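import Literature.NumberTheory.Sieve.MoebiusExpSum
import Literature.NumberTheory.Sieve.VinogradovExpSumTools
import Literature.NumberTheory.Sieve.MoebiusWalshCircuitsProofs
import Literature.NumberTheory.LFunctions.MoebiusTwoPowerModuli
import Literature.NumberTheory.LFunctions.MoebiusTwoPowerModuliProofs
import Literature.NumberTheory.LFunctions.SiegelWalfiszLiouville
import Literature.NumberTheory.LFunctions.LiouvilleSumExpSqrtBound
import Literature.NumberTheory.LFunctions.LiouvilleTwoPowerModuli
import Literature.Probability.RandomGraphs.LowDegree
import HarnessLib

/-!
# Green 2012, Proposition 1 for the Liouville function: Fourier–Walsh coefficients of `λ`, proved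

Topic `Literature/NumberTheory/LFunctions`. This file DISCHARGES the named fact
`Literature.NumberTheory.LFunctions.green_liouville_fourierWalsh` of `MoebiusWalshCircuits.lean`
(B. Green, *On (not) computing the Möbius function using bounded depth circuits*, Combin. Probab.
Comput. **21** (2012) 942–951 = arXiv:1103.4991 [Green2012], Proposition 1, in the `λ`-version of
his §1 remark "All of the results in this paper hold equally well for the Liouville function"):

> there are `c > 0` and `K` with `|Σ_{x ∈ {0,1}ⁿ} λ(val x) w_S(x)| / 2ⁿ ≤ K k e^{-c√n/k}` for every
> `n ≥ 1` and every non-empty `S ⊆ {0,…,n-1}`, `k = |S|`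

(`green_liouville_fourierWalsh_holds`, at the end of the file). Everything here is PROVED; the file
introduces no definitions and no named facts. Combined with the tree's
`Literature.NumberTheory.Sieve.green_liouville_AC0_of_fourierWalsh`
(`Sieve/MoebiusWalshCircuitsGreenProofs.lean`: Linial–Mansour–Nisan/Tal + Proposition 1 ⟹ Theorem 1)
it gives Green's Theorem 1 for `λ` (`Literature.NumberTheory.Sieve.green_liouville_AC0`).

## The printed proof and its rendering (arXiv numbering)

We follow Green's architecture step by step; the deep inputs are the tree's PROVED results.

* **Theorem 3** (`μ` twisted by characters to `2`-power moduli `2^t ≤ e^{c√log N}`; no exceptional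
  zero for such moduli) — the tree's named fact `green_moebius_character_twoPower`, proved in
  `MoebiusTwoPowerModuliProofs.lean` (`green_moebius_character_twoPower_holds`). Its `λ`-twin
  (`GreenWalsh.liouville_character_twoPower`) is deduced here through `λ = 𝟙_□ ⋆ μ`
  (`GreenWalsh.sum_liouville_char_eq`) exactly as in the tree's untwisted
  `LiouvilleSum.abs_sum_liouville_le_eventually_expSqrt`.
* **Corollary 1 → "λ in progressions mod 2^t"** (`GreenWalsh.norm_sum_progression_le`): instead of
  passing to additive characters we bound `Σ_{x<X, x≡r (2^t)} λ(x)` directly, by induction on `t`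
  (odd residues: orthogonality of characters mod `2^t`, `GreenWalsh.norm_sum_filter_le_of_char`;
  even residues: `λ(2z) = -λ(z)`, `GreenWalsh.liouville_two_mul`), with a bound uniform in `X ≤ N`
  (`GreenWalsh.char_bound_uniform`).
* **Corollary 2** (`GreenWalsh.liouville_near_dyadic`): for `|θ - a/2^t| ≤ e^{c₄√log N}/N`,
  `2^t ≤ e^{c₄√log N}`, `|Σ_{x<N} λ(x)e(θx)| ≤ K₄ N e^{-c₄√log N}` — Green's blocks of length `L`
  on which `e(θx)` is nearly constant on each progression mod `2^t`
  (`GreenWalsh.norm_expSum_le_of_progressions`).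
* **Proposition 4** (Green: "a well-known estimate for the exponential sum over the Möbius
  function"; Davenport, Iwaniec–Kowalski Thm 13.9): for `μ` this is the tree's
  `Literature.NumberTheory.Sieve.MoebiusExpSum.norm_afExpSum_moebius_le` (Vaughan's identity), used
  through `GreenWalsh.vinogradov_moebius` and inverted with Dirichlet's approximation theorem in
  `GreenWalsh.exists_rat_near_of_large_moebiusExpSum`; for `λ` (`λ = 𝟙_□ ⋆ μ`, pigeonholing the
  square part) `GreenWalsh.exists_near_rat_of_large_liouvilleExpSum`.
* **Lemma 1** (Harman–Kátai: a sparse dyadic rational near `a/q`, `q` small, has `q` a power of two)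
  — `GreenWalsh.harmanKatai`, with the pigeonhole gap `GreenWalsh.exists_gap`.
* **Proposition 3 for `λ`** (`GreenWalsh.prop3_liouville`): `|Σ_{x<2ⁿ} λ(x)e(θx)| ≤ K₁2ⁿe^{-c₁√log 2ⁿ}`
  for `θ = Σ_{j∈S} h_j/2^{j+1}`, `|S| ≤ c₅√n`, `|h_j| ≤ e^{c₁√log 2ⁿ}` — Proposition 4 gives `a/q`,
  Lemma 1 makes `q` a power of two, Corollary 2 finishes (growth bookkeeping in
  `GreenWalsh.prop3_cond`, `GreenWalsh.prop3_gap`).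
* **Proposition 2 (Kátai's argument)** (`GreenWalsh.katai`, for any `1`-bounded `f`): a large
  Fourier–Walsh coefficient at `S` forces a large exponential sum at some sparse dyadic rational
  `Σ_{j∈S} h_j/2^{j+1}`, `|h_j| ≤ 2200k²/δ²`, of size `≥ (δ/2)(δ²/6600k²)^k 2ⁿ`. Green smooths the
  square wave `ψ` by convolution on `ℝ/ℤ`; we smooth DISCRETELY: the digit sign of weight `2^j` is a
  square wave of period `P = 2^{j+1}` on `ℕ` (`GreenWalsh.sgn_testBit_eq`), replaced by a box
  average over a window `W ≈ P/D` (`D = 2^d ≈ 32k/δ`), which changes it only near the two jumps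
  (`GreenWalsh.squareWave_shift_ne_subset`, `GreenWalsh.sum_norm_boxSmooth_sub_le`: `L¹`-error
  `≤ 2W/P · N`), has Fourier coefficients `≪ P/(hW) · 1/h`-decay (`GreenWalsh.norm_boxSmooth_coeff_le`,
  finite Fourier inversion `GreenWalsh.fourier_inversion` on `ℤ/Pℤ`) so that truncating to
  `P‖h/P‖ ≤ H₀` costs `≪ D/H₀` (`GreenWalsh.norm_boxSmooth_sub_trunc_le`, `GreenWalsh.sum_inv_min_sq_le`);
  the per-digit package is `GreenWalsh.digit_package`, the product expansion and pigeonholing are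
  `GreenWalsh.norm_prod_sub_prod_le`, `GreenWalsh.exists_norm_ge_div_card`.
* **Proposition 1** (`green_liouville_fourierWalsh_holds`): with `δ = K k e^{-c√n/k}`,
  `c = c₁√(log 2)/10`, `K ≥ 82` large, either the bound is trivial (`δ ≥ 1`), or Proposition 2
  produces a sparse dyadic `θ` with numerators `≤ e^{c₁√log 2ⁿ}` and `|Σ λ(x)e(θx)| ≥ ½e^{-3c√n}2ⁿ`,
  contradicting Proposition 3 (`K₁e^{-10c√n}2ⁿ`) for `n` large; small `n` and `k > c₅√n` are
  absorbed into `K`.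

Constants are explicit but not optimised (Green: "we have not bothered to optimise the exponents").

## References

* B. Green, *On (not) computing the Möbius function using bounded depth circuits*, Combin. Probab.
  Comput. 21 (2012) 942–951; arXiv:1103.4991. Theorem 3, Corollaries 1–2, Lemma 1,
  Propositions 1–4 [Green2012].
* I. Kátai, *Distribution of digits of primes in q-ary canonical form*, Acta Math. Hungar. 47
  (1986) 341–359; G. Harman, I. Kátai, *Primes with preassigned digits II*, Acta Arith. 133 (2008)
  171–184 (as cited by Green for Proposition 2 and Lemma 1).
* H. Iwaniec, E. Kowalski, *Analytic Number Theory*, AMS Coll. Publ. 53 (2004), Theorem 13.9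
  [IwaniecKowalski2004].
* H. L. Montgomery, R. C. Vaughan, *Multiplicative Number Theory I*, CUP 2007, §11.3
  [MontgomeryVaughan2007].
-/

noncomputable section

open Finset Real ArithmeticFunction
open scoped FourierTransform ArithmeticFunction.Moebius ArithmeticFunction.zeta

namespace Literature.NumberTheory.LFunctions

namespace GreenWalsh

open Literature.NumberTheory.Sieve.Vinogradov (afExpSum norm_afExpSum_le norm_fourierChar)

/-! ### Green 2012, Proposition 4 for `μ` (minor arcs, from the tree's Vaughan-identity bound) -/

/-- The tree's minor-arc bound for `Σ_{n≤N} μ(n)e(nα)`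
(`Literature.NumberTheory.Sieve.MoebiusExpSum.norm_afExpSum_moebius_le`, Vaughan's identity) in the
factor order used below: `|α − a/q| ≤ q⁻²`, `(a,q) = 1`, `q ≤ N` ⟹
`‖Σ μ(n)e(nα)‖ ≤ 4096 (N/√q + N^{9/10} + √N√q)(log N)⁴`. [cite: IwaniecKowalski2004, Theorem 13.9] -/
theorem vinogradov_moebius {α : ℝ} {a : ℤ} {q : ℕ} (hq : 1 ≤ q) (hcop : IsCoprime a q)
    (hα : |α - a / q| ≤ 1 / (q : ℝ) ^ 2) {N : ℕ} (hN : 3 ≤ N) (hqN : q ≤ N) :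
    ‖afExpSum (fun n => (μ n : ℝ)) N α‖ ≤
      4096 * ((N : ℝ) / Real.sqrt q + (N : ℝ) ^ (9 / 10 : ℝ) + Real.sqrt N * Real.sqrt q) * Real.log N ^ 4 := by
  have h := Literature.NumberTheory.Sieve.MoebiusExpSum.norm_afExpSum_moebius_le hq hcop hα
    (le_trans (by norm_num) hN) hqN
  exact h.trans (le_of_eq (by ring))

/-! ### Green 2012, Proposition 4: large sum ⇒ frequency near a rational with small denominator -/

/-- **Green 2012, Proposition 4 (for `μ`, explicit)**: let `N ≥ 3`, `0 < δ`,
`12288 (log N)⁴ N^{9/10} ≤ δ N` and suppose `‖∑_{n ≤ N} μ(n) e(nθ)‖ ≥ δ N`. Then there is a rational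
`r` (in lowest terms) with `den r ≤ 12288² (log N)⁸/δ²` and `|θ − r| ≤ 12288² (log N)⁸/(δ² N)`.
Proof as printed: Dirichlet's approximation theorem with `Q = δ²N/(12288² (log N)⁸)`
(Mathlib `Real.exists_rat_abs_sub_le_and_den_le`) and the minor-arc bound
`norm_moebiusExpSum_le`, the alternative `√q ≥ …` being excluded by the choice of `Q`.
[cite: Green2012, Proposition 4] -/
theorem exists_rat_near_of_large_moebiusExpSum {N : ℕ} (hN : 3 ≤ N) {δ : ℝ} (hδ : 0 < δ)
    (hδN : 12288 * Real.log N ^ 4 * (N : ℝ) ^ (9 / 10 : ℝ) ≤ δ * N) {θ : ℝ}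
    (hlarge : δ * N ≤ ‖afExpSum (fun n => (μ n : ℝ)) N θ‖) :
    ∃ r : ℚ, (r.den : ℝ) ≤ 12288 ^ 2 * Real.log N ^ 8 / δ ^ 2 ∧
      |θ - r| ≤ 12288 ^ 2 * Real.log N ^ 8 / (δ ^ 2 * N) := by
  have hN0 : (0 : ℝ) < N := by exact_mod_cast (lt_of_lt_of_le (by norm_num) hN)
  have hN1 : (1 : ℝ) ≤ N := by exact_mod_cast le_trans (by norm_num) hN
  have hL1 : 1 ≤ Real.log N := by
    rw [← Real.log_exp 1]
    refine Real.log_le_log (Real.exp_pos 1) ?_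
    have := Real.exp_one_lt_d9
    have h3 : (3 : ℝ) ≤ N := by exact_mod_cast hN
    linarith
  have hL0 : 0 < Real.log N := by linarith
  set L : ℝ := Real.log N with hLdef
  -- the trivial bound gives `δ ≤ 1`
  have htriv : ‖afExpSum (fun n => (μ n : ℝ)) N θ‖ ≤ N := by
    refine (norm_afExpSum_le _ N θ).trans ?_
    calc ∑ n ∈ Icc 1 N, |(μ n : ℝ)| ≤ ∑ _n ∈ Icc 1 N, (1 : ℝ) :=
          Finset.sum_le_sum fun n _ => by exact_mod_cast ArithmeticFunction.abs_moebius_le_one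
      _ = N := by simp
  have hδ1 : δ ≤ 1 := by
    have := hlarge.trans htriv
    nlinarith
  -- Dirichlet
  set C₀ : ℝ := 12288 ^ 2 * L ^ 8 with hC₀
  have hC₀0 : 0 < C₀ := by positivity
  set Q : ℝ := δ ^ 2 * N / C₀ with hQ
  have hQ0 : 0 < Q := by positivity
  -- `Q ≥ 1`
  have h910 : (N : ℝ) ^ (9 / 10 : ℝ) * (N : ℝ) ^ (1 / 10 : ℝ) = N := by
    rw [← Real.rpow_add hN0]; norm_num
  have hN110 : 1 ≤ (N : ℝ) ^ (1 / 10 : ℝ) := Real.one_le_rpow hN1 (by norm_num)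
  have hδL : 12288 * L ^ 4 ≤ δ * (N : ℝ) ^ (1 / 10 : ℝ) := by
    have h1 : 12288 * L ^ 4 * (N : ℝ) ^ (9 / 10 : ℝ) ≤ δ * (N : ℝ) ^ (1 / 10 : ℝ) * (N : ℝ) ^ (9 / 10 : ℝ) := by
      calc 12288 * L ^ 4 * (N : ℝ) ^ (9 / 10 : ℝ) ≤ δ * N := hδN
        _ = δ * (N : ℝ) ^ (1 / 10 : ℝ) * (N : ℝ) ^ (9 / 10 : ℝ) := by rw [mul_assoc, mul_comm ((N:ℝ)^(1/10:ℝ)), h910]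
    exact le_of_mul_le_mul_right h1 (Real.rpow_pos_of_pos hN0 _)
  have hQ1 : 1 ≤ Q := by
    rw [hQ, le_div_iff₀ hC₀0, one_mul, hC₀]
    -- `12288² L⁸ ≤ (δ N^{1/10})² ≤ δ² N`
    have h1 : (12288 * L ^ 4) ^ 2 ≤ (δ * (N : ℝ) ^ (1 / 10 : ℝ)) ^ 2 :=
      pow_le_pow_left₀ (by positivity) hδL 2
    have h2 : ((N : ℝ) ^ (1 / 10 : ℝ)) ^ 2 ≤ N := by
      rw [← Real.rpow_natCast, ← Real.rpow_mul hN0.le]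
      norm_num
      calc (N : ℝ) ^ (1 / 5 : ℝ) ≤ (N : ℝ) ^ (1 : ℝ) := Real.rpow_le_rpow_of_exponent_le hN1 (by norm_num)
        _ = N := Real.rpow_one _
    calc (12288 : ℝ) ^ 2 * L ^ 8 = (12288 * L ^ 4) ^ 2 := by ring
      _ ≤ (δ * (N : ℝ) ^ (1 / 10 : ℝ)) ^ 2 := h1
      _ = δ ^ 2 * ((N : ℝ) ^ (1 / 10 : ℝ)) ^ 2 := by ring
      _ ≤ δ ^ 2 * N := mul_le_mul_of_nonneg_left h2 (by positivity)
  set n : ℕ := ⌊Q⌋₊ with hn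
  have hn1 : 0 < n := Nat.floor_pos.2 hQ1
  have hnQ : (n : ℝ) ≤ Q := Nat.floor_le hQ0.le
  have hQn : Q < n + 1 := Nat.lt_floor_add_one Q
  obtain ⟨r, hr, hrden⟩ := Real.exists_rat_abs_sub_le_and_den_le θ hn1
  have hden0 : (0 : ℝ) < r.den := by exact_mod_cast r.den_pos
  have hden1 : (1 : ℝ) ≤ r.den := by exact_mod_cast r.den_pos
  have hdenQ : (r.den : ℝ) ≤ Q := le_trans (by exact_mod_cast hrden) hnQ
  -- `|θ − r| ≤ 1/(Q den) ≤ 1/den²`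
  have hr1 : |θ - r| ≤ 1 / (Q * r.den) := by
    refine hr.trans ?_
    exact div_le_div_of_nonneg_left zero_le_one (by positivity) (mul_le_mul_of_nonneg_right hQn.le hden0.le)
  have hr2 : |θ - (r.num : ℝ) / r.den| ≤ 1 / (r.den : ℝ) ^ 2 := by
    rw [← Rat.cast_def]
    refine hr1.trans ?_
    rw [sq]
    exact div_le_div_of_nonneg_left zero_le_one (by positivity) (mul_le_mul_of_nonneg_right hdenQ hden0.le)
  -- `Q ≤ N` hence `den ≤ N`
  have hQN : Q ≤ N := by
    rw [hQ, div_le_iff₀ hC₀0]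
    have h1 : δ ^ 2 ≤ 1 := pow_le_one₀ hδ.le hδ1
    have h2 : (1 : ℝ) ≤ C₀ := by
      rw [hC₀]; have := one_le_pow₀ (n := 8) hL1; nlinarith
    calc δ ^ 2 * N ≤ 1 * N := mul_le_mul_of_nonneg_right h1 hN0.le
      _ ≤ N * C₀ := by rw [one_mul]; exact le_mul_of_one_le_right hN0.le h2
  have hdenN : r.den ≤ N := by
    have : (r.den : ℝ) ≤ N := hdenQ.trans hQN
    exact_mod_cast this
  -- Vinogradov
  have hcop : IsCoprime r.num (r.den : ℤ) := by
    rw [Int.isCoprime_iff_gcd_eq_one, Int.gcd_eq_natAbs, Int.natAbs_natCast]; exact r.reduced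
  have hV := vinogradov_moebius (q := r.den) r.den_pos hcop hr2 hN hdenN
  -- the three terms
  have hsqrtQ : Real.sqrt N * Real.sqrt Q = δ * N / (12288 * L ^ 4) := by
    rw [← Real.sqrt_mul hN0.le, hQ, hC₀]
    rw [show (N : ℝ) * (δ ^ 2 * N / (12288 ^ 2 * L ^ 8)) = (δ * N / (12288 * L ^ 4)) ^ 2 by field_simp]
    exact Real.sqrt_sq (by positivity)
  have hT3 : 4096 * (Real.sqrt N * Real.sqrt r.den) * L ^ 4 ≤ δ * N / 3 := by
    calc 4096 * (Real.sqrt N * Real.sqrt r.den) * L ^ 4 ≤ 4096 * (Real.sqrt N * Real.sqrt Q) * L ^ 4 := by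
          gcongr
      _ = δ * N / 3 := by rw [hsqrtQ]; field_simp; ring
  have hT2 : 4096 * (N : ℝ) ^ (9 / 10 : ℝ) * L ^ 4 ≤ δ * N / 3 := by
    have := hδN; nlinarith
  have hkey : δ * N / 3 ≤ 4096 * ((N : ℝ) / Real.sqrt r.den) * L ^ 4 := by
    have h := hlarge.trans hV
    nlinarith [hT2, hT3]
  -- `√den ≤ 12288 L⁴/δ`
  have hsq : Real.sqrt r.den ≤ 12288 * L ^ 4 / δ := by
    have hs0 : 0 < Real.sqrt r.den := Real.sqrt_pos.2 hden0
    rw [le_div_iff₀ hδ]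
    have h1 : δ * N / 3 * Real.sqrt r.den ≤ 4096 * N * L ^ 4 := by
      calc δ * N / 3 * Real.sqrt r.den ≤ 4096 * ((N : ℝ) / Real.sqrt r.den) * L ^ 4 * Real.sqrt r.den :=
            mul_le_mul_of_nonneg_right hkey hs0.le
        _ = 4096 * N * L ^ 4 := by field_simp
    nlinarith
  refine ⟨r, ?_, ?_⟩
  · calc (r.den : ℝ) = Real.sqrt r.den ^ 2 := (Real.sq_sqrt hden0.le).symm
      _ ≤ (12288 * L ^ 4 / δ) ^ 2 := pow_le_pow_left₀ (Real.sqrt_nonneg _) hsq 2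
      _ = 12288 ^ 2 * L ^ 8 / δ ^ 2 := by field_simp
  · refine hr1.trans ?_
    calc 1 / (Q * r.den) ≤ 1 / Q := div_le_div_of_nonneg_left zero_le_one hQ0 (le_mul_of_one_le_right hQ0.le hden1)
      _ = 12288 ^ 2 * L ^ 8 / (δ ^ 2 * N) := by rw [hQ, hC₀]; field_simp


open SiegelWalfiszLiouville (sum_Ioc_sum_divisorsAntidiagonal_eq liouville_eq_sum_antidiagonal
  sum_Ioc_inv_sq_le sum_Ioc_inv_sq_le_two filter_isSquare_Ioc_eq_image)

/-! ### From `μχ` to `λχ` for characters to `2`-power moduli -/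

/-- `∑_{x < N} f(x) = ∑_{0 < n ≤ N − 1} f(n)` when `f(0) = 0`. [folklore] -/
theorem sum_range_eq_sum_Ioc_pred {M : Type*} [AddCommMonoid M] (f : ℕ → M) (h0 : f 0 = 0) (N : ℕ) :
    ∑ x ∈ range N, f x = ∑ n ∈ Ioc 0 (N - 1), f n := by
  cases N with
  | zero => simp
  | succ N =>
      rw [Finset.range_eq_Ico, Finset.Ico_add_one_right_eq_Icc, Finset.Icc_eq_cons_Ioc (Nat.zero_le N),
        Finset.sum_cons, h0, zero_add]
      rfl

/-- **`∑_{0 < n ≤ N} λ(n)χ(n) = ∑_{0 < s ≤ N} 𝟙_□(s) χ(s) ∑_{0 < m ≤ N/s} μ(m)χ(m)`** (`λ = 𝟙_□ ⋆ μ`).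
[folklore] -/
theorem sum_liouville_char_eq {q : ℕ} (χ : DirichletCharacter ℂ q) (N : ℕ) :
    ∑ n ∈ Ioc 0 N, ((liouville n : ℤ) : ℂ) * χ (n : ZMod q) =
      ∑ s ∈ Ioc 0 N, (if IsSquare s then (1 : ℂ) else 0) * χ (s : ZMod q) *
        ∑ m ∈ Ioc 0 (N / s), ((μ m : ℤ) : ℂ) * χ (m : ZMod q) := by
  have h1 : ∀ n ∈ Ioc 0 N, ((liouville n : ℤ) : ℂ) * χ (n : ZMod q)
      = ∑ x ∈ n.divisorsAntidiagonal,
          (if IsSquare x.1 then (1 : ℂ) else 0) * χ (x.1 : ZMod q) * (((μ x.2 : ℤ) : ℂ) * χ (x.2 : ZMod q)) := by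
    intro n hn
    have hl := liouville_eq_sum_antidiagonal n
    have hl' : ((liouville n : ℤ) : ℂ) =
        ∑ x ∈ n.divisorsAntidiagonal, (if IsSquare x.1 then (1 : ℂ) else 0) * ((μ x.2 : ℤ) : ℂ) := by
      have h2 := congrArg Complex.ofReal hl
      rw [Complex.ofReal_intCast, Complex.ofReal_sum] at h2
      rw [h2]
      refine Finset.sum_congr rfl fun x _ => ?_
      rw [Complex.ofReal_mul, Complex.ofReal_intCast]
      split_ifs <;> simp
    rw [hl', Finset.sum_mul]
    refine Finset.sum_congr rfl fun x hx => ?_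
    rw [Nat.mem_divisorsAntidiagonal] at hx
    rw [← hx.1, Nat.cast_mul, map_mul]
    ring
  rw [Finset.sum_congr rfl h1, sum_Ioc_sum_divisorsAntidiagonal_eq
    (fun s m => (if IsSquare s then (1 : ℂ) else 0) * χ (s : ZMod q) * (((μ m : ℤ) : ℂ) * χ (m : ZMod q))) N]
  refine Finset.sum_congr rfl fun s _ => ?_
  rw [Finset.mul_sum]

set_option maxHeartbeats 400000 in
/-- **Liouville twisted by characters to `2`-power moduli** (Green 2012, Theorem 3 with the
Liouville remark of p. 3), from the Möbius statement `green_moebius_character_twoPower` through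
`λ = 𝟙_□ ⋆ μ`: there are `c > 0`, `K` with `‖∑_{x < N} λ(x)χ(x)‖ ≤ K N e^{−c√log N}` for all `t, N`,
all `χ` mod `2^t` with `2^t ≤ e^{c√log N}` (squares `s ≤ √N` by the Möbius bound at `N/s ≥ √N`,
the others trivially, `∑_{r > R} 1/r² ≤ 1/R`). [cite: Green2012, Theorem 3 and p. 3] -/
theorem liouville_character_twoPower (hY : green_moebius_character_twoPower) :
    ∃ c : ℝ, 0 < c ∧ ∃ K : ℝ, ∀ t N : ℕ, ∀ χ : DirichletCharacter ℂ (2 ^ t),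
      ((2 : ℝ) ^ t ≤ Real.exp (c * Real.sqrt (Real.log N))) →
        ‖∑ x ∈ range N, ((liouville x : ℤ) : ℂ) * χ (x : ZMod (2 ^ t))‖
          ≤ K * (N : ℝ) * Real.exp (-(c * Real.sqrt (Real.log N))) := by
  obtain ⟨c₂, hc₂, K₂, hK₂⟩ := hY
  -- WLOG `K₂ ≥ 0`
  have hK₂0 : 0 ≤ K₂ := by
    have h := hK₂ 0 1 1 (by simp)
    have h1 : ‖∑ x ∈ range 1, ((μ x : ℤ) : ℂ) * (1 : DirichletCharacter ℂ (2 ^ 0)) (x : ZMod (2 ^ 0))‖ = 0 := by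
      simp
    rw [h1] at h
    simp only [Nat.cast_one, mul_one] at h
    have hpos : 0 < Real.exp (-(c₂ * Real.sqrt (Real.log 1))) := Real.exp_pos _
    by_contra hneg
    push Not at hneg
    have := mul_neg_of_neg_of_pos hneg hpos
    linarith
  set c : ℝ := min (c₂ / 2) 1 with hcdef
  have hc0 : 0 < c := lt_min (by positivity) one_pos
  have hc1 : c ≤ c₂ / 2 := min_le_left _ _
  have hc1' : c ≤ 1 := min_le_right _ _
  set Ksmall : ℝ := Real.exp 6 with hKsmall
  refine ⟨c, hc0, 3 * K₂ + 1 + Ksmall, fun t N χ hq => ?_⟩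
  set L : ℝ := Real.log N with hL
  set E : ℝ := Real.exp (-(c * Real.sqrt L)) with hEdef
  have hE0 : 0 < E := Real.exp_pos _
  have hN0 : (0 : ℝ) ≤ N := Nat.cast_nonneg N
  -- the trivial bound
  have htriv : ‖∑ x ∈ range N, ((liouville x : ℤ) : ℂ) * χ (x : ZMod (2 ^ t))‖ ≤ N := by
    calc ‖∑ x ∈ range N, ((liouville x : ℤ) : ℂ) * χ (x : ZMod (2 ^ t))‖
        ≤ ∑ x ∈ range N, ‖((liouville x : ℤ) : ℂ) * χ (x : ZMod (2 ^ t))‖ := norm_sum_le _ _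
      _ ≤ ∑ _x ∈ range N, (1 : ℝ) := by
          refine Finset.sum_le_sum fun x _ => ?_
          rw [norm_mul, Complex.norm_intCast]
          calc |(liouville x : ℝ)| * ‖χ (x : ZMod (2 ^ t))‖ ≤ 1 * 1 := by
                gcongr
                · exact LiouvilleSum.abs_liouville_le_one x
                · exact DirichletCharacter.norm_le_one χ _
            _ = 1 := one_mul _
      _ = N := by simp
  rcases lt_or_ge L 36 with hL36 | hL36
  · -- small `N`
    have h1 : 1 ≤ Ksmall * E := by
      rw [hKsmall, hEdef, ← Real.exp_add]
      refine Real.one_le_exp ?_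
      have hs : Real.sqrt L ≤ 6 := by
        rw [show (6 : ℝ) = Real.sqrt 36 by rw [show (36 : ℝ) = 6 ^ 2 by norm_num, Real.sqrt_sq (by norm_num)]]
        exact Real.sqrt_le_sqrt hL36.le
      nlinarith [Real.sqrt_nonneg L]
    calc ‖∑ x ∈ range N, ((liouville x : ℤ) : ℂ) * χ (x : ZMod (2 ^ t))‖ ≤ N := htriv
      _ ≤ N * (Ksmall * E) := le_mul_of_one_le_right hN0 h1
      _ = Ksmall * N * E := by ring
      _ ≤ (3 * K₂ + 1 + Ksmall) * N * E := by
          have : 0 ≤ (3 * K₂ + 1) * N * E := by positivity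
          nlinarith
  · -- large `N`: `L ≥ 36`
    have hN1 : (1 : ℝ) < N := by
      by_contra h
      push Not at h
      have : L ≤ 0 := by
        rcases h.eq_or_lt with h1 | h1
        · rw [hL, h1, Real.log_one]
        · exact Real.log_nonpos hN0 h
      linarith
    have hNpos : (0 : ℝ) < N := by linarith
    have hexpL : Real.exp L = N := by rw [hL, Real.exp_log hNpos]
    have hN36 : Real.exp 36 ≤ N := by rw [← hexpL]; exact Real.exp_le_exp.2 hL36
    have hNge : (64 : ℝ) ≤ N := by
      have : (64 : ℝ) ≤ Real.exp 36 := by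
        have h1 := Real.quadratic_le_exp_of_nonneg (show (0:ℝ) ≤ 36 by norm_num)
        nlinarith
      linarith
    have hNnat : 64 ≤ N := by exact_mod_cast hNge
    set N' : ℕ := N - 1 with hN'
    have hN'2 : 2 ≤ N' := by omega
    have hNN' : N = N' + 1 := by omega
    -- Step 1: rearrangement over squares
    rw [sum_range_eq_sum_Ioc_pred _ (by simp) N, sum_liouville_char_eq]
    set S : ℕ → ℂ := fun M => ∑ m ∈ Ioc 0 M, ((μ m : ℤ) : ℂ) * χ (m : ZMod (2 ^ t)) with hSdef
    set R₁ : ℕ := Nat.sqrt N' with hR₁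
    set R₀ : ℕ := Nat.sqrt R₁ with hR₀
    have hR₁1 : 1 ≤ R₁ := Nat.sqrt_pos.2 (by omega)
    have hR₀1 : 1 ≤ R₀ := Nat.sqrt_pos.2 hR₁1
    have hR₀R₁ : R₀ ≤ R₁ := Nat.sqrt_le_self R₁
    have hstep1 : ‖∑ s ∈ Ioc 0 (N - 1), (if IsSquare s then (1 : ℂ) else 0) * χ (s : ZMod (2 ^ t)) *
        S ((N - 1) / s)‖ ≤ ∑ r ∈ Ioc 0 R₁, ‖S (N' / (r * r))‖ := by
      calc ‖∑ s ∈ Ioc 0 (N - 1), (if IsSquare s then (1 : ℂ) else 0) * χ (s : ZMod (2 ^ t)) * S ((N - 1) / s)‖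
          ≤ ∑ s ∈ Ioc 0 N', ‖(if IsSquare s then (1 : ℂ) else 0) * χ (s : ZMod (2 ^ t)) * S (N' / s)‖ :=
            norm_sum_le _ _
        _ ≤ ∑ s ∈ Ioc 0 N', (if IsSquare s then ‖S (N' / s)‖ else 0) := by
            refine Finset.sum_le_sum fun s _ => ?_
            split_ifs with hsq
            · rw [one_mul, norm_mul]
              calc ‖χ (s : ZMod (2 ^ t))‖ * ‖S (N' / s)‖ ≤ 1 * ‖S (N' / s)‖ :=
                    mul_le_mul_of_nonneg_right (DirichletCharacter.norm_le_one χ _) (norm_nonneg _)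
                _ = ‖S (N' / s)‖ := one_mul _
            · simp
        _ = ∑ s ∈ (Ioc 0 N').filter IsSquare, ‖S (N' / s)‖ := by rw [Finset.sum_filter]
        _ = ∑ r ∈ Ioc 0 R₁, ‖S (N' / (r * r))‖ := by
            rw [filter_isSquare_Ioc_eq_image, Finset.sum_image]
            intro x hx y hy hxy
            exact Nat.mul_self_inj.mp hxy
    refine hstep1.trans ?_
    rw [← Finset.sum_Ioc_consecutive _ (Nat.zero_le R₀) hR₀R₁]
    -- Step 2: `r ≤ R₀`, the Möbius bound
    have hR₁sq : R₁ * R₁ ≤ N' := Nat.sqrt_le N'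
    have hN'lt : N' < (R₁ + 1) * (R₁ + 1) := Nat.lt_succ_sqrt N'
    have hR₀sq : R₀ * R₀ ≤ R₁ := Nat.sqrt_le R₁
    have hR₁lt : R₁ < (R₀ + 1) * (R₀ + 1) := Nat.lt_succ_sqrt R₁
    have hsmall : ∀ r ∈ Ioc 0 R₀, ‖S (N' / (r * r))‖ ≤ K₂ * ((N : ℝ) / ((r : ℝ) * r) + 1) * E := by
      intro r hr
      have hr0 : 0 < r := (Finset.mem_Ioc.1 hr).1
      have hrR : r ≤ R₀ := (Finset.mem_Ioc.1 hr).2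
      set M : ℕ := N' / (r * r) with hM
      have hrr : r * r ≤ R₁ := le_trans (Nat.mul_le_mul hrR hrR) hR₀sq
      have hrr0 : 0 < r * r := Nat.mul_pos hr0 hr0
      -- `M ≥ R₁`
      have hMR : R₁ ≤ M := by
        rw [hM]
        calc R₁ ≤ N' / R₁ := (Nat.le_div_iff_mul_le (by omega)).2 hR₁sq
          _ ≤ N' / (r * r) := Nat.div_le_div_left hrr hrr0
      -- `(M+1)^4 ≥ N`
      have hM4 : N ≤ (M + 1) ^ 4 := by
        have h1 : N' < (M + 1) * (M + 1) := lt_of_lt_of_le hN'lt (Nat.mul_le_mul (by omega) (by omega))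
        have h2 : (M + 1) ^ 4 = ((M + 1) * (M + 1)) * ((M + 1) * (M + 1)) := by ring
        rw [h2]
        have h3 : N ≤ N' * N' := by nlinarith
        exact h3.trans (Nat.mul_le_mul h1.le h1.le)
      -- the range condition at `M + 1`
      have hM1 : (1 : ℝ) ≤ ((M + 1 : ℕ) : ℝ) := by exact_mod_cast Nat.succ_pos M
      have hlogM : Real.log N ≤ 4 * Real.log ((M + 1 : ℕ) : ℝ) := by
        have e : Real.log (((M + 1 : ℕ) : ℝ) ^ 4) = 4 * Real.log ((M + 1 : ℕ) : ℝ) := by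
          rw [Real.log_pow]; norm_num
        rw [← e]
        exact Real.log_le_log hNpos (by exact_mod_cast hM4)
      have hsqrtM : Real.sqrt L ≤ 2 * Real.sqrt (Real.log ((M + 1 : ℕ) : ℝ)) := by
        rw [show (2 : ℝ) = Real.sqrt 4 by rw [show (4:ℝ) = 2 ^ 2 by norm_num, Real.sqrt_sq (by norm_num)],
          ← Real.sqrt_mul (by norm_num)]
        exact Real.sqrt_le_sqrt (by rw [hL]; linarith)
      have hrange : (2 : ℝ) ^ t ≤ Real.exp (c₂ * Real.sqrt (Real.log ((M + 1 : ℕ) : ℝ))) := by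
        refine hq.trans (Real.exp_le_exp.2 ?_)
        calc c * Real.sqrt L ≤ (c₂ / 2) * (2 * Real.sqrt (Real.log ((M + 1 : ℕ) : ℝ))) :=
              mul_le_mul hc1 hsqrtM (Real.sqrt_nonneg _) (by positivity)
          _ = c₂ * Real.sqrt (Real.log ((M + 1 : ℕ) : ℝ)) := by ring
      have hYM := hK₂ t (M + 1) χ hrange
      have hSM : S M = ∑ x ∈ range (M + 1), ((μ x : ℤ) : ℂ) * χ (x : ZMod (2 ^ t)) := by
        rw [sum_range_eq_sum_Ioc_pred _ (by simp) (M + 1)]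
        rfl
      have hEM : Real.exp (-(c₂ * Real.sqrt (Real.log ((M + 1 : ℕ) : ℝ)))) ≤ E := by
        rw [hEdef]
        refine Real.exp_le_exp.2 (neg_le_neg ?_)
        calc c * Real.sqrt L ≤ (c₂ / 2) * (2 * Real.sqrt (Real.log ((M + 1 : ℕ) : ℝ))) :=
              mul_le_mul hc1 hsqrtM (Real.sqrt_nonneg _) (by positivity)
          _ = c₂ * Real.sqrt (Real.log ((M + 1 : ℕ) : ℝ)) := by ring
      have hMle : ((M + 1 : ℕ) : ℝ) ≤ (N : ℝ) / ((r : ℝ) * r) + 1 := by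
        push_cast
        refine add_le_add ?_ le_rfl
        rw [hM]
        calc ((N' / (r * r) : ℕ) : ℝ) ≤ (N' : ℝ) / ((r * r : ℕ) : ℝ) := Nat.cast_div_le
          _ ≤ (N : ℝ) / ((r : ℝ) * r) := by
              rw [Nat.cast_mul]
              exact div_le_div_of_nonneg_right (by exact_mod_cast Nat.sub_le N 1) (by positivity)
      calc ‖S M‖ = ‖∑ x ∈ range (M + 1), ((μ x : ℤ) : ℂ) * χ (x : ZMod (2 ^ t))‖ := by rw [hSM]
        _ ≤ K₂ * ((M + 1 : ℕ) : ℝ) * Real.exp (-(c₂ * Real.sqrt (Real.log ((M + 1 : ℕ) : ℝ)))) := hYM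
        _ ≤ K₂ * ((N : ℝ) / ((r : ℝ) * r) + 1) * E :=
            mul_le_mul (mul_le_mul_of_nonneg_left hMle hK₂0) hEM (Real.exp_pos _).le (by positivity)
    have hpart1 : ∑ r ∈ Ioc 0 R₀, ‖S (N' / (r * r))‖ ≤ 3 * K₂ * N * E := by
      refine (Finset.sum_le_sum hsmall).trans ?_
      have hsum : ∑ r ∈ Ioc 0 R₀, K₂ * ((N : ℝ) / ((r : ℝ) * r) + 1) * E =
          K₂ * E * (N * ∑ r ∈ Ioc 0 R₀, (1 : ℝ) / (r : ℝ) ^ 2 + R₀) := by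
        have e : ∀ r : ℕ, K₂ * ((N : ℝ) / ((r : ℝ) * r) + 1) * E =
            K₂ * E * N * ((1 : ℝ) / (r : ℝ) ^ 2) + K₂ * E := by
          intro r; rw [sq]; ring
        simp_rw [e]
        rw [Finset.sum_add_distrib, Finset.sum_const, Nat.card_Ioc, Nat.sub_zero, ← Finset.mul_sum, nsmul_eq_mul]
        ring
      rw [hsum]
      have h2 := sum_Ioc_inv_sq_le_two R₀
      have hR₀N : (R₀ : ℝ) ≤ N := by
        have : R₀ ≤ N := le_trans hR₀R₁ ((Nat.sqrt_le_self N').trans (by omega))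
        exact_mod_cast this
      have hKE : 0 ≤ K₂ * E := by positivity
      calc K₂ * E * (N * ∑ r ∈ Ioc 0 R₀, (1 : ℝ) / (r : ℝ) ^ 2 + R₀) ≤ K₂ * E * (N * 2 + N) := by
            refine mul_le_mul_of_nonneg_left (add_le_add ?_ hR₀N) hKE
            exact mul_le_mul_of_nonneg_left h2 hN0
        _ = 3 * K₂ * N * E := by ring
    -- Step 3: `R₀ < r ≤ R₁`, trivially
    have hNN'r : (N' : ℝ) ≤ N := by exact_mod_cast Nat.sub_le N 1
    have hbig : ∀ r ∈ Ioc R₀ R₁, ‖S (N' / (r * r))‖ ≤ (N : ℝ) * ((1 : ℝ) / (r : ℝ) ^ 2) := by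
      intro r hr
      have hr0 : 0 < r := lt_of_le_of_lt (Nat.zero_le _) (Finset.mem_Ioc.1 hr).1
      have hr0' : (0 : ℝ) < r := by exact_mod_cast hr0
      have h1 : ‖S (N' / (r * r))‖ ≤ ((N' / (r * r) : ℕ) : ℝ) := LiouvilleTwoPower.norm_sum_moebius_mul_character_le χ (N' / (r * r))
      have h2 : ((N' / (r * r) : ℕ) : ℝ) ≤ (N' : ℝ) / ((r * r : ℕ) : ℝ) := Nat.cast_div_le
      have h3 : (N' : ℝ) / ((r * r : ℕ) : ℝ) ≤ (N : ℝ) * (1 / (r : ℝ) ^ 2) := by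
        rw [mul_one_div, sq, Nat.cast_mul]
        exact div_le_div_of_nonneg_right hNN'r (by positivity)
      linarith
    have hinvR₀ : (1 : ℝ) / R₀ ≤ E := by
      -- `R₀⁴ ≥ N/32 ≥ e^{4c√L} = E⁻⁴`
      have h1 : N < 32 * R₀ ^ 4 := by
        have hA : R₁ + 1 ≤ (R₀ + 1) * (R₀ + 1) := hR₁lt
        have hB : N' < ((R₀ + 1) * (R₀ + 1)) * ((R₀ + 1) * (R₀ + 1)) :=
          lt_of_lt_of_le hN'lt (Nat.mul_le_mul hA hA)
        have hC : (R₀ + 1) ≤ 2 * R₀ := by omega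
        have hD : ((R₀ + 1) * (R₀ + 1)) * ((R₀ + 1) * (R₀ + 1)) ≤ 16 * R₀ ^ 4 := by
          calc ((R₀ + 1) * (R₀ + 1)) * ((R₀ + 1) * (R₀ + 1)) = (R₀ + 1) ^ 4 := by ring
            _ ≤ (2 * R₀) ^ 4 := Nat.pow_le_pow_left hC 4
            _ = 16 * R₀ ^ 4 := by ring
        omega
      have h1' : (N : ℝ) ≤ 32 * (R₀ : ℝ) ^ 4 := by exact_mod_cast h1.le
      have hlog32 : Real.log 32 ≤ 7 / 2 := by
        have : Real.log 32 = 5 * Real.log 2 := by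
          rw [show (32 : ℝ) = 2 ^ 5 by norm_num, Real.log_pow]; norm_num
        rw [this]; have := Real.log_two_lt_d9; linarith
      have hsqrtL : 6 ≤ Real.sqrt L := by
        rw [show (6 : ℝ) = Real.sqrt 36 by rw [show (36 : ℝ) = 6 ^ 2 by norm_num, Real.sqrt_sq (by norm_num)]]
        exact Real.sqrt_le_sqrt hL36
      have hkey : 4 * (c * Real.sqrt L) ≤ L - Real.log 32 := by
        have hsq := Real.sq_sqrt (show (0 : ℝ) ≤ L by linarith)
        nlinarith [mul_le_mul_of_nonneg_right hc1' (Real.sqrt_nonneg L)]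
      have hE4 : E⁻¹ ^ 4 ≤ (R₀ : ℝ) ^ 4 := by
        rw [hEdef, ← Real.exp_neg, neg_neg, ← Real.exp_nat_mul]
        push_cast
        have h2 : Real.exp (4 * (c * Real.sqrt L)) ≤ N / 32 := by
          rw [le_div_iff₀ (by norm_num), ← hexpL]
          calc Real.exp (4 * (c * Real.sqrt L)) * 32 = Real.exp (4 * (c * Real.sqrt L) + Real.log 32) := by
                rw [Real.exp_add, Real.exp_log (by norm_num)]
            _ ≤ Real.exp L := Real.exp_le_exp.2 (by linarith)
        linarith
      have hR₀pos : (0 : ℝ) < R₀ := by exact_mod_cast hR₀1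
      have hEinv : E⁻¹ ≤ R₀ := (pow_le_pow_iff_left₀ (by positivity) hR₀pos.le (by norm_num)).1 hE4
      rw [one_div]
      exact inv_le_of_inv_le₀ hE0 hEinv
    have hpart2 : ∑ r ∈ Ioc R₀ R₁, ‖S (N' / (r * r))‖ ≤ N * E := by
      refine (Finset.sum_le_sum hbig).trans ?_
      rw [← Finset.mul_sum]
      calc (N : ℝ) * ∑ r ∈ Ioc R₀ R₁, (1 : ℝ) / (r : ℝ) ^ 2 ≤ N * (1 / R₀) :=
            mul_le_mul_of_nonneg_left (sum_Ioc_inv_sq_le hR₀1 R₁) hN0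
        _ ≤ N * E := mul_le_mul_of_nonneg_left hinvR₀ hN0
    have hfin : 3 * K₂ * N * E + N * E ≤ (3 * K₂ + 1 + Ksmall) * N * E := by
      have : 0 ≤ Ksmall * N * E := by positivity
      nlinarith
    exact (add_le_add hpart1 hpart2).trans hfin

/-! ### `λ` in progressions to `2`-power moduli -/

/-- A progression to a unit residue through characters (orthogonality):
`∑_{x < X, x ≡ r} f(x) = φ(n)⁻¹ ∑_χ χ(r⁻¹) ∑_{x < X} f(x)χ(x)`. [folklore] -/
theorem sum_filter_eq_sum_char {n : ℕ} [NeZero n] {r : ZMod n} (hr : IsUnit r) (X : ℕ) (f : ℕ → ℂ) :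
    ∑ x ∈ (range X).filter (fun x : ℕ => (x : ZMod n) = r), f x =
      ((n.totient : ℂ))⁻¹ * ∑ χ : DirichletCharacter ℂ n, χ r⁻¹ * ∑ x ∈ range X, f x * χ (x : ZMod n) := by
  have hφ : (n.totient : ℂ) ≠ 0 := by exact_mod_cast (Nat.totient_pos.2 (NeZero.pos n)).ne'
  have hind : ∀ y : ZMod n, (if y = r then (1 : ℂ) else 0) =
      ((n.totient : ℂ))⁻¹ * ∑ χ : DirichletCharacter ℂ n, χ r⁻¹ * χ y := by
    intro y
    rw [DirichletCharacter.sum_char_inv_mul_char_eq ℂ hr y]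
    by_cases h : y = r
    · rw [if_pos h, if_pos h.symm, inv_mul_cancel₀ hφ]
    · rw [if_neg h, if_neg (Ne.symm h), mul_zero]
  rw [Finset.sum_filter]
  calc ∑ x ∈ range X, (if (x : ZMod n) = r then f x else 0)
      = ∑ x ∈ range X, (if (x : ZMod n) = r then (1 : ℂ) else 0) * f x := by
        refine Finset.sum_congr rfl fun x _ => ?_
        split_ifs <;> simp
    _ = ∑ x ∈ range X, ((n.totient : ℂ))⁻¹ * ∑ χ : DirichletCharacter ℂ n, χ r⁻¹ * (f x * χ (x : ZMod n)) := by
        refine Finset.sum_congr rfl fun x _ => ?_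
        rw [hind, Finset.mul_sum, Finset.mul_sum, Finset.sum_mul]
        refine Finset.sum_congr rfl fun χ _ => ?_
        ring
    _ = _ := by
        rw [← Finset.mul_sum, Finset.sum_comm]
        congr 1
        refine Finset.sum_congr rfl fun χ _ => ?_
        rw [Finset.mul_sum]

/-- The number of Dirichlet characters mod `n` with complex values is `φ(n)`. [folklore] -/
theorem card_dirichletCharacter (n : ℕ) [NeZero n] :
    (Finset.univ : Finset (DirichletCharacter ℂ n)).card = n.totient := by
  rw [Finset.card_univ, ← Nat.card_eq_fintype_card]
  exact DirichletCharacter.card_eq_totient_of_hasEnoughRootsOfUnity ℂ n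

/-- Bounding a unit progression by the character sums. [folklore] -/
theorem norm_sum_filter_le_of_char {n : ℕ} [NeZero n] {r : ZMod n} (hr : IsUnit r) (X : ℕ) (f : ℕ → ℂ)
    {B : ℝ} (hB : ∀ χ : DirichletCharacter ℂ n, ‖∑ x ∈ range X, f x * χ (x : ZMod n)‖ ≤ B) :
    ‖∑ x ∈ (range X).filter (fun x : ℕ => (x : ZMod n) = r), f x‖ ≤ B := by
  have hB0 : 0 ≤ B := (norm_nonneg _).trans (hB 1)
  have hφ0 : 0 < (n.totient : ℝ) := by exact_mod_cast Nat.totient_pos.2 (NeZero.pos n)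
  rw [sum_filter_eq_sum_char hr X f, norm_mul, norm_inv, Complex.norm_natCast]
  calc (n.totient : ℝ)⁻¹ * ‖∑ χ : DirichletCharacter ℂ n, χ r⁻¹ * ∑ x ∈ range X, f x * χ (x : ZMod n)‖
      ≤ (n.totient : ℝ)⁻¹ * ∑ χ : DirichletCharacter ℂ n, ‖χ r⁻¹ * ∑ x ∈ range X, f x * χ (x : ZMod n)‖ :=
        mul_le_mul_of_nonneg_left (norm_sum_le _ _) (by positivity)
    _ ≤ (n.totient : ℝ)⁻¹ * ∑ _χ : DirichletCharacter ℂ n, B := by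
        refine mul_le_mul_of_nonneg_left (Finset.sum_le_sum fun χ _ => ?_) (by positivity)
        rw [norm_mul]
        calc ‖χ r⁻¹‖ * ‖∑ x ∈ range X, f x * χ (x : ZMod n)‖ ≤ 1 * B :=
              mul_le_mul (DirichletCharacter.norm_le_one χ _) (hB χ) (norm_nonneg _) zero_le_one
          _ = B := one_mul _
    _ = B := by
        rw [Finset.sum_const, card_dirichletCharacter, nsmul_eq_mul, ← mul_assoc, inv_mul_cancel₀ hφ0.ne', one_mul]

/-- **Even residues to a `2`-power modulus**: for a non-unit `r` mod `2^{t+1}` (i.e. `r` even),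
`∑_{x < X, x ≡ r (2^{t+1})} f(x) = ∑_{z < ⌈X/2⌉, z ≡ r/2 (2^t)} f(2z)`. [folklore] -/
theorem sum_filter_nonunit (t : ℕ) (r : ZMod (2 ^ (t + 1))) (hr : ¬ IsUnit r) (X : ℕ) (f : ℕ → ℂ) :
    ∑ x ∈ (range X).filter (fun x : ℕ => (x : ZMod (2 ^ (t + 1))) = r), f x =
      ∑ z ∈ (range ((X + 1) / 2)).filter (fun z : ℕ => (z : ZMod (2 ^ t)) = ((r.val / 2 : ℕ) : ZMod (2 ^ t))),
        f (2 * z) := by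
  haveI : NeZero (2 ^ (t + 1)) := ⟨pow_ne_zero _ two_ne_zero⟩
  -- `r.val` is even
  have hr2 : 2 ∣ r.val := by
    by_contra h2
    apply hr
    rw [← ZMod.natCast_zmod_val r, ZMod.isUnit_iff_coprime, Nat.coprime_pow_right_iff (by omega)]
    exact (Nat.prime_two.coprime_iff_not_dvd.2 h2).symm
  obtain ⟨w, hw⟩ := hr2
  have hpow : 2 ^ (t + 1) = 2 * 2 ^ t := by ring
  -- the two filters
  have hset : (range X).filter (fun x : ℕ => (x : ZMod (2 ^ (t + 1))) = r) =
      ((range ((X + 1) / 2)).filter (fun z : ℕ => (z : ZMod (2 ^ t)) = ((r.val / 2 : ℕ) : ZMod (2 ^ t)))).image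
        (fun z => 2 * z) := by
    ext x
    simp only [Finset.mem_filter, Finset.mem_range, Finset.mem_image]
    have hrw : r.val / 2 = w := by rw [hw]; simp
    rw [hrw]
    constructor
    · rintro ⟨hx, hxr⟩
      have hxr' : x % 2 ^ (t + 1) = r.val % 2 ^ (t + 1) := by
        rw [← ZMod.natCast_eq_natCast_iff', ZMod.natCast_zmod_val]; exact hxr
      have hmod : x ≡ 2 * w [MOD 2 * 2 ^ t] := by rw [← hpow, ← hw]; exact hxr'
      have hx2 : 2 ∣ x := by
        have h1 : x % 2 = (2 * w) % 2 :=
          Nat.ModEq.of_mul_right (2 ^ t) hmod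
        omega
      obtain ⟨z, rfl⟩ := hx2
      refine ⟨z, ⟨by omega, ?_⟩, rfl⟩
      rw [ZMod.natCast_eq_natCast_iff']
      exact Nat.ModEq.mul_left_cancel' two_ne_zero hmod
    · rintro ⟨z, ⟨hz, hzr⟩, rfl⟩
      refine ⟨by omega, ?_⟩
      rw [ZMod.natCast_eq_natCast_iff'] at hzr
      rw [← ZMod.natCast_zmod_val r, ZMod.natCast_eq_natCast_iff', hw, hpow]
      exact Nat.ModEq.mul_left' 2 hzr
  rw [hset, Finset.sum_image]
  intro a _ b _ hab
  exact Nat.eq_of_mul_eq_mul_left two_pos hab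

/-- `λ(2z) = −λ(z)`. [folklore] -/
theorem liouville_two_mul (z : ℕ) : liouville (2 * z) = -liouville z := by
  rcases Nat.eq_zero_or_pos z with rfl | hz
  · simp
  · rw [liouville_apply_mul, liouville_apply two_ne_zero, ArithmeticFunction.cardFactors_apply_prime Nat.prime_two]
    simp

/-- **`λ` in progressions to `2`-power moduli, by induction on the modulus** (Green 2012, proof of
Corollary 1, adapted to `λ`: unit residues by orthogonality of characters, even residues by
`x = 2z`, `λ(2z) = −λ(z)`): if all character sums `∑_{x < X} λ(x)χ(x)`, `χ` mod `2^{t'}`, `t' ≤ t₀`,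
`X ≤ N`, are bounded by `B`, then so is every progression sum `∑_{x < X, x ≡ r (2^t)} λ(x)`,
`t ≤ t₀`, `X ≤ N`. [cite: Green2012, Corollary 1 (proof)] -/
theorem norm_sum_progression_le {t₀ N : ℕ} {B : ℝ}
    (hB : ∀ t : ℕ, t ≤ t₀ → ∀ χ : DirichletCharacter ℂ (2 ^ t), ∀ X : ℕ, X ≤ N →
      ‖∑ x ∈ range X, ((liouville x : ℤ) : ℂ) * χ (x : ZMod (2 ^ t))‖ ≤ B) :
    ∀ t : ℕ, t ≤ t₀ → ∀ X : ℕ, X ≤ N → ∀ r : ZMod (2 ^ t),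
      ‖∑ x ∈ (range X).filter (fun x : ℕ => (x : ZMod (2 ^ t)) = r), ((liouville x : ℤ) : ℂ)‖ ≤ B := by
  intro t
  induction t with
  | zero =>
      intro _ X hX r
      -- modulus `1`: no condition; the character sum with `χ = 1` is the plain sum
      haveI : Subsingleton (ZMod (2 ^ 0)) := by rw [pow_zero]; infer_instance
      have h1 : (range X).filter (fun x : ℕ => (x : ZMod (2 ^ 0)) = r) = range X := by
        refine Finset.filter_true_of_mem fun x _ => ?_
        exact Subsingleton.elim _ _
      rw [h1]
      have h := hB 0 (Nat.zero_le _) 1 X hX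
      have h2 : ∑ x ∈ range X, ((liouville x : ℤ) : ℂ) * (1 : DirichletCharacter ℂ (2 ^ 0)) (x : ZMod (2 ^ 0)) =
          ∑ x ∈ range X, ((liouville x : ℤ) : ℂ) := by
        refine Finset.sum_congr rfl fun x _ => ?_
        rw [MulChar.one_apply (isUnit_of_subsingleton _), mul_one]
      rwa [h2] at h
  | succ t ih =>
      intro ht X hX r
      haveI : NeZero (2 ^ (t + 1)) := ⟨pow_ne_zero _ two_ne_zero⟩
      by_cases hr : IsUnit r
      · exact norm_sum_filter_le_of_char hr X _ fun χ => hB (t + 1) ht χ X hX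
      · rw [sum_filter_nonunit t r hr X]
        have hX' : (X + 1) / 2 ≤ N := by omega
        have h := ih (by omega) ((X + 1) / 2) hX' ((r.val / 2 : ℕ) : ZMod (2 ^ t))
        have hneg : ∑ z ∈ (range ((X + 1) / 2)).filter
            (fun z : ℕ => (z : ZMod (2 ^ t)) = ((r.val / 2 : ℕ) : ZMod (2 ^ t))),
              ((liouville (2 * z) : ℤ) : ℂ) =
            -∑ z ∈ (range ((X + 1) / 2)).filter
              (fun z : ℕ => (z : ZMod (2 ^ t)) = ((r.val / 2 : ℕ) : ZMod (2 ^ t))),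
                ((liouville z : ℤ) : ℂ) := by
          rw [← Finset.sum_neg_distrib]
          refine Finset.sum_congr rfl fun z _ => ?_
          rw [liouville_two_mul]; push_cast; ring
        rw [hneg, norm_neg]
        exact h

/-! ### Exponential sums near a dyadic rational (Green 2012, Corollary 2) -/

open scoped FourierTransform

/-- `e` is `1` on integers: `e(x a/q) = e(r a/q)` when `x ≡ r (mod q)`. [folklore] -/
theorem fourierChar_natCast_congr {q : ℕ} (hq : 0 < q) (a : ℤ) {x r : ℕ} (h : x % q = r % q) :
    (𝐞 ((x : ℝ) * ((a : ℝ) / q)) : ℂ) = 𝐞 ((r : ℝ) * ((a : ℝ) / q)) := by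
  -- `x = r + q k` or `r = x + q k` up to sign; use `Int` arithmetic
  have hq0 : (q : ℝ) ≠ 0 := by exact_mod_cast hq.ne'
  have hdiv : (q : ℤ) ∣ (x : ℤ) - r := by
    have := Nat.ModEq.dvd h.symm
    -- `Nat.ModEq.dvd : a ≡ b [MOD n] → (n:ℤ) ∣ b - a`
    simpa using (Nat.ModEq.dvd (h.symm : r % q = x % q))
  obtain ⟨k, hk⟩ := hdiv
  have hxr : (x : ℝ) * ((a : ℝ) / q) = (r : ℝ) * ((a : ℝ) / q) + ((k * a : ℤ) : ℝ) := by
    have hk' : (x : ℝ) - r = q * k := by exact_mod_cast hk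
    push_cast
    field_simp
    linear_combination (a : ℝ) * hk'
  rw [hxr, AddChar.map_add_eq_mul, Circle.coe_mul]
  have hint : (𝐞 (((k * a : ℤ)) : ℝ) : ℂ) = 1 := by
    rw [Real.fourierChar_apply]
    have : (↑(2 * Real.pi * ((k * a : ℤ) : ℝ)) : ℂ) * Complex.I = ((k * a : ℤ) : ℂ) * (2 * Real.pi * Complex.I) := by
      push_cast; ring
    rw [this, Complex.exp_int_mul_two_pi_mul_I]
  rw [hint, mul_one]

/-- **From progressions to a nearby frequency** (Green 2012, proof of Corollary 2: "if `P` is any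
interval of integers of length `L` and `x₀ ∈ P` then `∑_{x∈P} μ(x)e(θx) = ∑_{x∈P} μ(x)e(ax/q)e((x−x₀)(θ−a/q))`
… dividing `{0,…,N−1}` into `O(N/L)` such progressions"): if `‖f‖ ≤ 1` and every progression sum
`∑_{x<X, x≡r (q)} f(x)`, `X ≤ N`, is at most `B` in norm, then for `θ = a/q + β` and every block
length `L' ≥ 1`,
`‖∑_{x<N} f(x) e(xθ)‖ ≤ (N/L' + 1)(2qB + 2π|β|L'²)`. [cite: Green2012, Corollary 2 (proof)] -/
theorem norm_expSum_le_of_progressions {q : ℕ} (hq : 0 < q) (a : ℤ) (β : ℝ) {N L' : ℕ} (hL' : 0 < L')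
    (f : ℕ → ℂ) (hf : ∀ x, ‖f x‖ ≤ 1) {B : ℝ}
    (hB : ∀ X : ℕ, X ≤ N → ∀ r : ZMod q, ‖∑ x ∈ (range X).filter (fun x : ℕ => (x : ZMod q) = r), f x‖ ≤ B) :
    ‖∑ x ∈ range N, f x * (𝐞 ((x : ℝ) * ((a : ℝ) / q + β)) : ℂ)‖ ≤
      ((N : ℝ) / L' + 1) * (2 * q * B + 2 * Real.pi * |β| * L' * L') := by
  haveI : NeZero q := ⟨hq.ne'⟩
  have hB0 : 0 ≤ B := by
    have := hB 0 (Nat.zero_le _) 0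
    simp at this
    exact this
  set m : ℕ := N / L' + 1 with hm
  set F : ℕ → ℂ := fun x => f x * (𝐞 ((x : ℝ) * ((a : ℝ) / q + β)) : ℂ) with hF
  -- blocks `x / L' = i`
  have hmaps : ∀ x ∈ range N, x / L' ∈ range m := by
    intro x hx
    rw [Finset.mem_range] at hx ⊢
    have : x / L' ≤ N / L' := Nat.div_le_div_right hx.le
    omega
  rw [← Finset.sum_fiberwise_of_maps_to hmaps]
  -- each block
  have hblock : ∀ i ∈ range m, ‖∑ x ∈ (range N).filter (fun x => x / L' = i), F x‖ ≤
      2 * q * B + 2 * Real.pi * |β| * L' * L' := by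
    intro i hi
    have hi' : i ≤ N / L' := by rw [Finset.mem_range] at hi; omega
    set X₀ : ℕ := i * L' with hX₀
    set X₁ : ℕ := min N ((i + 1) * L') with hX₁
    have hX₀N : X₀ ≤ N := by
      rw [hX₀]; calc i * L' ≤ N / L' * L' := Nat.mul_le_mul_right _ hi'
        _ ≤ N := Nat.div_mul_le_self N L'
    have hX₀X₁ : X₀ ≤ X₁ := by
      rw [hX₁]; refine le_min hX₀N ?_; rw [hX₀]; nlinarith
    have hX₁N : X₁ ≤ N := min_le_left _ _
    set b := (range N).filter (fun x => x / L' = i) with hb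
    have hmem : ∀ x, x ∈ b ↔ x < X₁ ∧ X₀ ≤ x := by
      intro x
      rw [hb, Finset.mem_filter, Finset.mem_range, hX₁, hX₀]
      have e1 : x / L' = i ↔ i * L' ≤ x ∧ x < (i + 1) * L' := by
        constructor
        · intro h
          exact ⟨(Nat.le_div_iff_mul_le hL').1 h.ge,
            (Nat.div_lt_iff_lt_mul hL').1 (h.le.trans_lt (Nat.lt_succ_self i))⟩
        · rintro ⟨h1, h2⟩
          have h3 : i ≤ x / L' := (Nat.le_div_iff_mul_le hL').2 h1
          have h4 : x / L' < i + 1 := (Nat.div_lt_iff_lt_mul hL').2 h2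
          omega
      rw [e1]
      constructor
      · rintro ⟨hxN, h1, h2⟩; exact ⟨lt_min hxN h2, h1⟩
      · rintro ⟨hx, h1⟩; exact ⟨lt_of_lt_of_le hx (min_le_left _ _), h1, lt_of_lt_of_le hx (min_le_right _ _)⟩
    have hcard : (b.card : ℝ) ≤ L' := by
      have : b ⊆ Finset.Ico X₀ (X₀ + L') := by
        intro x hx
        rw [hmem] at hx
        rw [Finset.mem_Ico]
        refine ⟨hx.2, lt_of_lt_of_le hx.1 ((min_le_right _ _).trans (by rw [hX₀]; nlinarith))⟩
      have := Finset.card_le_card this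
      rw [Nat.card_Ico] at this
      exact_mod_cast (by omega : b.card ≤ L')
    have hdist : ∀ x ∈ b, |(x : ℝ) - X₀| ≤ L' := by
      intro x hx
      rw [hmem] at hx
      have h1 : (X₀ : ℝ) ≤ x := by exact_mod_cast hx.2
      have h2 : (x : ℝ) < X₀ + L' := by
        have : x < X₀ + L' := lt_of_lt_of_le hx.1 ((min_le_right _ _).trans (by rw [hX₀]; nlinarith))
        exact_mod_cast this
      rw [abs_of_nonneg (by linarith)]; linarith
    -- factor the phase
    have hphase : ∀ x : ℕ, (𝐞 ((x : ℝ) * ((a : ℝ) / q + β)) : ℂ) =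
        (𝐞 ((X₀ : ℝ) * β) : ℂ) * ((𝐞 ((x : ℝ) * ((a : ℝ) / q)) : ℂ) * (𝐞 (((x : ℝ) - X₀) * β) : ℂ)) := by
      intro x
      rw [← Circle.coe_mul, ← Circle.coe_mul, ← AddChar.map_add_eq_mul, ← AddChar.map_add_eq_mul]
      congr 2; ring
    have hsplit : ∑ x ∈ b, F x = (𝐞 ((X₀ : ℝ) * β) : ℂ) *
        (∑ x ∈ b, f x * (𝐞 ((x : ℝ) * ((a : ℝ) / q)) : ℂ) +
          ∑ x ∈ b, f x * (𝐞 ((x : ℝ) * ((a : ℝ) / q)) : ℂ) * ((𝐞 (((x : ℝ) - X₀) * β) : ℂ) - 1)) := by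
      rw [← Finset.sum_add_distrib, Finset.mul_sum]
      refine Finset.sum_congr rfl fun x _ => ?_
      rw [hF]; dsimp only; rw [hphase x]; ring
    -- the error term
    have herr : ‖∑ x ∈ b, f x * (𝐞 ((x : ℝ) * ((a : ℝ) / q)) : ℂ) * ((𝐞 (((x : ℝ) - X₀) * β) : ℂ) - 1)‖ ≤
        2 * Real.pi * |β| * L' * L' := by
      calc ‖∑ x ∈ b, f x * (𝐞 ((x : ℝ) * ((a : ℝ) / q)) : ℂ) * ((𝐞 (((x : ℝ) - X₀) * β) : ℂ) - 1)‖
          ≤ ∑ x ∈ b, ‖f x * (𝐞 ((x : ℝ) * ((a : ℝ) / q)) : ℂ) * ((𝐞 (((x : ℝ) - X₀) * β) : ℂ) - 1)‖ :=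
            norm_sum_le _ _
        _ ≤ ∑ _x ∈ b, 2 * Real.pi * |β| * L' := by
            refine Finset.sum_le_sum fun x hx => ?_
            rw [norm_mul, norm_mul, norm_fourierChar, mul_one]
            calc ‖f x‖ * ‖(𝐞 (((x : ℝ) - X₀) * β) : ℂ) - 1‖ ≤ 1 * (2 * Real.pi * |((x : ℝ) - X₀) * β|) :=
                  mul_le_mul (hf x) (by
                    rw [Real.fourierChar_apply, mul_comm _ Complex.I]
                    refine (Real.norm_exp_I_mul_ofReal_sub_one_le).trans ?_
                    rw [Real.norm_eq_abs, abs_mul, abs_of_pos Real.two_pi_pos]) (norm_nonneg _) zero_le_one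
              _ = 2 * Real.pi * |β| * |(x : ℝ) - X₀| := by rw [abs_mul]; ring
              _ ≤ 2 * Real.pi * |β| * L' := mul_le_mul_of_nonneg_left (hdist x hx) (by positivity)
        _ = b.card * (2 * Real.pi * |β| * L') := by rw [Finset.sum_const, nsmul_eq_mul]
        _ ≤ L' * (2 * Real.pi * |β| * L') := mul_le_mul_of_nonneg_right hcard (by positivity)
        _ = 2 * Real.pi * |β| * L' * L' := by ring
    -- the main term through residues
    have hmain : ‖∑ x ∈ b, f x * (𝐞 ((x : ℝ) * ((a : ℝ) / q)) : ℂ)‖ ≤ 2 * q * B := by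
      rw [← Finset.sum_fiberwise b (fun x : ℕ => (x : ZMod q))]
      calc ‖∑ r : ZMod q, ∑ x ∈ b.filter (fun x : ℕ => (x : ZMod q) = r), f x * (𝐞 ((x : ℝ) * ((a : ℝ) / q)) : ℂ)‖
          ≤ ∑ r : ZMod q, ‖∑ x ∈ b.filter (fun x : ℕ => (x : ZMod q) = r), f x * (𝐞 ((x : ℝ) * ((a : ℝ) / q)) : ℂ)‖ :=
            norm_sum_le _ _
        _ ≤ ∑ _r : ZMod q, 2 * B := by
            refine Finset.sum_le_sum fun r _ => ?_
            -- constant phase on the class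
            have hconst : ∑ x ∈ b.filter (fun x : ℕ => (x : ZMod q) = r), f x * (𝐞 ((x : ℝ) * ((a : ℝ) / q)) : ℂ) =
                (𝐞 ((r.val : ℝ) * ((a : ℝ) / q)) : ℂ) * ∑ x ∈ b.filter (fun x : ℕ => (x : ZMod q) = r), f x := by
              rw [Finset.mul_sum]
              refine Finset.sum_congr rfl fun x hx => ?_
              have hxr : (x : ZMod q) = r := (Finset.mem_filter.1 hx).2
              have hmod : x % q = r.val % q := by
                rw [← ZMod.natCast_eq_natCast_iff', ZMod.natCast_zmod_val]; exact hxr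
              rw [fourierChar_natCast_congr hq a hmod]; ring
            rw [hconst, norm_mul, norm_fourierChar, one_mul]
            -- the class sum on the block is a difference of two initial-segment sums
            have hfilt : b.filter (fun x : ℕ => (x : ZMod q) = r) =
                ((range X₁).filter (fun x : ℕ => (x : ZMod q) = r)).filter (fun x => X₀ ≤ x) := by
              ext x
              simp only [Finset.mem_filter, Finset.mem_range, hmem]
              tauto
            have hdecomp : ∑ x ∈ (range X₁).filter (fun x : ℕ => (x : ZMod q) = r), f x =
                ∑ x ∈ (range X₀).filter (fun x : ℕ => (x : ZMod q) = r), f x +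
                  ∑ x ∈ ((range X₁).filter (fun x : ℕ => (x : ZMod q) = r)).filter (fun x => X₀ ≤ x), f x := by
              rw [← Finset.sum_filter_add_sum_filter_not ((range X₁).filter (fun x : ℕ => (x : ZMod q) = r))
                (fun x => x < X₀)]
              congr 1
              · congr 1
                ext x
                simp only [Finset.mem_filter, Finset.mem_range]
                constructor
                · rintro ⟨⟨-, h2⟩, h3⟩; exact ⟨h3, h2⟩
                · rintro ⟨h1, h2⟩; exact ⟨⟨lt_of_lt_of_le h1 hX₀X₁, h2⟩, h1⟩
              · congr 1
                ext x
                simp only [Finset.mem_filter, not_lt]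
            have heq : ∑ x ∈ b.filter (fun x : ℕ => (x : ZMod q) = r), f x =
                ∑ x ∈ (range X₁).filter (fun x : ℕ => (x : ZMod q) = r), f x -
                  ∑ x ∈ (range X₀).filter (fun x : ℕ => (x : ZMod q) = r), f x := by
              rw [hfilt, hdecomp]; ring
            rw [heq]
            calc ‖∑ x ∈ (range X₁).filter (fun x : ℕ => (x : ZMod q) = r), f x -
                  ∑ x ∈ (range X₀).filter (fun x : ℕ => (x : ZMod q) = r), f x‖
                ≤ ‖∑ x ∈ (range X₁).filter (fun x : ℕ => (x : ZMod q) = r), f x‖ +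
                    ‖∑ x ∈ (range X₀).filter (fun x : ℕ => (x : ZMod q) = r), f x‖ := norm_sub_le _ _
              _ ≤ B + B := add_le_add (hB X₁ hX₁N r) (hB X₀ hX₀N r)
              _ = 2 * B := by ring
        _ = q * (2 * B) := by rw [Finset.sum_const, Finset.card_univ, ZMod.card, nsmul_eq_mul]
        _ = 2 * q * B := by ring
    rw [hsplit, norm_mul, norm_fourierChar, one_mul]
    exact (norm_add_le _ _).trans (add_le_add hmain herr)
  calc ‖∑ i ∈ range m, ∑ x ∈ (range N).filter (fun x => x / L' = i), F x‖
      ≤ ∑ i ∈ range m, ‖∑ x ∈ (range N).filter (fun x => x / L' = i), F x‖ := norm_sum_le _ _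
    _ ≤ ∑ _i ∈ range m, (2 * q * B + 2 * Real.pi * |β| * L' * L') := Finset.sum_le_sum hblock
    _ = m * (2 * q * B + 2 * Real.pi * |β| * L' * L') := by rw [Finset.sum_const, Finset.card_range, nsmul_eq_mul]
    _ ≤ ((N : ℝ) / L' + 1) * (2 * q * B + 2 * Real.pi * |β| * L' * L') := by
        refine mul_le_mul_of_nonneg_right ?_ (by positivity)
        rw [hm]; push_cast
        exact add_le_add Nat.cast_div_le le_rfl

/-- The trivial bound for a twisted Liouville sum. [folklore] -/
theorem norm_sum_liouville_mul_le (N : ℕ) (g : ℕ → ℂ) (hg : ∀ x, ‖g x‖ ≤ 1) :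
    ‖∑ x ∈ range N, ((liouville x : ℤ) : ℂ) * g x‖ ≤ N := by
  calc ‖∑ x ∈ range N, ((liouville x : ℤ) : ℂ) * g x‖ ≤ ∑ x ∈ range N, ‖((liouville x : ℤ) : ℂ) * g x‖ :=
        norm_sum_le _ _
    _ ≤ ∑ _x ∈ range N, (1 : ℝ) := by
        refine Finset.sum_le_sum fun x _ => ?_
        rw [norm_mul, Complex.norm_intCast]
        calc |(liouville x : ℝ)| * ‖g x‖ ≤ 1 * 1 := by
              gcongr
              · exact LiouvilleSum.abs_liouville_le_one x
              · exact hg x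
          _ = 1 := one_mul _
    _ = N := by simp

/-- **Uniform character-sum bound below `N`**: from `liouville_character_twoPower` (constants
`c, K ≥ 1`), for `log N ≥ max(1, c²)` and `2^{t₀} ≤ e^{(c/8)√log N}`, every `∑_{x<X} λ(x)χ(x)`,
`χ` mod `2^t`, `t ≤ t₀`, `X ≤ N`, is at most `K N e^{−(c/2)√log N}` (small `X` trivially, large `X`
by the bound at `X`, `log X ≥ (log N)/4`). [cite: Green2012, Corollary 1 (proof)] -/
theorem char_bound_uniform {c K : ℝ} (hc : 0 < c) (hK : 1 ≤ K)
    (h : ∀ t N : ℕ, ∀ χ : DirichletCharacter ℂ (2 ^ t),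
      ((2 : ℝ) ^ t ≤ Real.exp (c * Real.sqrt (Real.log N))) →
        ‖∑ x ∈ range N, ((liouville x : ℤ) : ℂ) * χ (x : ZMod (2 ^ t))‖
          ≤ K * (N : ℝ) * Real.exp (-(c * Real.sqrt (Real.log N))))
    {N t₀ : ℕ} (hL : max 1 (c ^ 2) ≤ Real.log N)
    (ht₀ : (2 : ℝ) ^ t₀ ≤ Real.exp (c / 8 * Real.sqrt (Real.log N))) :
    ∀ t : ℕ, t ≤ t₀ → ∀ χ : DirichletCharacter ℂ (2 ^ t), ∀ X : ℕ, X ≤ N →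
      ‖∑ x ∈ range X, ((liouville x : ℤ) : ℂ) * χ (x : ZMod (2 ^ t))‖ ≤
        K * N * Real.exp (-(c / 2 * Real.sqrt (Real.log N))) := by
  intro t ht χ X hX
  set L : ℝ := Real.log N with hLdef
  set B : ℝ := K * N * Real.exp (-(c / 2 * Real.sqrt L)) with hBdef
  have hL1 : 1 ≤ L := (le_max_left _ _).trans hL
  have hLc : c ^ 2 ≤ L := (le_max_right _ _).trans hL
  have hL0 : 0 < L := by linarith
  have hN0 : (0 : ℝ) < N := by
    by_contra h0
    push Not at h0
    have : (N : ℝ) = 0 := le_antisymm h0 (Nat.cast_nonneg N)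
    rw [hLdef, this, Real.log_zero] at hL1
    linarith
  have hexpL : Real.exp L = N := by rw [hLdef, Real.exp_log hN0]
  have hsqrtL : c ≤ Real.sqrt L := by
    rw [← Real.sqrt_sq hc.le]; exact Real.sqrt_le_sqrt hLc
  have hsL0 : 0 < Real.sqrt L := Real.sqrt_pos.2 hL0
  rcases le_or_gt (X : ℝ) B with hXB | hXB
  · exact (norm_sum_liouville_mul_le X _ fun x => DirichletCharacter.norm_le_one χ _).trans hXB
  · -- large `X`: `log X ≥ L/4`
    have hB0 : 0 < B := by rw [hBdef]; positivity
    have hX0 : (0 : ℝ) < X := hB0.trans hXB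
    have hlogX : L / 4 ≤ Real.log X := by
      have h1 : Real.log B ≤ Real.log X := Real.log_le_log hB0 hXB.le
      have h2 : Real.log B = Real.log K + L + (-(c / 2 * Real.sqrt L)) := by
        rw [hBdef, Real.log_mul (by positivity) (Real.exp_pos _).ne', Real.log_mul (by positivity) hN0.ne',
          Real.log_exp, hLdef]
      have h3 : 0 ≤ Real.log K := Real.log_nonneg hK
      have h4 : c / 2 * Real.sqrt L ≤ 3 / 4 * L := by
        have := Real.sq_sqrt hL0.le
        nlinarith
      linarith
    have hsqrtX : Real.sqrt L / 2 ≤ Real.sqrt (Real.log X) := by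
      rw [show Real.sqrt L / 2 = Real.sqrt (L / 4) by
        rw [show L / 4 = L / 2 ^ 2 by ring, Real.sqrt_div' L (by norm_num : (0:ℝ) ≤ 2 ^ 2),
          Real.sqrt_sq (by norm_num)]]
      exact Real.sqrt_le_sqrt hlogX
    have hrange : (2 : ℝ) ^ t ≤ Real.exp (c * Real.sqrt (Real.log X)) := by
      have h2t : (2 : ℝ) ^ t ≤ 2 ^ t₀ := pow_le_pow_right₀ (by norm_num) ht
      refine h2t.trans (ht₀.trans (Real.exp_le_exp.2 ?_))
      calc c / 8 * Real.sqrt L ≤ c * (Real.sqrt L / 2) := by nlinarith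
        _ ≤ c * Real.sqrt (Real.log X) := mul_le_mul_of_nonneg_left hsqrtX hc.le
    refine (h t X χ hrange).trans ?_
    have hXN : (X : ℝ) ≤ N := by exact_mod_cast hX
    have hexp : Real.exp (-(c * Real.sqrt (Real.log X))) ≤ Real.exp (-(c / 2 * Real.sqrt L)) :=
      Real.exp_le_exp.2 (by nlinarith)
    calc K * (X : ℝ) * Real.exp (-(c * Real.sqrt (Real.log X))) ≤ K * N * Real.exp (-(c / 2 * Real.sqrt L)) :=
          mul_le_mul (mul_le_mul_of_nonneg_left hXN (by linarith)) hexp (Real.exp_pos _).le (by positivity)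
      _ = B := rfl

set_option maxHeartbeats 400000 in
/-- **Green 2012, Corollary 2, for `λ`** (exponential sums at frequencies near a dyadic rational):
there are `c₄ > 0`, `K₄` such that for all `N, t`, `a ∈ ℤ`, `θ ∈ ℝ` with `2^t ≤ e^{c₄√log N}` and
`|θ − a/2^t| ≤ e^{c₄√log N}/N`: `‖∑_{x<N} λ(x) e(xθ)‖ ≤ K₄ N e^{−c₄√log N}`. From
`liouville_character_twoPower` (with `c₄ = c/8`), progressions to modulus `2^t`
(`norm_sum_progression_le`) and blocks of length `L' ≍ N e^{−2c₄√log N}`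
(`norm_expSum_le_of_progressions`). [cite: Green2012, Corollary 2] -/
theorem liouville_near_dyadic (hY : green_moebius_character_twoPower) :
    ∃ c₄ : ℝ, 0 < c₄ ∧ ∃ K₄ : ℝ, ∀ (N t : ℕ) (a : ℤ) (θ : ℝ),
      ((2 : ℝ) ^ t ≤ Real.exp (c₄ * Real.sqrt (Real.log N))) →
      |θ - a / 2 ^ t| ≤ Real.exp (c₄ * Real.sqrt (Real.log N)) / N →
        ‖∑ x ∈ range N, ((liouville x : ℤ) : ℂ) * (𝐞 ((x : ℝ) * θ) : ℂ)‖
          ≤ K₄ * (N : ℝ) * Real.exp (-(c₄ * Real.sqrt (Real.log N))) := by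
  obtain ⟨c, hc, K₀, hK₀⟩ := liouville_character_twoPower hY
  -- WLOG `K ≥ 1`
  set K : ℝ := max K₀ 1 with hKdef
  have hK1 : 1 ≤ K := le_max_right _ _
  have hK : ∀ t N : ℕ, ∀ χ : DirichletCharacter ℂ (2 ^ t),
      ((2 : ℝ) ^ t ≤ Real.exp (c * Real.sqrt (Real.log N))) →
        ‖∑ x ∈ range N, ((liouville x : ℤ) : ℂ) * χ (x : ZMod (2 ^ t))‖
          ≤ K * (N : ℝ) * Real.exp (-(c * Real.sqrt (Real.log N))) := fun t N χ h1 =>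
    (hK₀ t N χ h1).trans (mul_le_mul_of_nonneg_right
      (mul_le_mul_of_nonneg_right (le_max_left _ _) (Nat.cast_nonneg N)) (Real.exp_pos _).le)
  set c₄ : ℝ := c / 8 with hc₄
  have hc₄0 : 0 < c₄ := by positivity
  set L₀ : ℝ := max 1 (c ^ 2) with hL₀
  set Ksmall : ℝ := Real.exp (c₄ * Real.sqrt L₀) with hKsmall
  refine ⟨c₄, hc₄0, 4 * K + 12 * Real.pi + Ksmall, fun N t a θ hq hθ => ?_⟩
  set L : ℝ := Real.log N with hLdef
  set E : ℝ := Real.exp (-(c₄ * Real.sqrt L)) with hEdef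
  have hE0 : 0 < E := Real.exp_pos _
  have hN0 : (0 : ℝ) ≤ N := Nat.cast_nonneg N
  have htriv := norm_sum_liouville_mul_le N (fun x => (𝐞 ((x : ℝ) * θ) : ℂ)) fun x => (norm_fourierChar _).le
  rcases lt_or_ge L L₀ with hLL | hLL
  · -- small `N`
    have h1 : 1 ≤ Ksmall * E := by
      rw [hKsmall, hEdef, ← Real.exp_add]
      refine Real.one_le_exp ?_
      have hL0' : 0 ≤ L₀ := le_trans zero_le_one (le_max_left _ _)
      have : Real.sqrt L ≤ Real.sqrt L₀ := Real.sqrt_le_sqrt hLL.le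
      nlinarith [Real.sqrt_nonneg L]
    calc ‖∑ x ∈ range N, ((liouville x : ℤ) : ℂ) * (𝐞 ((x : ℝ) * θ) : ℂ)‖ ≤ N := htriv
      _ ≤ N * (Ksmall * E) := le_mul_of_one_le_right hN0 h1
      _ = Ksmall * N * E := by ring
      _ ≤ (4 * K + 12 * Real.pi) * N * E + Ksmall * N * E :=
          le_add_of_nonneg_left (by positivity)
      _ = (4 * K + 12 * Real.pi + Ksmall) * N * E := by ring
  · -- large `N`
    have hL1 : 1 ≤ L := (le_max_left _ _).trans hLL
    have hL0 : 0 < L := by linarith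
    have hNpos : (0 : ℝ) < N := by
      by_contra h0
      push Not at h0
      have : (N : ℝ) = 0 := le_antisymm h0 hN0
      rw [hLdef, this, Real.log_zero] at hL1
      linarith
    have hexpL : Real.exp L = N := by rw [hLdef, Real.exp_log hNpos]
    have hLc : c ^ 2 ≤ L := (le_max_right _ _).trans hLL
    have hsqrtL : c ≤ Real.sqrt L := by
      rw [← Real.sqrt_sq hc.le]; exact Real.sqrt_le_sqrt hLc
    -- the uniform character bound and the progressions
    set B : ℝ := K * N * Real.exp (-(c / 2 * Real.sqrt L)) with hBdef
    have hB0 : 0 ≤ B := by positivity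
    have hq' : (2 : ℝ) ^ t ≤ Real.exp (c / 8 * Real.sqrt L) := hq
    have hchar := char_bound_uniform hc hK1 hK (N := N) (t₀ := t) hLL hq'
    have hprog := norm_sum_progression_le hchar t le_rfl
    -- block length
    set L' : ℕ := ⌊(N : ℝ) * Real.exp (-(2 * c₄ * Real.sqrt L))⌋₊ + 1 with hL'
    have hL'pos : 0 < L' := Nat.succ_pos _
    have hL'ge : (N : ℝ) * Real.exp (-(2 * c₄ * Real.sqrt L)) ≤ L' := by
      rw [hL']; push_cast; exact (Nat.lt_floor_add_one _).le
    have hexp2 : Real.exp (2 * c₄ * Real.sqrt L) ≤ N := by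
      rw [← hexpL]; refine Real.exp_le_exp.2 ?_
      have := Real.sq_sqrt hL0.le
      nlinarith
    have hNE1 : 1 ≤ (N : ℝ) * Real.exp (-(2 * c₄ * Real.sqrt L)) := by
      rw [Real.exp_neg, ← div_eq_mul_inv, le_div_iff₀ (Real.exp_pos _), one_mul]; exact hexp2
    have hL'le : (L' : ℝ) ≤ 2 * ((N : ℝ) * Real.exp (-(2 * c₄ * Real.sqrt L))) := by
      rw [hL']; push_cast
      have := Nat.floor_le (show (0:ℝ) ≤ (N : ℝ) * Real.exp (-(2 * c₄ * Real.sqrt L)) by positivity)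
      linarith
    have hNL' : (N : ℝ) / L' ≤ Real.exp (2 * c₄ * Real.sqrt L) := by
      rw [div_le_iff₀ (by exact_mod_cast hL'pos)]
      calc (N : ℝ) = Real.exp (2 * c₄ * Real.sqrt L) * ((N : ℝ) * Real.exp (-(2 * c₄ * Real.sqrt L))) := by
            rw [Real.exp_neg]; field_simp
        _ ≤ Real.exp (2 * c₄ * Real.sqrt L) * L' := mul_le_mul_of_nonneg_left hL'ge (Real.exp_pos _).le
    -- the block estimate
    set β : ℝ := θ - a / 2 ^ t with hβ
    have hθ' : θ = (a : ℝ) / ((2 ^ t : ℕ) : ℝ) + β := by rw [hβ]; push_cast; ring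
    have hq0 : 0 < 2 ^ t := Nat.two_pow_pos t
    have hmain := norm_expSum_le_of_progressions hq0 a β (N := N) hL'pos
      (fun x => ((liouville x : ℤ) : ℂ)) (fun x => by
        rw [Complex.norm_intCast]; exact LiouvilleSum.abs_liouville_le_one x) hprog
    rw [← hθ'] at hmain
    refine hmain.trans ?_
    -- sizes
    have hqE : ((2 ^ t : ℕ) : ℝ) ≤ Real.exp (c₄ * Real.sqrt L) := by push_cast; rwa [hLdef] at hq
    have hβE : |β| ≤ Real.exp (c₄ * Real.sqrt L) / N := by rw [hβ]; rwa [hLdef] at hθ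
    have hEB : ((2 ^ t : ℕ) : ℝ) * B ≤ K * N * Real.exp (-(3 * c₄ * Real.sqrt L)) := by
      calc ((2 ^ t : ℕ) : ℝ) * B ≤ Real.exp (c₄ * Real.sqrt L) * B := mul_le_mul_of_nonneg_right hqE hB0
        _ = K * N * (Real.exp (c₄ * Real.sqrt L) * Real.exp (-(c / 2 * Real.sqrt L))) := by rw [hBdef]; ring
        _ = K * N * Real.exp (-(3 * c₄ * Real.sqrt L)) := by rw [← Real.exp_add]; congr 1; rw [hc₄]; ring
    have h1E : (1 : ℝ) ≤ Real.exp (2 * c₄ * Real.sqrt L) := Real.one_le_exp (by positivity)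
    have hterm1 : ((N : ℝ) / L' + 1) * (2 * ((2 ^ t : ℕ) : ℝ) * B) ≤ 4 * K * N * E := by
      calc ((N : ℝ) / L' + 1) * (2 * ((2 ^ t : ℕ) : ℝ) * B)
          ≤ (Real.exp (2 * c₄ * Real.sqrt L) + Real.exp (2 * c₄ * Real.sqrt L)) *
              (2 * (K * N * Real.exp (-(3 * c₄ * Real.sqrt L)))) := by
            refine mul_le_mul (add_le_add hNL' h1E) (by linarith) (by positivity) (by positivity)
        _ = 4 * K * N * (Real.exp (2 * c₄ * Real.sqrt L) * Real.exp (-(3 * c₄ * Real.sqrt L))) := by ring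
        _ = 4 * K * N * E := by rw [← Real.exp_add, hEdef]; congr 1; ring
    have hterm2 : ((N : ℝ) / L' + 1) * (2 * Real.pi * |β| * L' * L') ≤ 12 * Real.pi * N * E := by
      have hL'0 : (0 : ℝ) < L' := by exact_mod_cast hL'pos
      have e1 : ((N : ℝ) / L' + 1) * (2 * Real.pi * |β| * L' * L') = (N + L') * (2 * Real.pi * |β| * L') := by
        field_simp
      rw [e1]
      have hL'N : (L' : ℝ) ≤ 2 * N := by
        refine hL'le.trans ?_
        have h1 : Real.exp (-(2 * c₄ * Real.sqrt L)) ≤ 1 :=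
          Real.exp_le_one_iff.2 (neg_nonpos.2 (by positivity))
        have h2 : (N : ℝ) * Real.exp (-(2 * c₄ * Real.sqrt L)) ≤ N := mul_le_of_le_one_right hNpos.le h1
        exact mul_le_mul_of_nonneg_left h2 (by norm_num)
      have hNL'3 : (N : ℝ) + L' ≤ 3 * N := by
        calc (N : ℝ) + L' ≤ N + 2 * N := add_le_add le_rfl hL'N
          _ = 3 * N := by ring
      have hβL' : |β| * L' ≤ 2 * Real.exp (-(c₄ * Real.sqrt L)) := by
        calc |β| * L' ≤ (Real.exp (c₄ * Real.sqrt L) / N) * (2 * ((N : ℝ) * Real.exp (-(2 * c₄ * Real.sqrt L)))) :=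
              mul_le_mul hβE hL'le hL'0.le (by positivity)
          _ = 2 * (Real.exp (c₄ * Real.sqrt L) * Real.exp (-(2 * c₄ * Real.sqrt L))) := by field_simp
          _ = 2 * Real.exp (-(c₄ * Real.sqrt L)) := by rw [← Real.exp_add]; congr 1; ring
      calc ((N : ℝ) + L') * (2 * Real.pi * |β| * L') = ((N : ℝ) + L') * (2 * Real.pi) * (|β| * L') := by ring
        _ ≤ (3 * N) * (2 * Real.pi) * (2 * Real.exp (-(c₄ * Real.sqrt L))) :=
            mul_le_mul (mul_le_mul_of_nonneg_right hNL'3 (by positivity)) hβL' (by positivity) (by positivity)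
        _ = 12 * Real.pi * N * E := by rw [hEdef]; ring
    rw [mul_add]
    have hKs : 0 ≤ Ksmall * N * E := by positivity
    calc ((N : ℝ) / L' + 1) * (2 * ((2 ^ t : ℕ) : ℝ) * B) + ((N : ℝ) / L' + 1) * (2 * Real.pi * |β| * L' * L')
        ≤ 4 * K * N * E + 12 * Real.pi * N * E := add_le_add hterm1 hterm2
      _ ≤ 4 * K * N * E + 12 * Real.pi * N * E + Ksmall * N * E := le_add_of_nonneg_right hKs
      _ = (4 * K + 12 * Real.pi + Ksmall) * N * E := by ring


/-! ### Green 2012, Proposition 4 for `λ` (from the Möbius statement, `λ = 𝟙_□ ⋆ μ`) -/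


/-- `∑_{n ≤ N} λ(n) F(n) = ∑_{s ≤ N} 𝟙_□(s) ∑_{m ≤ N/s} μ(m) F(sm)`. [folklore] -/
theorem sum_liouville_mul_eq (F : ℕ → ℂ) (N : ℕ) :
    ∑ n ∈ Ioc 0 N, ((liouville n : ℤ) : ℂ) * F n =
      ∑ s ∈ Ioc 0 N, (if IsSquare s then (1 : ℂ) else 0) *
        ∑ m ∈ Ioc 0 (N / s), ((μ m : ℤ) : ℂ) * F (s * m) := by
  have h1 : ∀ n ∈ Ioc 0 N, ((liouville n : ℤ) : ℂ) * F n
      = ∑ x ∈ n.divisorsAntidiagonal,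
          (if IsSquare x.1 then (1 : ℂ) else 0) * (((μ x.2 : ℤ) : ℂ) * F (x.1 * x.2)) := by
    intro n hn
    have hl := liouville_eq_sum_antidiagonal n
    have hl' : ((liouville n : ℤ) : ℂ) =
        ∑ x ∈ n.divisorsAntidiagonal, (if IsSquare x.1 then (1 : ℂ) else 0) * ((μ x.2 : ℤ) : ℂ) := by
      have h2 := congrArg Complex.ofReal hl
      rw [Complex.ofReal_intCast, Complex.ofReal_sum] at h2
      rw [h2]
      refine Finset.sum_congr rfl fun x _ => ?_
      rw [Complex.ofReal_mul, Complex.ofReal_intCast]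
      split_ifs <;> simp
    rw [hl', Finset.sum_mul]
    refine Finset.sum_congr rfl fun x hx => ?_
    rw [Nat.mem_divisorsAntidiagonal] at hx
    rw [hx.1]; ring
  rw [Finset.sum_congr rfl h1, sum_Ioc_sum_divisorsAntidiagonal_eq
    (fun s m => (if IsSquare s then (1 : ℂ) else 0) * (((μ m : ℤ) : ℂ) * F (s * m))) N]
  refine Finset.sum_congr rfl fun s _ => ?_
  rw [Finset.mul_sum]

/-- The Liouville exponential sum through the Möbius ones at the frequencies `d²θ`:
`‖∑_{n≤N} λ(n)e(nθ)‖ ≤ ∑_{d ≤ √N} ‖∑_{m ≤ N/d²} μ(m) e(m d²θ)‖`. [folklore] -/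
theorem norm_liouvilleExpSum_le_sum (N : ℕ) (θ : ℝ) :
    ‖afExpSum (fun n => (liouville n : ℝ)) N θ‖ ≤
      ∑ d ∈ Ioc 0 (Nat.sqrt N), ‖afExpSum (fun m => (μ m : ℝ)) (N / (d * d)) ((d * d : ℕ) * θ)‖ := by
  have hIcc : Icc 1 N = Ioc 0 N := rfl
  have heq : afExpSum (fun n => (liouville n : ℝ)) N θ =
      ∑ s ∈ Ioc 0 N, (if IsSquare s then (1 : ℂ) else 0) *
        afExpSum (fun m => (μ m : ℝ)) (N / s) ((s : ℕ) * θ) := by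
    unfold afExpSum
    rw [hIcc]
    have e1 : ∀ n : ℕ, (((liouville n : ℝ)) : ℂ) = ((liouville n : ℤ) : ℂ) := fun n => by norm_cast
    simp_rw [e1]
    rw [sum_liouville_mul_eq]
    refine Finset.sum_congr rfl fun s _ => ?_
    congr 1
    refine Finset.sum_congr rfl fun m _ => ?_
    push_cast
    ring_nf
  rw [heq]
  calc ‖∑ s ∈ Ioc 0 N, (if IsSquare s then (1 : ℂ) else 0) * afExpSum (fun m => (μ m : ℝ)) (N / s) ((s : ℕ) * θ)‖
      ≤ ∑ s ∈ Ioc 0 N, ‖(if IsSquare s then (1 : ℂ) else 0) * afExpSum (fun m => (μ m : ℝ)) (N / s) ((s : ℕ) * θ)‖ :=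
        norm_sum_le _ _
    _ = ∑ s ∈ Ioc 0 N, (if IsSquare s then ‖afExpSum (fun m => (μ m : ℝ)) (N / s) ((s : ℕ) * θ)‖ else 0) := by
        refine Finset.sum_congr rfl fun s _ => ?_
        split_ifs <;> simp
    _ = ∑ s ∈ (Ioc 0 N).filter IsSquare, ‖afExpSum (fun m => (μ m : ℝ)) (N / s) ((s : ℕ) * θ)‖ := by
        rw [Finset.sum_filter]
    _ = ∑ d ∈ Ioc 0 (Nat.sqrt N), ‖afExpSum (fun m => (μ m : ℝ)) (N / (d * d)) ((d * d : ℕ) * θ)‖ := by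
        rw [filter_isSquare_Ioc_eq_image, Finset.sum_image]
        intro x _ y _ hxy
        exact Nat.mul_self_inj.mp hxy

/-- **Green 2012, Proposition 4 for the Liouville function** ("very similar proofs", p. 3): if
`‖∑_{n ≤ N} λ(n)e(nθ)‖ ≥ δN` (`0 < δ ≤ 1`, and `N` large in terms of `δ` as recorded by `hcond`),
then `θ` is within `C(log N)⁸/(δ⁶N)` of a rational `a/q` with `1 ≤ q ≤ C(log N)⁸/δ⁶`,
`C = 12288²·324`. Proof: `λ = 𝟙_□ ⋆ μ`, so some `d ≤ 3/δ` has
`‖∑_{m ≤ N/d²} μ(m)e(md²θ)‖ ≥ (δ/2D)(N/d²)`, `D = ⌊2/δ⌋ + 1` (the `d > D` contribute `< δN/2`),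
and the Möbius statement `exists_rat_near_of_large_moebiusExpSum` at `N/d²`, frequency `d²θ`
gives `d²θ ≈ r`, i.e. `θ ≈ r/d²`. [cite: Green2012, Proposition 4 and p. 3] -/
theorem exists_near_rat_of_large_liouvilleExpSum {N : ℕ} {δ : ℝ} (hδ : 0 < δ) (hδ1 : δ ≤ 1)
    (hcond : ∀ M : ℕ, (N : ℝ) * δ ^ 2 / 9 - 1 ≤ M → M ≤ N →
      3 ≤ M ∧ 12288 * Real.log M ^ 4 * (M : ℝ) ^ (9 / 10 : ℝ) ≤ δ ^ 2 / 6 * M)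
    {θ : ℝ} (hlarge : δ * N ≤ ‖afExpSum (fun n => (liouville n : ℝ)) N θ‖) :
    ∃ q : ℕ, 1 ≤ q ∧ (q : ℝ) ≤ 12288 ^ 2 * 324 * Real.log N ^ 8 / δ ^ 6 ∧
      ∃ a : ℤ, |θ - a / q| ≤ 12288 ^ 2 * 324 * Real.log N ^ 8 / (δ ^ 6 * N) := by
  -- `N ≥ 3`
  have hN3 : 3 ≤ N := (hcond N (by
    have : (N : ℝ) * δ ^ 2 ≤ N * 1 := mul_le_mul_of_nonneg_left (pow_le_one₀ hδ.le hδ1) (Nat.cast_nonneg N)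
    linarith) le_rfl).1
  have hN0 : (0 : ℝ) < N := by exact_mod_cast lt_of_lt_of_le (by norm_num) hN3
  have hlogN0 : 0 ≤ Real.log N := Real.log_natCast_nonneg N
  set D : ℕ := ⌊2 / δ⌋₊ + 1 with hD
  have hD0 : 0 < D := Nat.succ_pos _
  have hDδ : 2 / δ < D := by rw [hD]; push_cast; exact Nat.lt_floor_add_one _
  have hDle : (D : ℝ) ≤ 3 / δ := by
    rw [hD]; push_cast
    have h1 : (⌊2 / δ⌋₊ : ℝ) ≤ 2 / δ := Nat.floor_le (by positivity)
    have h2 : (1 : ℝ) ≤ 1 / δ := by rw [le_div_iff₀ hδ]; linarith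
    calc (⌊2 / δ⌋₊ : ℝ) + 1 ≤ 2 / δ + 1 / δ := add_le_add h1 h2
      _ = 3 / δ := by ring
  set A : ℕ → ℝ := fun d => ‖afExpSum (fun m => (μ m : ℝ)) (N / (d * d)) ((d * d : ℕ) * θ)‖ with hA
  have hA0 : ∀ d, 0 ≤ A d := fun d => norm_nonneg _
  have hstep1 : δ * N ≤ ∑ d ∈ Ioc 0 (Nat.sqrt N), A d := hlarge.trans (norm_liouvilleExpSum_le_sum N θ)
  -- split at `D`
  have hsub : Ioc 0 (Nat.sqrt N) ⊆ Ioc 0 D ∪ Ioc D (Nat.sqrt N) := by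
    intro d hd
    rw [Finset.mem_union, Finset.mem_Ioc, Finset.mem_Ioc]
    rw [Finset.mem_Ioc] at hd
    by_cases h : d ≤ D
    · exact Or.inl ⟨hd.1, h⟩
    · exact Or.inr ⟨not_le.1 h, hd.2⟩
  have hdisj : Disjoint (Ioc 0 D) (Ioc D (Nat.sqrt N)) := by
    rw [Finset.disjoint_left]
    intro d h1 h2
    rw [Finset.mem_Ioc] at h1 h2
    omega
  have hstep2 : ∑ d ∈ Ioc 0 (Nat.sqrt N), A d ≤ ∑ d ∈ Ioc 0 D, A d + ∑ d ∈ Ioc D (Nat.sqrt N), A d := by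
    rw [← Finset.sum_union hdisj]
    exact Finset.sum_le_sum_of_subset_of_nonneg hsub fun d _ _ => hA0 d
  -- the tail `d > D` is `< δN/2`
  have htail : ∑ d ∈ Ioc D (Nat.sqrt N), A d < δ * N / 2 := by
    calc ∑ d ∈ Ioc D (Nat.sqrt N), A d ≤ ∑ d ∈ Ioc D (Nat.sqrt N), (N : ℝ) * (1 / (d : ℝ) ^ 2) := by
          refine Finset.sum_le_sum fun d hd => ?_
          have hd0 : 0 < d := lt_trans hD0 (Finset.mem_Ioc.1 hd).1
          calc A d ≤ ((N / (d * d) : ℕ) : ℝ) := Literature.NumberTheory.Sieve.MoebiusExpSum.norm_afExpSum_moebius_le_self _ _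
            _ ≤ (N : ℝ) / ((d * d : ℕ) : ℝ) := Nat.cast_div_le
            _ = (N : ℝ) * (1 / (d : ℝ) ^ 2) := by push_cast; ring
      _ = N * ∑ d ∈ Ioc D (Nat.sqrt N), (1 / (d : ℝ) ^ 2) := by rw [Finset.mul_sum]
      _ ≤ N * (1 / D) := mul_le_mul_of_nonneg_left (sum_Ioc_inv_sq_le hD0 _) hN0.le
      _ < N * (δ / 2) := by
          refine mul_lt_mul_of_pos_left ?_ hN0
          rw [one_div, inv_lt_iff_one_lt_mul₀ (by exact_mod_cast hD0)]
          have := (div_lt_iff₀ hδ).1 hDδ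
          linarith
      _ = δ * N / 2 := by ring
  have hhead : δ * N / 2 ≤ ∑ d ∈ Ioc 0 D, A d := by linarith
  -- pigeonhole
  obtain ⟨d, hdD, hdA⟩ : ∃ d ∈ Ioc 0 D, δ * N / (2 * D) ≤ A d := by
    by_contra hcon
    push Not at hcon
    have hlt : ∑ d ∈ Ioc 0 D, A d < ∑ _d ∈ Ioc 0 D, δ * N / (2 * D) :=
      Finset.sum_lt_sum_of_nonempty ⟨1, by rw [Finset.mem_Ioc]; omega⟩ hcon
    rw [Finset.sum_const, Nat.card_Ioc, Nat.sub_zero, nsmul_eq_mul] at hlt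
    have : (D : ℝ) * (δ * N / (2 * D)) = δ * N / 2 := by field_simp
    linarith
  have hd0 : 0 < d := (Finset.mem_Ioc.1 hdD).1
  have hdle : d ≤ D := (Finset.mem_Ioc.1 hdD).2
  have hd0' : (0 : ℝ) < d := by exact_mod_cast hd0
  have hdd0 : (0 : ℝ) < ((d * d : ℕ) : ℝ) := by positivity
  set M : ℕ := N / (d * d) with hM
  -- `d ≤ 3/δ`, `M ≥ Nδ²/9 − 1`
  have hdδ : (d : ℝ) ≤ 3 / δ := le_trans (by exact_mod_cast hdle) hDle
  have hdd : ((d * d : ℕ) : ℝ) ≤ 9 / δ ^ 2 := by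
    push_cast
    calc (d : ℝ) * d ≤ (3 / δ) * (3 / δ) := mul_le_mul hdδ hdδ hd0'.le (by positivity)
      _ = 9 / δ ^ 2 := by field_simp; ring
  have hMreal : (N : ℝ) / ((d * d : ℕ) : ℝ) - 1 ≤ M := by
    rw [hM]
    have h := Nat.lt_div_mul_add (a := N) (Nat.mul_pos hd0 hd0)
    have h' : (N : ℝ) < ((N / (d * d) : ℕ) : ℝ) * ((d * d : ℕ) : ℝ) + ((d * d : ℕ) : ℝ) := by exact_mod_cast h
    rw [div_sub_one hdd0.ne', div_le_iff₀ hdd0]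
    linarith
  have hMlow : (N : ℝ) * δ ^ 2 / 9 - 1 ≤ M := by
    refine le_trans ?_ hMreal
    have : (N : ℝ) * δ ^ 2 / 9 ≤ (N : ℝ) / ((d * d : ℕ) : ℝ) := by
      rw [div_le_div_iff₀ (by norm_num) hdd0]
      calc (N : ℝ) * δ ^ 2 * ((d * d : ℕ) : ℝ) ≤ (N : ℝ) * δ ^ 2 * (9 / δ ^ 2) :=
            mul_le_mul_of_nonneg_left hdd (by positivity)
        _ = N * 9 := by field_simp
    linarith
  have hMN : M ≤ N := Nat.div_le_self _ _
  obtain ⟨hM3, hMcond⟩ := hcond M hMlow hMN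
  have hM0 : (0 : ℝ) < M := by exact_mod_cast lt_of_lt_of_le (by norm_num) hM3
  have hMle : (M : ℝ) ≤ N := by exact_mod_cast hMN
  have hMreal' : (M : ℝ) ≤ (N : ℝ) / ((d * d : ℕ) : ℝ) := by rw [hM]; exact Nat.cast_div_le
  -- `δ' = δ/(2D) ≥ δ²/6`
  set δ' : ℝ := δ / (2 * D) with hδ'
  have hD0' : (0 : ℝ) < D := by exact_mod_cast hD0
  have hδ'0 : 0 < δ' := by positivity
  have hδ'ge : δ ^ 2 / 6 ≤ δ' := by
    rw [hδ', div_le_div_iff₀ (by norm_num) (by positivity)]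
    have : (2 : ℝ) * D ≤ 6 / δ := by
      calc (2 : ℝ) * D ≤ 2 * (3 / δ) := by linarith
        _ = 6 / δ := by ring
    calc δ ^ 2 * (2 * D) ≤ δ ^ 2 * (6 / δ) := mul_le_mul_of_nonneg_left this (by positivity)
      _ = δ * 6 := by field_simp
  have hcondM : 12288 * Real.log M ^ 4 * (M : ℝ) ^ (9 / 10 : ℝ) ≤ δ' * M :=
    hMcond.trans (mul_le_mul_of_nonneg_right hδ'ge hM0.le)
  have hlargeM : δ' * M ≤ ‖afExpSum (fun m => (μ m : ℝ)) M ((d * d : ℕ) * θ)‖ := by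
    calc δ' * M ≤ δ' * N := mul_le_mul_of_nonneg_left hMle hδ'0.le
      _ = δ * N / (2 * D) := by rw [hδ']; ring
      _ ≤ A d := hdA
  obtain ⟨r, hrden, hrθ⟩ := exists_rat_near_of_large_moebiusExpSum hM3 hδ'0 hcondM hlargeM
  -- sizes
  have hlogM : Real.log M ≤ Real.log N := Real.log_le_log hM0 hMle
  have hlogM0 : 0 ≤ Real.log M := Real.log_natCast_nonneg M
  have hlog8 : Real.log M ^ 8 ≤ Real.log N ^ 8 := pow_le_pow_left₀ hlogM0 hlogM 8
  have hδ'inv : 1 / δ' ^ 2 ≤ 36 / δ ^ 4 := by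
    rw [div_le_div_iff₀ (by positivity) (by positivity)]
    have h1 : (δ ^ 2 / 6) ^ 2 ≤ δ' ^ 2 := pow_le_pow_left₀ (by positivity) hδ'ge 2
    nlinarith
  have hδ46 : (1 : ℝ) / δ ^ 4 ≤ 1 / δ ^ 6 := by
    refine div_le_div_of_nonneg_left zero_le_one (by positivity) ?_
    calc δ ^ 6 = δ ^ 4 * δ ^ 2 := by ring
      _ ≤ δ ^ 4 * 1 := mul_le_mul_of_nonneg_left (pow_le_one₀ hδ.le hδ1) (by positivity)
      _ = δ ^ 4 := mul_one _
  refine ⟨r.den * (d * d), Nat.mul_pos r.den_pos (Nat.mul_pos hd0 hd0), ?_, r.num, ?_⟩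
  · -- `den · d² ≤ (12288² (log N)⁸ · 36/δ⁴)(9/δ²)`
    push_cast
    calc (r.den : ℝ) * ((d : ℝ) * d) ≤ (12288 ^ 2 * Real.log M ^ 8 / δ' ^ 2) * (9 / δ ^ 2) := by
          refine mul_le_mul hrden (by exact_mod_cast hdd) (by positivity) (by positivity)
      _ = 12288 ^ 2 * 9 * Real.log M ^ 8 * (1 / δ' ^ 2) * (1 / δ ^ 2) := by ring
      _ ≤ 12288 ^ 2 * 9 * Real.log N ^ 8 * (36 / δ ^ 4) * (1 / δ ^ 2) := by
          gcongr
      _ = 12288 ^ 2 * 324 * Real.log N ^ 8 / δ ^ 6 := by field_simp; ring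
  · -- `|θ − num/(den d²)| = |d²θ − r|/d² ≤ …`
    have hcast : ((r.num : ℝ)) / ((r.den * (d * d) : ℕ) : ℝ) = (r : ℝ) / ((d * d : ℕ) : ℝ) := by
      rw [Rat.cast_def]; push_cast; field_simp
    rw [hcast]
    have hθeq : θ - (r : ℝ) / ((d * d : ℕ) : ℝ) = (((d * d : ℕ) : ℝ) * θ - r) / ((d * d : ℕ) : ℝ) := by
      field_simp
    rw [hθeq, abs_div, abs_of_pos hdd0, div_le_iff₀ hdd0]
    refine hrθ.trans ?_
    -- `12288² (log M)⁸/(δ'² M) ≤ 12288²·324 (log N)⁸/(δ⁶N) · d²`, using `1/M ≤ 2d²/N`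
    have hMinv : 1 / (M : ℝ) ≤ 2 * ((d * d : ℕ) : ℝ) / N := by
      -- `M ≥ N/d² − 1 ≥ N/(2d²)` since `N/d² ≥ M ≥ 3 ≥ 2`
      have h1 : (2 : ℝ) ≤ (N : ℝ) / ((d * d : ℕ) : ℝ) := le_trans (by exact_mod_cast (by omega : 2 ≤ M)) hMreal'
      have h2 : (N : ℝ) / ((d * d : ℕ) : ℝ) / 2 ≤ M := by linarith
      rw [div_le_div_iff₀ hM0 hN0]
      have h3 : (N : ℝ) ≤ 2 * ((d * d : ℕ) : ℝ) * M := by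
        have h4 : (N : ℝ) / (((d * d : ℕ) : ℝ) * 2) ≤ M := by rw [← div_div]; exact h2
        rw [div_le_iff₀ (by positivity)] at h4
        linarith
      linarith
    calc 12288 ^ 2 * Real.log M ^ 8 / (δ' ^ 2 * M)
        = 12288 ^ 2 * Real.log M ^ 8 * (1 / δ' ^ 2) * (1 / M) := by field_simp
      _ ≤ 12288 ^ 2 * Real.log N ^ 8 * (36 / δ ^ 4) * (2 * ((d * d : ℕ) : ℝ) / N) := by gcongr
      _ = 12288 ^ 2 * 72 * Real.log N ^ 8 * (1 / δ ^ 4) / N * ((d * d : ℕ) : ℝ) := by field_simp; ring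
      _ ≤ 12288 ^ 2 * 324 * Real.log N ^ 8 * (1 / δ ^ 6) / N * ((d * d : ℕ) : ℝ) := by gcongr; norm_num
      _ = 12288 ^ 2 * 324 * Real.log N ^ 8 / (δ ^ 6 * N) * ((d * d : ℕ) : ℝ) := by field_simp


/-! ### Green 2012, Lemma 1 (Harman–Kátai): near a sparse dyadic rational, small denominators are powers of two -/

/-- The empty-block pigeonhole: for `S ⊆ {0,…,n−1}` with `|S| = k` and `G = ⌊n/(k+1)⌋`, there is
`b ∈ {0} ∪ {j+1 : j ∈ S}` with `b + G ≤ n` such that every level `j + 1 > b`, `j ∈ S`, is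
`≥ b + G + 1` (one of the `k+1` blocks `(iG, (i+1)G]` contains no level; take `b` the largest
point `≤ iG`). Green: "By the pigeonhole principle there is some index `j` such that
`|i_j − i_{j+1}| ≥ n/2k`." [cite: Green2012, Lemma 1 (proof)] -/
theorem exists_gap {n : ℕ} (S : Finset (Fin n)) :
    ∃ b : ℕ, (b = 0 ∨ ∃ j ∈ S, b = (j : ℕ) + 1) ∧ b + n / (S.card + 1) ≤ n ∧
      ∀ j ∈ S, b < (j : ℕ) + 1 → b + n / (S.card + 1) + 1 ≤ (j : ℕ) + 1 := by
  classical
  set k := S.card with hk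
  set G := n / (k + 1) with hG
  have hGk : (k + 1) * G ≤ n := by rw [hG, mul_comm]; exact Nat.div_mul_le_self n (k + 1)
  -- levels and their blocks
  set Lv : Finset ℕ := S.image (fun j : Fin n => (j : ℕ) + 1) with hLv
  have hLcard : Lv.card ≤ k := by rw [hLv, hk]; exact Finset.card_image_le
  rcases Nat.eq_zero_or_pos G with hG0 | hGpos
  · -- `G = 0`: `b = 0` works trivially
    refine ⟨0, Or.inl rfl, by rw [hG0]; omega, fun j _ hj => by rw [hG0]; omega⟩
  -- an empty block
  set φ : ℕ → ℕ := fun ℓ => (ℓ - 1) / G with hφ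
  have himg : (Lv.image φ).card < (Finset.range (k + 1)).card := by
    rw [Finset.card_range]
    exact lt_of_le_of_lt (Finset.card_image_le.trans hLcard) (Nat.lt_succ_self k)
  obtain ⟨i, hi, hinot⟩ : ∃ i ∈ Finset.range (k + 1), i ∉ Lv.image φ := by
    by_contra hcon
    push Not at hcon
    have hsub : Finset.range (k + 1) ⊆ Lv.image φ := fun i hi => hcon i hi
    exact absurd (Finset.card_le_card hsub) (not_le.2 himg)
  have hik : i ≤ k := by rw [Finset.mem_range] at hi; omega
  -- no level in `(iG, (i+1)G]`
  have hempty : ∀ j ∈ S, ¬ (i * G < (j : ℕ) + 1 ∧ (j : ℕ) + 1 ≤ (i + 1) * G) := by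
    intro j hj hcon
    apply hinot
    rw [Finset.mem_image]
    refine ⟨(j : ℕ) + 1, Finset.mem_image.2 ⟨j, hj, rfl⟩, ?_⟩
    rw [hφ]
    dsimp only
    rw [Nat.add_sub_cancel]
    apply Nat.div_eq_of_lt_le
    · calc i * G ≤ (j : ℕ) := by omega
        _ = j := rfl
    · calc (j : ℕ) < (i + 1) * G := by omega
        _ = (i + 1) * G := rfl
  -- `b` = the largest point of `{0} ∪ Lv` below `iG`
  set T := (insert 0 Lv).filter (fun ℓ => ℓ ≤ i * G) with hT
  have hTne : T.Nonempty := ⟨0, by rw [hT, Finset.mem_filter]; exact ⟨Finset.mem_insert_self _ _, Nat.zero_le _⟩⟩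
  set b := T.max' hTne with hb
  have hbT : b ∈ T := Finset.max'_mem T hTne
  have hbmem : b ∈ insert 0 Lv ∧ b ≤ i * G := by simpa [hT] using hbT
  refine ⟨b, ?_, ?_, ?_⟩
  · rcases Finset.mem_insert.1 hbmem.1 with h0 | hL
    · exact Or.inl h0
    · rw [hLv, Finset.mem_image] at hL
      obtain ⟨j, hj, hjb⟩ := hL
      exact Or.inr ⟨j, hj, hjb.symm⟩
  · calc b + G ≤ i * G + G := by omega
      _ = (i + 1) * G := by ring
      _ ≤ (k + 1) * G := Nat.mul_le_mul_right G (by omega)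
      _ ≤ n := hGk
  · intro j hj hbj
    -- `j + 1 > iG` (else `j+1 ∈ T`, `j + 1 ≤ b`), hence `> (i+1)G` by emptiness
    have h1 : i * G < (j : ℕ) + 1 := by
      by_contra hle
      push Not at hle
      have hmemT : (j : ℕ) + 1 ∈ T := by
        rw [hT, Finset.mem_filter]
        exact ⟨Finset.mem_insert_of_mem (Finset.mem_image.2 ⟨j, hj, rfl⟩), hle⟩
      have := Finset.le_max' T _ hmemT
      rw [← hb] at this
      omega
    have h2 : (i + 1) * G < (j : ℕ) + 1 := by
      by_contra hle
      push Not at hle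
      exact hempty j hj ⟨h1, hle⟩
    have h3 : b + G + 1 ≤ (i + 1) * G + 1 := by
      have : b ≤ i * G := hbmem.2
      nlinarith
    omega

/-- A geometric tail over distinct levels: `∑_{j ∈ S, j+1 ≥ M₀} 2^{−(j+1)} ≤ 2 · 2^{−M₀}`. [folklore] -/
theorem sum_two_pow_neg_le {n : ℕ} (S : Finset (Fin n)) (M₀ : ℕ) :
    ∑ j ∈ S.filter (fun j : Fin n => M₀ ≤ (j : ℕ) + 1), ((1 : ℝ) / 2) ^ ((j : ℕ) + 1) ≤ 2 * (1 / 2) ^ M₀ := by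
  -- inject into the levels `m ∈ [M₀, n]`
  have hinj : Set.InjOn (fun j : Fin n => (j : ℕ) + 1) (S.filter (fun j : Fin n => M₀ ≤ (j : ℕ) + 1) : Set (Fin n)) := by
    intro x _ y _ hxy
    exact Fin.ext (by simpa using hxy)
  rw [← Finset.sum_image (f := fun m : ℕ => ((1 : ℝ) / 2) ^ m) hinj]
  have hsub : (S.filter (fun j : Fin n => M₀ ≤ (j : ℕ) + 1)).image (fun j : Fin n => (j : ℕ) + 1) ⊆ Finset.Ico M₀ (n + 1) := by
    intro m hm
    rw [Finset.mem_image] at hm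
    obtain ⟨j, hj, rfl⟩ := hm
    rw [Finset.mem_filter] at hj
    rw [Finset.mem_Ico]
    exact ⟨hj.2, by omega⟩
  refine (Finset.sum_le_sum_of_subset_of_nonneg hsub fun _ _ _ => by positivity).trans ?_
  rcases le_or_gt M₀ (n + 1) with hM | hM
  · rw [geom_sum_Ico (by norm_num) hM]
    have h1 : ((1 : ℝ) / 2) ^ (n + 1) ≥ 0 := by positivity
    have h2 : ((1 : ℝ) / 2 - 1) = -(1 / 2) := by norm_num
    rw [h2]
    have : (((1 : ℝ) / 2) ^ (n + 1) - (1 / 2) ^ M₀) / -(1 / 2) = 2 * (1 / 2) ^ M₀ - 2 * (1 / 2) ^ (n + 1) := by ring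
    rw [this]
    linarith
  · rw [Finset.Ico_eq_empty (by omega), Finset.sum_empty]
    positivity

/-- **Green 2012, Lemma 1 (Harman–Kátai), for a sparse dyadic rational `θ = ∑_{j∈S} h_j/2^{j+1}`**:
if `|h_j| ≤ Q`, `1 ≤ q ≤ Q`, `|θ − a/q| ≤ Q/2^n` and `2Q² < 2^{⌊n/(k+1)⌋}` (`k = |S|`), then `a/q`
is a dyadic rational `a₁/2^v` with `2^v ≤ q` (Green: "then `q` is a power of two"). Proof as
printed: with the gap `b` of `exists_gap`, `θ` is within `Q·2^{−(b+G)}` of `a'/2^b`,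
`|a/q − a'/2^b| < 1/(q2^b)`, so `a·2^b = a'q` and the odd part of `q` divides `a`.
[cite: Green2012, Lemma 1] -/
theorem harmanKatai {n : ℕ} (S : Finset (Fin n)) (h : Fin n → ℤ) {Q : ℝ} (hQ1 : 1 ≤ Q)
    (hh : ∀ j ∈ S, |(h j : ℝ)| ≤ Q) {a : ℤ} {q : ℕ} (hq : 1 ≤ q) (hqQ : (q : ℝ) ≤ Q)
    (hθ : |∑ j ∈ S, (h j : ℝ) / 2 ^ ((j : ℕ) + 1) - a / q| ≤ Q / 2 ^ n)
    (hgap : 2 * Q ^ 2 < (2 : ℝ) ^ (n / (S.card + 1))) :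
    ∃ v : ℕ, ∃ a₁ : ℤ, (2 : ℝ) ^ v ≤ q ∧ (a : ℝ) / q = a₁ / 2 ^ v := by
  classical
  obtain ⟨b, hbmem, hbn, hbgap⟩ := exists_gap S
  set G := n / (S.card + 1) with hG
  set θ : ℝ := ∑ j ∈ S, (h j : ℝ) / 2 ^ ((j : ℕ) + 1) with hθdef
  -- `a' = ∑_{j+1 ≤ b} h_j 2^{b−(j+1)}`
  set Slow := S.filter (fun j : Fin n => (j : ℕ) + 1 ≤ b) with hSlow
  set Shigh := S.filter (fun j : Fin n => ¬ ((j : ℕ) + 1 ≤ b)) with hShigh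
  set a' : ℤ := ∑ j ∈ Slow, h j * 2 ^ (b - ((j : ℕ) + 1)) with ha'
  have hsplit : θ = (a' : ℝ) / 2 ^ b + ∑ j ∈ Shigh, (h j : ℝ) / 2 ^ ((j : ℕ) + 1) := by
    rw [hθdef, ← Finset.sum_filter_add_sum_filter_not S (fun j : Fin n => (j : ℕ) + 1 ≤ b)]
    congr 1
    rw [ha']
    push_cast
    rw [Finset.sum_div]
    refine Finset.sum_congr rfl fun j hj => ?_
    have hjb : (j : ℕ) + 1 ≤ b := (Finset.mem_filter.1 hj).2
    rw [div_eq_div_iff (by positivity) (by positivity), mul_assoc, ← pow_add, Nat.sub_add_cancel hjb]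
  -- the high part is small: `≤ Q · 2 · 2^{-(b+G+1)} = Q 2^{-(b+G)}`
  have hhigh : |∑ j ∈ Shigh, (h j : ℝ) / 2 ^ ((j : ℕ) + 1)| ≤ Q * (2 * ((1 : ℝ) / 2) ^ (b + G + 1)) := by
    calc |∑ j ∈ Shigh, (h j : ℝ) / 2 ^ ((j : ℕ) + 1)| ≤ ∑ j ∈ Shigh, |(h j : ℝ) / 2 ^ ((j : ℕ) + 1)| :=
          Finset.abs_sum_le_sum_abs _ _
      _ ≤ ∑ j ∈ Shigh, Q * ((1 : ℝ) / 2) ^ ((j : ℕ) + 1) := by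
          refine Finset.sum_le_sum fun j hj => ?_
          rw [abs_div, abs_of_pos (by positivity : (0 : ℝ) < 2 ^ ((j : ℕ) + 1)), one_div, inv_pow,
            ← div_eq_mul_inv]
          exact div_le_div_of_nonneg_right (hh j (Finset.mem_filter.1 hj).1) (by positivity)
      _ = Q * ∑ j ∈ Shigh, ((1 : ℝ) / 2) ^ ((j : ℕ) + 1) := by rw [Finset.mul_sum]
      _ ≤ Q * (2 * ((1 : ℝ) / 2) ^ (b + G + 1)) := by
          refine mul_le_mul_of_nonneg_left ?_ (by linarith)
          have hsub : Shigh ⊆ S.filter (fun j : Fin n => b + G + 1 ≤ (j : ℕ) + 1) := by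
            intro j hj
            rw [Finset.mem_filter] at hj ⊢
            exact ⟨hj.1, hbgap j hj.1 (not_le.1 hj.2)⟩
          exact (Finset.sum_le_sum_of_subset_of_nonneg hsub fun _ _ _ => by positivity).trans
            (sum_two_pow_neg_le S (b + G + 1))
  -- `|a/q − a'/2^b| < 1/(q 2^b)`
  have hq0 : (0 : ℝ) < q := by exact_mod_cast hq
  have hQ0 : 0 < Q := by linarith
  have h2b : (0 : ℝ) < 2 ^ b := by positivity
  have hkey : |(a : ℝ) / q - (a' : ℝ) / 2 ^ b| < 1 / (q * 2 ^ b) := by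
    have h1 : |(a : ℝ) / q - (a' : ℝ) / 2 ^ b| ≤ Q / 2 ^ n + Q * (2 * ((1 : ℝ) / 2) ^ (b + G + 1)) := by
      have e : (a : ℝ) / q - (a' : ℝ) / 2 ^ b = (∑ j ∈ Shigh, (h j : ℝ) / 2 ^ ((j : ℕ) + 1)) - (θ - a / q) := by
        rw [hsplit]; ring
      rw [e]
      refine (abs_sub _ _).trans ?_
      rw [add_comm]
      exact add_le_add hθ hhigh
    refine lt_of_le_of_lt h1 ?_
    -- multiply by `q 2^b ≤ Q 2^b`: `Q² 2^b/2^n + Q² 2^{-G} ≤ 2Q² 2^{-G} < 1`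
    rw [lt_div_iff₀ (by positivity)]
    have hbG : (2 : ℝ) ^ b * (2 : ℝ) ^ G ≤ 2 ^ n := by
      rw [← pow_add]; exact pow_le_pow_right₀ (by norm_num) hbn
    have h2G : (0 : ℝ) < 2 ^ G := by positivity
    have e1 : (2 * ((1 : ℝ) / 2) ^ (b + G + 1)) = 1 / (2 ^ b * 2 ^ G) := by
      rw [div_pow, one_pow, pow_succ, pow_add, eq_div_iff (by positivity)]
      field_simp
    rw [e1]
    have hqb : (q : ℝ) * 2 ^ b ≤ Q * 2 ^ b := mul_le_mul_of_nonneg_right hqQ h2b.le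
    calc (Q / 2 ^ n + Q * (1 / (2 ^ b * 2 ^ G))) * (q * 2 ^ b)
        ≤ (Q / 2 ^ n + Q * (1 / (2 ^ b * 2 ^ G))) * (Q * 2 ^ b) :=
          mul_le_mul_of_nonneg_left hqb (by positivity)
      _ = Q ^ 2 * (2 ^ b / 2 ^ n) + Q ^ 2 / 2 ^ G := by field_simp
      _ ≤ Q ^ 2 * (1 / 2 ^ G) + Q ^ 2 / 2 ^ G := by
          refine add_le_add (mul_le_mul_of_nonneg_left ?_ (by positivity)) le_rfl
          rw [div_le_div_iff₀ (by positivity) h2G, one_mul]; exact hbG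
      _ = 2 * Q ^ 2 / 2 ^ G := by ring
      _ < 1 := by rw [div_lt_one h2G]; exact hgap
  -- hence `a 2^b = a' q`
  have hint : a * 2 ^ b = a' * q := by
    have h1 : |((a * 2 ^ b - a' * q : ℤ) : ℝ)| < 1 := by
      have e : ((a * 2 ^ b - a' * q : ℤ) : ℝ) = ((a : ℝ) / q - (a' : ℝ) / 2 ^ b) * (q * 2 ^ b) := by
        push_cast; field_simp
      rw [e, abs_mul, abs_of_pos (by positivity : (0 : ℝ) < q * 2 ^ b)]
      calc |(a : ℝ) / q - (a' : ℝ) / 2 ^ b| * (q * 2 ^ b) < 1 / (q * 2 ^ b) * (q * 2 ^ b) :=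
            mul_lt_mul_of_pos_right hkey (by positivity)
        _ = 1 := by field_simp
    have h2 : |a * 2 ^ b - a' * q| < 1 := by exact_mod_cast h1
    have h3 : a * 2 ^ b - a' * q = 0 := Int.abs_lt_one_iff.mp h2
    linarith
  -- the odd part of `q` divides `a`
  obtain ⟨v, q₀, hq₀odd, hqv⟩ := Nat.exists_eq_two_pow_mul_odd (by omega : q ≠ 0)
  have hdvd : (q₀ : ℤ) ∣ a * 2 ^ b := by
    refine ⟨a' * 2 ^ v, ?_⟩
    rw [hint, hqv]; push_cast; ring
  have hcop : IsCoprime (q₀ : ℤ) ((2 : ℤ) ^ b) := by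
    apply IsCoprime.pow_right
    have hc2 : Nat.Coprime q₀ 2 :=
      (Nat.prime_two.coprime_iff_not_dvd.2 (by rw [Nat.two_dvd_ne_zero]; exact Nat.odd_iff.1 hq₀odd)).symm
    rw [Int.isCoprime_iff_gcd_eq_one]
    rw [Nat.Coprime] at hc2
    exact_mod_cast hc2
  obtain ⟨a₁, ha₁⟩ := hcop.dvd_of_dvd_mul_right hdvd
  refine ⟨v, a₁, ?_, ?_⟩
  · have : 2 ^ v ≤ q := by
      rw [hqv]; exact Nat.le_mul_of_pos_right _ (Nat.pos_of_ne_zero (fun h0 => by simp [h0] at hq₀odd))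
    exact_mod_cast this
  · have hq₀0 : (q₀ : ℝ) ≠ 0 := by
      have : q₀ ≠ 0 := fun h0 => by simp [h0] at hq₀odd
      exact_mod_cast this
    rw [ha₁, hqv]; push_cast
    field_simp



/-! ### Growth lemmas: polynomials, `e^{a√L}`, `e^{bL}` -/

/-- `A L^p ≤ e^{a√L}` for all large `L` (`A, a > 0`). [folklore] -/
theorem exists_pow_le_exp_sqrt {A a : ℝ} (hA : 0 < A) (ha : 0 < a) (p : ℕ) :
    ∃ L₀ : ℝ, 0 < L₀ ∧ ∀ L : ℝ, L₀ ≤ L → A * L ^ p ≤ Real.exp (a * Real.sqrt L) := by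
  -- `L^p e^{-(a/2)√L} ≤ B`, so `A L^p ≤ A B e^{(a/2)√L} ≤ e^{a√L}` once `e^{(a/2)√L} ≥ A B`
  set B : ℝ := (2 * p).factorial / (a / 2) ^ (2 * p) with hB
  have hB0 : 0 < B := by positivity
  set L₀ : ℝ := max 1 ((2 * Real.log (A * B) / a) ^ 2) with hL₀
  refine ⟨L₀, lt_of_lt_of_le one_pos (le_max_left _ _), fun L hL => ?_⟩
  have hL1 : 1 ≤ L := (le_max_left _ _).trans hL
  have hL0 : 0 ≤ L := by linarith
  have h1 := MoebiusTwist.pow_mul_exp_neg_sqrt_le (a := a / 2) (by positivity) hL0 p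
  -- `L^p ≤ B e^{(a/2)√L}`
  have h2 : L ^ p ≤ B * Real.exp (a / 2 * Real.sqrt L) := by
    rw [Real.exp_neg] at h1
    rw [← hB] at h1
    have := (mul_inv_le_iff₀ (Real.exp_pos _)).1 h1
    linarith
  -- `A B ≤ e^{(a/2)√L}`
  have h3 : A * B ≤ Real.exp (a / 2 * Real.sqrt L) := by
    have hsq : (2 * Real.log (A * B) / a) ^ 2 ≤ L := (le_max_right _ _).trans hL
    have h4 : 2 * Real.log (A * B) / a ≤ Real.sqrt L := by
      rcases le_or_gt 0 (2 * Real.log (A * B) / a) with hpos | hneg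
      · rw [← Real.sqrt_sq hpos]; exact Real.sqrt_le_sqrt hsq
      · exact hneg.le.trans (Real.sqrt_nonneg _)
    have h5 : Real.log (A * B) ≤ a / 2 * Real.sqrt L := by
      rw [div_le_iff₀ ha] at h4; linarith
    calc A * B = Real.exp (Real.log (A * B)) := (Real.exp_log (by positivity)).symm
      _ ≤ Real.exp (a / 2 * Real.sqrt L) := Real.exp_le_exp.2 h5
  calc A * L ^ p ≤ A * (B * Real.exp (a / 2 * Real.sqrt L)) := mul_le_mul_of_nonneg_left h2 hA.le
    _ = (A * B) * Real.exp (a / 2 * Real.sqrt L) := by ring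
    _ ≤ Real.exp (a / 2 * Real.sqrt L) * Real.exp (a / 2 * Real.sqrt L) :=
        mul_le_mul_of_nonneg_right h3 (Real.exp_pos _).le
    _ = Real.exp (a * Real.sqrt L) := by rw [← Real.exp_add]; congr 1; ring

/-- `A L^p e^{a√L} ≤ e^{bL}` for all large `L` (`A, a, b > 0`). [folklore] -/
theorem exists_pow_exp_sqrt_le_exp {A a b : ℝ} (hA : 0 < A) (ha : 0 < a) (hb : 0 < b) (p : ℕ) :
    ∃ L₀ : ℝ, 0 < L₀ ∧ ∀ L : ℝ, L₀ ≤ L → A * L ^ p * Real.exp (a * Real.sqrt L) ≤ Real.exp (b * L) := by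
  obtain ⟨L₁, hL₁, h1⟩ := exists_pow_le_exp_sqrt hA ha p
  -- `A L^p e^{a√L} ≤ e^{2a√L} ≤ e^{bL}` once `2a√L ≤ bL`, i.e. `√L ≥ 2a/b`
  refine ⟨max L₁ ((2 * a / b) ^ 2), lt_of_lt_of_le hL₁ (le_max_left _ _), fun L hL => ?_⟩
  have hLL₁ : L₁ ≤ L := (le_max_left _ _).trans hL
  have hL0 : 0 ≤ L := by linarith
  have hsq : 2 * a / b ≤ Real.sqrt L := by
    rw [← Real.sqrt_sq (by positivity : (0:ℝ) ≤ 2 * a / b)]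
    exact Real.sqrt_le_sqrt ((le_max_right _ _).trans hL)
  have h2 : 2 * a * Real.sqrt L ≤ b * L := by
    have := Real.sq_sqrt hL0
    rw [div_le_iff₀ hb] at hsq
    nlinarith [Real.sqrt_nonneg L]
  calc A * L ^ p * Real.exp (a * Real.sqrt L) ≤ Real.exp (a * Real.sqrt L) * Real.exp (a * Real.sqrt L) :=
        mul_le_mul_of_nonneg_right (h1 L hLL₁) (Real.exp_pos _).le
    _ = Real.exp (2 * a * Real.sqrt L) := by rw [← Real.exp_add]; congr 1; ring
    _ ≤ Real.exp (b * L) := Real.exp_le_exp.2 h2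



/-! ### Green 2012, Proposition 3 for `λ`: exponential sums at sparse dyadic rationals -/

/-- `∑_{x<N} f(x) = ∑_{n ∈ Icc 1 (N−1)} f(n)` for `f(0) = 0`, as an `afExpSum`. [folklore] -/
theorem sum_range_liouville_eq_afExpSum (N : ℕ) (θ : ℝ) :
    ∑ x ∈ range N, ((liouville x : ℤ) : ℂ) * (𝐞 ((x : ℝ) * θ) : ℂ) =
      afExpSum (fun n => (liouville n : ℝ)) (N - 1) θ := by
  rw [sum_range_eq_sum_Ioc_pred _ (by simp) N]
  unfold afExpSum
  refine Finset.sum_congr rfl fun n _ => ?_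
  push_cast
  rfl

/-- The largeness conditions of Proposition 4 (`exists_near_rat_of_large_liouvilleExpSum`) in the
setting of Proposition 3: with `X = e^L`, `E₁ = e^{−c₁√L} ≤ δ ≤ 1`, `X/2 ≤ N₁ ≤ X` and the two
growth thresholds, every `M ∈ [N₁δ²/9 − 1, N₁]` has `M ≥ 3` and
`12288 (log M)⁴ M^{9/10} ≤ (δ²/6) M`. [cite: Green2012, Proposition 3 (proof)] -/
theorem prop3_cond {c₁ L δ : ℝ} (hc₁ : 0 < c₁)
    (hδE : Real.exp (-(c₁ * Real.sqrt L)) ≤ δ)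
    (hA1 : 108 * Real.exp (2 * c₁ * Real.sqrt L) ≤ Real.exp L)
    (hA2 : 73728 * L ^ 4 * Real.exp (3 * c₁ * Real.sqrt L) ≤ Real.exp (1 / 10 * L))
    (hF108 : 108 ≤ Real.exp (c₁ * Real.sqrt L))
    {N₁ : ℕ} (hN₁ge : Real.exp L / 2 ≤ N₁) (hN₁le : (N₁ : ℝ) ≤ Real.exp L) :
    ∀ M : ℕ, (N₁ : ℝ) * δ ^ 2 / 9 - 1 ≤ M → M ≤ N₁ →
      3 ≤ M ∧ 12288 * Real.log M ^ 4 * (M : ℝ) ^ (9 / 10 : ℝ) ≤ δ ^ 2 / 6 * M := by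
  intro M hM1 hM2
  set E₁ : ℝ := Real.exp (-(c₁ * Real.sqrt L)) with hE₁
  set X : ℝ := Real.exp L with hX
  have hX0 : 0 < X := Real.exp_pos L
  have hE₁0 : 0 < E₁ := Real.exp_pos _
  have hE₁2 : E₁ ^ 2 ≤ δ ^ 2 := pow_le_pow_left₀ hE₁0.le hδE 2
  have hE₁sq : E₁ ^ 2 = Real.exp (-(2 * c₁ * Real.sqrt L)) := by
    rw [hE₁, ← Real.exp_nat_mul]; congr 1; push_cast; ring
  have hFE : Real.exp (c₁ * Real.sqrt L) * E₁ = 1 := by rw [hE₁, ← Real.exp_add]; simp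
  -- `X E₁² ≥ 108`
  have hA1' : 108 ≤ X * E₁ ^ 2 := by
    rw [hE₁sq, Real.exp_neg, ← div_eq_mul_inv, le_div_iff₀ (Real.exp_pos _)]
    linarith
  have hMge : X * E₁ ^ 2 / 36 ≤ M := by
    have h1 : X / 2 * E₁ ^ 2 ≤ (N₁ : ℝ) * δ ^ 2 := mul_le_mul hN₁ge hE₁2 (by positivity) (Nat.cast_nonneg _)
    linarith
  have hM3r : (3 : ℝ) ≤ M := le_trans (by linarith) hMge
  have hM3 : 3 ≤ M := by exact_mod_cast hM3r
  have hM0 : (0 : ℝ) < M := by linarith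
  refine ⟨hM3, ?_⟩
  have hMle : (M : ℝ) ≤ X := (Nat.cast_le.2 hM2).trans hN₁le
  have hlogM : Real.log M ≤ L := by
    have := Real.log_le_log hM0 hMle; rwa [hX, Real.log_exp] at this
  have hlogM0 : 0 ≤ Real.log M := Real.log_natCast_nonneg M
  -- `M ≥ X E₁³`
  have hMge' : X * E₁ ^ 3 ≤ M := by
    refine le_trans ?_ hMge
    rw [le_div_iff₀ (by norm_num)]
    have h36 : E₁ * 36 ≤ 1 := by nlinarith
    calc X * E₁ ^ 3 * 36 = X * E₁ ^ 2 * (E₁ * 36) := by ring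
      _ ≤ X * E₁ ^ 2 * 1 := mul_le_mul_of_nonneg_left h36 (by positivity)
      _ = X * E₁ ^ 2 := mul_one _
  -- `M^{1/10} ≥ e^{L/10 − 0.3 c₁ √L}`
  have hM110 : Real.exp (L / 10 - 3 / 10 * c₁ * Real.sqrt L) ≤ (M : ℝ) ^ (1 / 10 : ℝ) := by
    have h1 : X * E₁ ^ 3 = Real.exp (L - 3 * c₁ * Real.sqrt L) := by
      rw [hX, hE₁, ← Real.exp_nat_mul, ← Real.exp_add]; congr 1; push_cast; ring
    have h2 : Real.exp (L / 10 - 3 / 10 * c₁ * Real.sqrt L) = (Real.exp (L - 3 * c₁ * Real.sqrt L)) ^ (1 / 10 : ℝ) := by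
      rw [← Real.exp_mul]; congr 1; ring
    rw [h2, ← h1]
    exact Real.rpow_le_rpow (by positivity) hMge' (by norm_num)
  have hkey : 12288 * Real.log M ^ 4 ≤ δ ^ 2 / 6 * (M : ℝ) ^ (1 / 10 : ℝ) := by
    have h1 : 12288 * Real.log M ^ 4 ≤ 12288 * L ^ 4 := by
      have := pow_le_pow_left₀ hlogM0 hlogM 4; nlinarith
    have h2 : 12288 * L ^ 4 ≤ E₁ ^ 2 / 6 * Real.exp (L / 10 - 3 / 10 * c₁ * Real.sqrt L) := by
      rw [hE₁sq, div_mul_eq_mul_div, ← Real.exp_add, le_div_iff₀ (by norm_num)]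
      have e2 : Real.exp (-(2 * c₁ * Real.sqrt L) + (L / 10 - 3 / 10 * c₁ * Real.sqrt L)) =
          Real.exp (1 / 10 * L) * Real.exp (-(23 / 10 * c₁ * Real.sqrt L)) := by
        rw [← Real.exp_add]; congr 1; ring
      rw [e2]
      have e3 : Real.exp (-(3 * c₁ * Real.sqrt L)) ≤ Real.exp (-(23 / 10 * c₁ * Real.sqrt L)) :=
        Real.exp_le_exp.2 (by nlinarith [Real.sqrt_nonneg L])
      have e4 : 73728 * L ^ 4 * Real.exp (3 * c₁ * Real.sqrt L) * Real.exp (-(3 * c₁ * Real.sqrt L)) = 73728 * L ^ 4 := by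
        rw [mul_assoc, ← Real.exp_add]; simp
      calc 12288 * L ^ 4 * 6 = 73728 * L ^ 4 := by ring
        _ = 73728 * L ^ 4 * Real.exp (3 * c₁ * Real.sqrt L) * Real.exp (-(3 * c₁ * Real.sqrt L)) := e4.symm
        _ ≤ Real.exp (1 / 10 * L) * Real.exp (-(3 * c₁ * Real.sqrt L)) :=
            mul_le_mul_of_nonneg_right hA2 (Real.exp_pos _).le
        _ ≤ Real.exp (1 / 10 * L) * Real.exp (-(23 / 10 * c₁ * Real.sqrt L)) :=
            mul_le_mul_of_nonneg_left e3 (Real.exp_pos _).le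
    have h3 : E₁ ^ 2 / 6 * Real.exp (L / 10 - 3 / 10 * c₁ * Real.sqrt L) ≤ δ ^ 2 / 6 * (M : ℝ) ^ (1 / 10 : ℝ) :=
      mul_le_mul (by linarith) hM110 (Real.exp_pos _).le (by positivity)
    linarith
  have hM910 : (M : ℝ) ^ (9 / 10 : ℝ) * (M : ℝ) ^ (1 / 10 : ℝ) = M := by
    rw [← Real.rpow_add hM0]; norm_num
  calc 12288 * Real.log M ^ 4 * (M : ℝ) ^ (9 / 10 : ℝ)
      ≤ (δ ^ 2 / 6 * (M : ℝ) ^ (1 / 10 : ℝ)) * (M : ℝ) ^ (9 / 10 : ℝ) :=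
        mul_le_mul_of_nonneg_right hkey (by positivity)
    _ = δ ^ 2 / 6 * M := by rw [mul_assoc, mul_comm ((M:ℝ) ^ (1/10:ℝ)), hM910]

/-- The gap inequality of Lemma 1 in the setting of Proposition 3: for `n ≥ 2` and
`1 ≤ k ≤ c₅√n`, `c₅ = 1/(26c₁/√log 2 + 4)`, one has `13c₁√(n log 2) < ⌊n/(k+1)⌋ log 2`.
[cite: Green2012, Proposition 3 (proof)] -/
theorem prop3_gap {c₁ : ℝ} (hc₁ : 0 < c₁) {n k : ℕ} (hn2 : 2 ≤ n) (hk1 : 1 ≤ k)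
    (hSk : (k : ℝ) ≤ 1 / (26 * c₁ / Real.sqrt (Real.log 2) + 4) * Real.sqrt n) :
    13 * c₁ * Real.sqrt (n * Real.log 2) < ((n / (k + 1) : ℕ) : ℝ) * Real.log 2 := by
  have hl2 : 0 < Real.log 2 := Real.log_pos one_lt_two
  have hsl2 : 0 < Real.sqrt (Real.log 2) := Real.sqrt_pos.2 hl2
  set c₅ : ℝ := 1 / (26 * c₁ / Real.sqrt (Real.log 2) + 4) with hc₅def
  have hc₅ : 0 < c₅ := by rw [hc₅def]; positivity
  have hk1r : (1 : ℝ) ≤ k := by exact_mod_cast hk1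
  have h1 : (n : ℝ) / (k + 1) - 1 ≤ ((n / (k + 1) : ℕ) : ℝ) := by
    have := Nat.lt_div_mul_add (a := n) (b := k + 1) (by omega)
    have h' : (n : ℝ) < ((n / (k + 1) : ℕ) : ℝ) * (k + 1) + (k + 1) := by exact_mod_cast this
    rw [div_sub_one (by positivity), div_le_iff₀ (by positivity)]
    linarith
  have hn0 : (0 : ℝ) < n := by exact_mod_cast (lt_of_lt_of_le two_pos hn2)
  have hsqn : 0 < Real.sqrt n := Real.sqrt_pos.2 hn0
  have h2 : Real.sqrt n / (2 * c₅) ≤ (n : ℝ) / (k + 1) := by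
    have hk2 : (k : ℝ) + 1 ≤ 2 * c₅ * Real.sqrt n := by
      have : (k : ℝ) ≤ c₅ * Real.sqrt n := hSk
      linarith
    rw [div_le_div_iff₀ (by positivity) (by positivity)]
    calc Real.sqrt n * (k + 1) ≤ Real.sqrt n * (2 * c₅ * Real.sqrt n) :=
          mul_le_mul_of_nonneg_left hk2 hsqn.le
      _ = n * (2 * c₅) := by rw [mul_comm (2 * c₅), ← mul_assoc, Real.mul_self_sqrt hn0.le]
  have hL' : Real.sqrt (n * Real.log 2) = Real.sqrt n * Real.sqrt (Real.log 2) :=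
    Real.sqrt_mul (Nat.cast_nonneg n) _
  have hc₅inv : 1 / (2 * c₅) = 13 * c₁ / Real.sqrt (Real.log 2) + 2 := by
    rw [hc₅def]; field_simp; ring
  have h3 : Real.sqrt n / (2 * c₅) = Real.sqrt n * (13 * c₁ / Real.sqrt (Real.log 2) + 2) := by
    rw [div_eq_mul_one_div, hc₅inv]
  have hsl22 : Real.sqrt (Real.log 2) * Real.sqrt (Real.log 2) = Real.log 2 := Real.mul_self_sqrt hl2.le
  have h4 : 13 * c₁ * Real.sqrt (n * Real.log 2) + Real.log 2 < (Real.sqrt n / (2 * c₅) - 1) * Real.log 2 := by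
    rw [h3, hL']
    have hsn1 : 1 < Real.sqrt n := by
      rw [show (1:ℝ) = Real.sqrt 1 by simp]
      exact Real.sqrt_lt_sqrt (by norm_num) (by exact_mod_cast hn2)
    have hdiv : Real.log 2 / Real.sqrt (Real.log 2) = Real.sqrt (Real.log 2) := by
      rw [div_eq_iff hsl2.ne']; exact hsl22.symm
    have e : (Real.sqrt n * (13 * c₁ / Real.sqrt (Real.log 2) + 2) - 1) * Real.log 2 =
        13 * c₁ * (Real.sqrt n * Real.sqrt (Real.log 2)) + (2 * Real.sqrt n - 1) * Real.log 2 := by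
      calc (Real.sqrt n * (13 * c₁ / Real.sqrt (Real.log 2) + 2) - 1) * Real.log 2
          = 13 * c₁ * Real.sqrt n * (Real.log 2 / Real.sqrt (Real.log 2)) + (2 * Real.sqrt n - 1) * Real.log 2 := by
            ring
        _ = _ := by rw [hdiv]; ring
    rw [e]
    have : Real.log 2 < (2 * Real.sqrt n - 1) * Real.log 2 := by
      have h5 : (1 : ℝ) < 2 * Real.sqrt n - 1 := by linarith
      nlinarith
    linarith
  calc 13 * c₁ * Real.sqrt (n * Real.log 2) < (Real.sqrt n / (2 * c₅) - 1) * Real.log 2 - Real.log 2 := by linarith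
    _ ≤ ((n : ℝ) / (k + 1) - 1) * Real.log 2 - Real.log 2 + Real.log 2 := by
        nlinarith [mul_le_mul_of_nonneg_right h2 hl2.le]
    _ = ((n : ℝ) / (k + 1) - 1) * Real.log 2 := by ring
    _ ≤ ((n / (k + 1) : ℕ) : ℝ) * Real.log 2 := mul_le_mul_of_nonneg_right h1 hl2.le

set_option maxHeartbeats 1600000 in
/-- **Green 2012, Proposition 3, for the Liouville function.** There are `c₁, c₅ > 0`, `K₁` and `n₀`
such that for `n ≥ n₀`, `N = 2ⁿ`, every `S ⊆ {0,…,n−1}` with `1 ≤ |S| ≤ c₅√n` and every sparse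
dyadic rational `θ = ∑_{j∈S} h_j/2^{j+1}` with `|h_j| ≤ e^{c₁√log N}`:
`‖∑_{x<N} λ(x)e(xθ)‖ ≤ K₁ N e^{−c₁√log N}`. Proof as printed (with the constants of this file):
if not, `exists_near_rat_of_large_liouvilleExpSum` (Prop. 4) gives `a/q`, `q ≤ C(log N)⁸/δ⁶`,
`|θ − a/q| ≤ C(log N)⁸/(δ⁶N)`, `δ = K₁e^{−c₁√log N}`; `harmanKatai` (Lemma 1) with
`Q = max(e^{c₁√log N}, 2C(log N)⁸/δ⁶) ≤ e^{13c₁√log N}` shows `a/q = a₁/2^v`, `2^v ≤ q`; and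
`liouville_near_dyadic` (Cor. 2, `c₁ = c₄/16`) bounds the sum by `K₄Ne^{−c₄√log N}`, a
contradiction. [cite: Green2012, Proposition 3] -/
theorem prop3_liouville :
    ∃ c₁ : ℝ, 0 < c₁ ∧ ∃ c₅ : ℝ, 0 < c₅ ∧ ∃ K₁ : ℝ, 0 < K₁ ∧ ∃ n₀ : ℕ, ∀ n : ℕ, n₀ ≤ n →
      ∀ S : Finset (Fin n), 1 ≤ S.card → (S.card : ℝ) ≤ c₅ * Real.sqrt n →
      ∀ h : Fin n → ℤ, (∀ j ∈ S, |(h j : ℝ)| ≤ Real.exp (c₁ * Real.sqrt (Real.log ((2 : ℝ) ^ n)))) →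
        ‖∑ x ∈ range (2 ^ n), ((liouville x : ℤ) : ℂ) *
            (𝐞 ((x : ℝ) * ∑ j ∈ S, (h j : ℝ) / 2 ^ ((j : ℕ) + 1)) : ℂ)‖ ≤
          K₁ * (2 : ℝ) ^ n * Real.exp (-(c₁ * Real.sqrt (Real.log ((2 : ℝ) ^ n)))) := by
  obtain ⟨c₄, hc₄, K₄', hK₄'⟩ := liouville_near_dyadic green_moebius_character_twoPower_holds
  set K₄ : ℝ := max K₄' 1 with hK₄def
  have hK₄1 : 1 ≤ K₄ := le_max_right _ _
  have hK₄ : ∀ (N t : ℕ) (a : ℤ) (θ : ℝ), ((2 : ℝ) ^ t ≤ Real.exp (c₄ * Real.sqrt (Real.log N))) →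
      |θ - a / 2 ^ t| ≤ Real.exp (c₄ * Real.sqrt (Real.log N)) / N →
        ‖∑ x ∈ range N, ((liouville x : ℤ) : ℂ) * (𝐞 ((x : ℝ) * θ) : ℂ)‖
          ≤ K₄ * (N : ℝ) * Real.exp (-(c₄ * Real.sqrt (Real.log N))) := fun N t a θ h1 h2 =>
    (hK₄' N t a θ h1 h2).trans (mul_le_mul_of_nonneg_right
      (mul_le_mul_of_nonneg_right (le_max_left _ _) (Nat.cast_nonneg N)) (Real.exp_pos _).le)
  set c₁ : ℝ := c₄ / 16 with hc₁def
  have hc₁ : 0 < c₁ := by positivity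
  set C : ℝ := 12288 ^ 2 * 324 with hCdef
  have hC1 : (1 : ℝ) ≤ C := by rw [hCdef]; norm_num
  have hC0 : 0 < C := by linarith
  have hl2 : 0 < Real.log 2 := Real.log_pos one_lt_two
  set c₅ : ℝ := 1 / (26 * c₁ / Real.sqrt (Real.log 2) + 4) with hc₅def
  have hc₅ : 0 < c₅ := by rw [hc₅def]; positivity
  -- thresholds
  obtain ⟨L₁, hL₁, hA1⟩ := exists_pow_exp_sqrt_le_exp (A := 108) (a := 2 * c₁) (b := 1) (by norm_num) (by positivity) one_pos 0
  obtain ⟨L₂, hL₂, hA2⟩ := exists_pow_exp_sqrt_le_exp (A := 73728) (a := 3 * c₁) (b := 1 / 10) (by norm_num) (by positivity) (by norm_num) 4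
  obtain ⟨L₃, hL₃, hA3⟩ := exists_pow_le_exp_sqrt (A := 8 * C ^ 2) (a := c₁) (by positivity) hc₁ 16
  set L₀ : ℝ := max (max L₁ L₂) (max L₃ 1) with hL₀
  set n₀ : ℕ := ⌈L₀ / Real.log 2⌉₊ + 1 with hn₀
  refine ⟨c₁, hc₁, c₅, hc₅, K₄, by positivity, n₀, fun n hn S hS1 hSk h hh => ?_⟩
  -- notation
  set N : ℕ := 2 ^ n with hNdef
  set L : ℝ := Real.log ((2 : ℝ) ^ n) with hLdef
  have hL : L = n * Real.log 2 := by rw [hLdef, Real.log_pow]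
  have hNreal : ((N : ℕ) : ℝ) = (2 : ℝ) ^ n := by rw [hNdef]; push_cast; ring
  have hlogN : Real.log (N : ℝ) = L := by rw [hNreal]
  have hN0 : (0 : ℝ) < (2 : ℝ) ^ n := by positivity
  have hexpL : Real.exp L = (2 : ℝ) ^ n := by rw [hLdef, Real.exp_log hN0]
  -- `L ≥ L₀`, `n ≥ 2`
  have hnL : L₀ ≤ L := by
    rw [hL]
    have h1 : L₀ / Real.log 2 ≤ n := by
      have : (⌈L₀ / Real.log 2⌉₊ : ℝ) ≤ n := by exact_mod_cast (by omega : ⌈L₀ / Real.log 2⌉₊ ≤ n)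
      exact (Nat.le_ceil _).trans this
    rwa [div_le_iff₀ hl2] at h1
  have hLL₁ : L₁ ≤ L := le_trans (le_trans (le_max_left _ _) (le_max_left _ _)) hnL
  have hLL₂ : L₂ ≤ L := le_trans (le_trans (le_max_right _ _) (le_max_left _ _)) hnL
  have hLL₃ : L₃ ≤ L := le_trans (le_trans (le_max_left _ _) (le_max_right _ _)) hnL
  have hL1 : 1 ≤ L := le_trans (le_trans (le_max_right _ _) (le_max_right _ _)) hnL
  have hL0 : 0 < L := by linarith
  have hn2 : 2 ≤ n := by
    have : 1 ≤ ⌈L₀ / Real.log 2⌉₊ := Nat.one_le_iff_ne_zero.2 (Nat.ceil_pos.2 (by positivity)).ne'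
    omega
  have hn1 : 1 ≤ n := by omega
  set θ : ℝ := ∑ j ∈ S, (h j : ℝ) / 2 ^ ((j : ℕ) + 1) with hθdef
  set E₁ : ℝ := Real.exp (-(c₁ * Real.sqrt L)) with hE₁
  set F : ℝ := Real.exp (c₁ * Real.sqrt L) with hFdef
  have hF1 : 1 ≤ F := Real.one_le_exp (by positivity)
  have hFE : F * E₁ = 1 := by rw [hFdef, hE₁, ← Real.exp_add]; simp
  have hA1' : 108 * Real.exp (2 * c₁ * Real.sqrt L) ≤ Real.exp L := by
    have := hA1 L hLL₁; simpa using this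
  have hA2' : 73728 * L ^ 4 * Real.exp (3 * c₁ * Real.sqrt L) ≤ Real.exp (1 / 10 * L) := hA2 L hLL₂
  have hA3' : 8 * C ^ 2 * L ^ 16 ≤ F := hA3 L hLL₃
  have hF108 : 108 ≤ F := by
    have hL16 : 1 ≤ L ^ 16 := one_le_pow₀ hL1
    have : (108 : ℝ) ≤ 8 * C ^ 2 * L ^ 16 := by nlinarith
    linarith
  -- by contradiction
  by_contra hcon
  push Not at hcon
  set Sg : ℂ := ∑ x ∈ range (2 ^ n), ((liouville x : ℤ) : ℂ) * (𝐞 ((x : ℝ) * θ) : ℂ) with hSg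
  have hSgN : ‖Sg‖ ≤ (2 : ℝ) ^ n := by
    have := norm_sum_liouville_mul_le (2 ^ n) (fun x => (𝐞 ((x : ℝ) * θ) : ℂ)) fun x => (norm_fourierChar _).le
    rwa [show (((2 ^ n : ℕ)) : ℝ) = (2 : ℝ) ^ n by push_cast; ring] at this
  set δ : ℝ := K₄ * E₁ with hδdef
  have hδ0 : 0 < δ := by positivity
  have hδE : E₁ ≤ δ := by rw [hδdef]; exact le_mul_of_one_le_left (Real.exp_pos _).le hK₄1
  have hδ1 : δ < 1 := by
    have h1 : δ * (2 : ℝ) ^ n < ‖Sg‖ := by rw [hδdef]; linarith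
    have := h1.trans_le hSgN
    exact lt_of_mul_lt_mul_right (by linarith) hN0.le
  -- Step 1: Proposition 4 at `N₁ = 2ⁿ − 1`
  set N₁ : ℕ := 2 ^ n - 1 with hN₁
  have hN2 : 2 ≤ 2 ^ n := by
    calc 2 = 2 ^ 1 := (pow_one 2).symm
      _ ≤ 2 ^ n := Nat.pow_le_pow_right (by norm_num) hn1
  have hN₁real : (N₁ : ℝ) = (2 : ℝ) ^ n - 1 := by
    rw [hN₁]; push_cast [Nat.one_le_two_pow]; ring
  have hN₁le : (N₁ : ℝ) ≤ (2 : ℝ) ^ n := by rw [hN₁real]; linarith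
  have hN₁ge : (2 : ℝ) ^ n / 2 ≤ N₁ := by
    rw [hN₁real]
    have : (2 : ℝ) ≤ (2 : ℝ) ^ n := by exact_mod_cast hN2
    linarith
  have hN₁pos : (0 : ℝ) < N₁ := lt_of_lt_of_le (by positivity) hN₁ge
  have hlogN₁ : Real.log N₁ ≤ L := by rw [hLdef]; exact Real.log_le_log hN₁pos hN₁le
  have hlogN₁0 : 0 ≤ Real.log N₁ := Real.log_natCast_nonneg N₁
  have hlarge : δ * N₁ ≤ ‖afExpSum (fun m => (liouville m : ℝ)) N₁ θ‖ := by
    rw [hN₁, ← sum_range_liouville_eq_afExpSum]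
    calc δ * ((2 ^ n - 1 : ℕ) : ℝ) ≤ δ * (2 : ℝ) ^ n := by
          refine mul_le_mul_of_nonneg_left ?_ hδ0.le
          rw [← hN₁]; exact hN₁le
      _ ≤ ‖Sg‖ := by rw [hδdef]; linarith
  have hcond := prop3_cond hc₁ hδE hA1' hA2' hF108 (N₁ := N₁) (by rw [hexpL]; exact hN₁ge)
    (by rw [hexpL]; exact hN₁le)
  obtain ⟨q, hq1, hqle, a, haθ⟩ := exists_near_rat_of_large_liouvilleExpSum hδ0 hδ1.le hcond hlarge
  -- Step 2: the sizes of `q` and `|θ − a/q|` in terms of `Q`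
  set Q : ℝ := max F (2 * C * L ^ 8 / δ ^ 6) with hQdef
  have hQF : F ≤ Q := le_max_left _ _
  have hQ1 : 1 ≤ Q := hF1.trans hQF
  have hlog8 : Real.log N₁ ^ 8 ≤ L ^ 8 := pow_le_pow_left₀ hlogN₁0 hlogN₁ 8
  have hqle' : (q : ℝ) ≤ C * Real.log N₁ ^ 8 / δ ^ 6 := by rw [hCdef]; exact hqle
  have haθ' : |θ - a / q| ≤ C * Real.log N₁ ^ 8 / (δ ^ 6 * N₁) := by rw [hCdef]; exact haθ
  have hqQ : (q : ℝ) ≤ Q := by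
    refine hqle'.trans (le_trans ?_ (le_max_right _ _))
    have h1 : C * Real.log N₁ ^ 8 / δ ^ 6 ≤ C * L ^ 8 / δ ^ 6 := by gcongr
    have h2 : C * L ^ 8 / δ ^ 6 ≤ 2 * C * L ^ 8 / δ ^ 6 := by
      have : 0 ≤ C * L ^ 8 / δ ^ 6 := by positivity
      have e : 2 * C * L ^ 8 / δ ^ 6 = 2 * (C * L ^ 8 / δ ^ 6) := by ring
      linarith
    linarith
  have hθQ : |θ - a / q| ≤ Q / 2 ^ n := by
    refine haθ'.trans (le_trans ?_ (div_le_div_of_nonneg_right (le_max_right _ _) hN0.le))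
    calc C * Real.log N₁ ^ 8 / (δ ^ 6 * N₁) ≤ C * L ^ 8 / (δ ^ 6 * ((2 : ℝ) ^ n / 2)) := by gcongr
      _ = 2 * C * L ^ 8 / δ ^ 6 / 2 ^ n := by field_simp
  -- `Q ≤ 2C L⁸ F⁶`, `2Q² ≤ 8C²L¹⁶F¹² ≤ F¹³`
  have hδ6 : 1 / δ ^ 6 ≤ F ^ 6 := by
    have h1 : E₁ ^ 6 ≤ δ ^ 6 := pow_le_pow_left₀ (Real.exp_pos _).le hδE 6
    have h2 : F ^ 6 * E₁ ^ 6 = 1 := by rw [← mul_pow, hFE, one_pow]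
    rw [div_le_iff₀ (by positivity)]
    nlinarith [pow_pos (Real.exp_pos (c₁ * Real.sqrt L)) 6]
  have hQle : Q ≤ 2 * C * L ^ 8 * F ^ 6 := by
    rw [hQdef]
    refine max_le ?_ ?_
    · have h1 : (1 : ℝ) ≤ 2 * C * L ^ 8 := by
        have := one_le_pow₀ (n := 8) hL1; nlinarith
      have h2 : F ≤ F ^ 6 := le_self_pow₀ hF1 (by norm_num)
      nlinarith [pow_pos (Real.exp_pos (c₁ * Real.sqrt L)) 6]
    · rw [div_eq_mul_one_div]
      exact mul_le_mul_of_nonneg_left hδ6 (by positivity)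
  have hF13 : 2 * Q ^ 2 ≤ F ^ 13 := by
    calc 2 * Q ^ 2 ≤ 2 * (2 * C * L ^ 8 * F ^ 6) ^ 2 := by gcongr
      _ = (8 * C ^ 2 * L ^ 16) * F ^ 12 := by ring
      _ ≤ F * F ^ 12 := mul_le_mul_of_nonneg_right hA3' (by positivity)
      _ = F ^ 13 := by ring
  -- Step 3: the gap condition `F¹³ < 2^{⌊n/(k+1)⌋}`
  have hgapreal := prop3_gap hc₁ hn2 hS1 hSk
  have hgap : 2 * Q ^ 2 < (2 : ℝ) ^ (n / (S.card + 1)) := by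
    refine lt_of_le_of_lt hF13 ?_
    rw [hFdef, ← Real.exp_nat_mul, ← Real.rpow_natCast, Real.rpow_def_of_pos two_pos]
    refine Real.exp_lt_exp.2 ?_
    push_cast
    rw [mul_comm (Real.log 2), hL]
    linarith
  -- Step 4: Harman–Kátai
  obtain ⟨v, a₁, hvq, hav⟩ := harmanKatai S h hQ1 (fun j hj => (hh j hj).trans hQF) hq1 hqQ hθQ hgap
  -- Step 5: Corollary 2 at `t = v`, `a = a₁`
  have hc₁13 : (13 : ℝ) * c₁ ≤ c₄ := by rw [hc₁def]; linarith
  have hc₁c₄ : c₁ ≤ c₄ := by rw [hc₁def]; linarith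
  have hF13le : F ^ 13 ≤ Real.exp (c₄ * Real.sqrt L) := by
    rw [hFdef, ← Real.exp_nat_mul]
    refine Real.exp_le_exp.2 ?_
    push_cast
    calc (13 : ℝ) * (c₁ * Real.sqrt L) = (13 * c₁) * Real.sqrt L := by ring
      _ ≤ c₄ * Real.sqrt L := mul_le_mul_of_nonneg_right hc₁13 (Real.sqrt_nonneg L)
  have hQc₄ : Q ≤ Real.exp (c₄ * Real.sqrt L) := by
    have hQQ : Q ≤ 2 * Q ^ 2 := by nlinarith [hQ1]
    exact hQQ.trans (hF13.trans hF13le)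
  have h2v : (2 : ℝ) ^ v ≤ Real.exp (c₄ * Real.sqrt (Real.log N)) := by
    rw [hlogN]; exact hvq.trans (hqQ.trans hQc₄)
  have hθv : |θ - a₁ / 2 ^ v| ≤ Real.exp (c₄ * Real.sqrt (Real.log N)) / N := by
    rw [hlogN, hNreal, ← hav]
    exact hθQ.trans (div_le_div_of_nonneg_right hQc₄ hN0.le)
  have hfinal := hK₄ N v a₁ θ h2v hθv
  rw [hlogN, hNreal] at hfinal
  have hlast : K₄ * (2 : ℝ) ^ n * Real.exp (-(c₄ * Real.sqrt L)) ≤ K₄ * (2 : ℝ) ^ n * E₁ := by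
    refine mul_le_mul_of_nonneg_left (Real.exp_le_exp.2 ?_) (by positivity)
    exact neg_le_neg (mul_le_mul_of_nonneg_right hc₁c₄ (Real.sqrt_nonneg L))
  have hSg' : ‖Sg‖ ≤ K₄ * (2 : ℝ) ^ n * E₁ := hfinal.trans hlast
  exact absurd (lt_of_lt_of_le hcon hSg') (lt_irrefl _)


open Literature.NumberTheory.Sieve.Vinogradov (distInt distInt_nonneg distInt_eq_zero_iff
  two_mul_distInt_le_abs_sin norm_fourierChar_sub_one norm_fourierChar fourierChar_natCast_mul
  norm_sum_Ioc_fourierChar_mul_distInt_le distInt_le_abs_sub_int)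

/-! ### Periodic sums on `ℕ` -/

/-- Translation invariance of a sum over a period. [folklore] -/
theorem sum_range_shift {M : Type*} [AddCommGroup M] {P : ℕ} (F : ℕ → M)
    (hF : ∀ w, F (w + P) = F w) (x : ℕ) :
    ∑ w ∈ range P, F (x + w) = ∑ w ∈ range P, F w := by
  induction x with
  | zero => simp
  | succ x ih =>
      have h1 : ∑ w ∈ range P, F (x + 1 + w) = ∑ w ∈ range P, F (x + (w + 1)) :=
        Finset.sum_congr rfl fun w _ => by rw [add_assoc, add_comm 1 w]
      rw [h1]
      rcases Nat.eq_zero_or_pos P with hP | hP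
      · subst hP; simp
      · -- `∑_{w<P} F(x+w+1) = ∑_{w<P} F(x+w) − F(x) + F(x+P)`
        have h2 : ∑ w ∈ range P, F (x + (w + 1)) + F (x + 0) = ∑ w ∈ range (P + 1), F (x + w) := by
          rw [Finset.sum_range_succ']
        have h3 : ∑ w ∈ range (P + 1), F (x + w) = ∑ w ∈ range P, F (x + w) + F (x + P) :=
          Finset.sum_range_succ _ _
        have h4 : F (x + P) = F (x + 0) := by rw [add_zero]; exact hF x
        have h5 : ∑ w ∈ range P, F (x + (w + 1)) = ∑ w ∈ range P, F (x + w) := by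
          have := h2.trans (h3.trans (by rw [h4]))
          exact add_right_cancel this
        rw [h5, ih]

/-- A sum over `m` periods. [folklore] -/
theorem sum_range_mul_periodic {M : Type*} [AddCommGroup M] {P : ℕ} (F : ℕ → M)
    (hF : ∀ w, F (w + P) = F w) (m : ℕ) :
    ∑ x ∈ range (P * m), F x = m • ∑ x ∈ range P, F x := by
  induction m with
  | zero => simp
  | succ m ih =>
      rw [Nat.mul_succ, Finset.sum_range_add, ih, succ_nsmul, sum_range_shift F hF]

/-! ### Geometric sums of `e(hu/P)` -/

/-- `e(x) ≠ 1` when `x ∉ ℤ`. [folklore] -/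
theorem fourierChar_ne_one {x : ℝ} (hx : distInt x ≠ 0) : (𝐞 x : ℂ) ≠ 1 := by
  intro h0
  have h1 := norm_fourierChar_sub_one x
  rw [h0, sub_self, norm_zero] at h1
  have h2 := two_mul_distInt_le_abs_sin x
  have h3 : 0 < distInt x := lt_of_le_of_ne (distInt_nonneg x) (Ne.symm hx)
  linarith

/-- `distInt (h/P) = 0 ↔ P ∣ h` (`P ≥ 1`). [folklore] -/
theorem distInt_div_eq_zero_iff {P : ℕ} (hP : 0 < P) (h : ℤ) :
    distInt ((h : ℝ) / P) = 0 ↔ (P : ℤ) ∣ h := by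
  rw [distInt_eq_zero_iff]
  have hP0 : (P : ℝ) ≠ 0 := by exact_mod_cast hP.ne'
  constructor
  · rintro ⟨n, hn⟩
    refine ⟨n, ?_⟩
    have : (h : ℝ) = n * P := by rw [div_eq_iff hP0] at hn; linarith
    have : (h : ℝ) = ((P * n : ℤ) : ℝ) := by rw [this]; push_cast; ring
    exact_mod_cast this
  · rintro ⟨n, hn⟩
    refine ⟨n, ?_⟩
    rw [hn]; push_cast; field_simp

/-- **Orthogonality on `ℤ/P`**: `∑_{u<P} e(hu/P) = P` if `P ∣ h`, and `= 0` otherwise. [folklore] -/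
theorem sum_range_fourierChar_div (P : ℕ) (hP : 0 < P) (h : ℤ) :
    ∑ u ∈ range P, (𝐞 ((u : ℝ) * ((h : ℝ) / P)) : ℂ) = if (P : ℤ) ∣ h then (P : ℂ) else 0 := by
  split_ifs with hdvd
  · obtain ⟨n, hn⟩ := hdvd
    have hP0 : (P : ℂ) ≠ 0 := by exact_mod_cast hP.ne'
    have hint : ∀ u : ℕ, (𝐞 ((u : ℝ) * ((h : ℝ) / P)) : ℂ) = 1 := by
      intro u
      rw [Real.fourierChar_apply]
      have : (↑(2 * Real.pi * ((u : ℝ) * ((h : ℝ) / P))) : ℂ) * Complex.I = ((u * n : ℤ) : ℂ) * (2 * Real.pi * Complex.I) := by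
        rw [hn]; push_cast; field_simp
      rw [this, Complex.exp_int_mul_two_pi_mul_I]
    simp [hint]
  · have hne : distInt ((h : ℝ) / P) ≠ 0 := fun h0 => hdvd ((distInt_div_eq_zero_iff hP h).1 h0)
    have hne1 := fourierChar_ne_one hne
    have hgeom : ∑ u ∈ range P, (𝐞 ((u : ℝ) * ((h : ℝ) / P)) : ℂ) = ∑ u ∈ range P, ((𝐞 ((h : ℝ) / P) : ℂ)) ^ u :=
      Finset.sum_congr rfl fun u _ => by rw [fourierChar_natCast_mul]
    rw [hgeom, geom_sum_eq hne1]
    have hpow : ((𝐞 ((h : ℝ) / P) : ℂ)) ^ P = 1 := by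
      rw [← fourierChar_natCast_mul, Real.fourierChar_apply]
      have hP0 : (P : ℂ) ≠ 0 := by exact_mod_cast hP.ne'
      have : (↑(2 * Real.pi * ((P : ℝ) * ((h : ℝ) / P))) : ℂ) * Complex.I = ((h : ℤ) : ℂ) * (2 * Real.pi * Complex.I) := by
        push_cast; field_simp
      rw [this, Complex.exp_int_mul_two_pi_mul_I]
    rw [hpow, sub_self, zero_div]

/-! ### Fourier inversion on a period -/

/-- **Finite Fourier inversion** for a `P`-periodic function on `ℕ`:
`F(x) = ∑_{h<P} c_h e(hx/P)` with `c_h = P⁻¹ ∑_{u<P} F(u) e(−hu/P)`. [folklore] -/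
theorem fourier_inversion {P : ℕ} (hP : 0 < P) (F : ℕ → ℂ) (hF : ∀ w, F (w + P) = F w) (x : ℕ) :
    F x = ∑ h ∈ range P, ((P : ℂ)⁻¹ * ∑ u ∈ range P, F u * (𝐞 ((u : ℝ) * (-(h : ℝ) / P)) : ℂ)) *
      (𝐞 ((x : ℝ) * ((h : ℝ) / P)) : ℂ) := by
  have hP0 : (P : ℂ) ≠ 0 := by exact_mod_cast hP.ne'
  -- rewrite the right side as `P⁻¹ ∑_u F(u) ∑_h e(h(x−u)/P)`
  have hswap : ∑ h ∈ range P, ((P : ℂ)⁻¹ * ∑ u ∈ range P, F u * (𝐞 ((u : ℝ) * (-(h : ℝ) / P)) : ℂ)) *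
      (𝐞 ((x : ℝ) * ((h : ℝ) / P)) : ℂ) =
      (P : ℂ)⁻¹ * ∑ u ∈ range P, F u * ∑ h ∈ range P, (𝐞 ((h : ℝ) * ((((x : ℤ) - u : ℤ) : ℝ) / P)) : ℂ) := by
    rw [Finset.mul_sum]
    simp_rw [Finset.mul_sum, Finset.sum_mul]
    rw [Finset.sum_comm]
    refine Finset.sum_congr rfl fun u _ => Finset.sum_congr rfl fun h _ => ?_
    have : (𝐞 ((u : ℝ) * (-(h : ℝ) / P)) : ℂ) * (𝐞 ((x : ℝ) * ((h : ℝ) / P)) : ℂ) =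
        (𝐞 ((h : ℝ) * ((((x : ℤ) - u : ℤ) : ℝ) / P)) : ℂ) := by
      rw [← Circle.coe_mul, ← AddChar.map_add_eq_mul]
      congr 2; push_cast; ring
    rw [mul_assoc, mul_assoc, this]
  rw [hswap]
  -- inner sum: `P` iff `u ≡ x`
  have hinner : ∀ u ∈ range P, F u * ∑ h ∈ range P, (𝐞 ((h : ℝ) * ((((x : ℤ) - u : ℤ) : ℝ) / P)) : ℂ) =
      if u = x % P then F u * P else 0 := by
    intro u hu
    rw [Finset.mem_range] at hu
    rw [sum_range_fourierChar_div P hP]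
    by_cases hux : u = x % P
    · rw [if_pos hux, if_pos]
      rw [hux]
      exact Int.dvd_self_sub_of_emod_eq (Int.natCast_mod x P).symm
    · rw [if_neg hux, if_neg, mul_zero]
      intro hdvd
      apply hux
      have h1 : (u : ℤ) ≡ x [ZMOD P] := Int.modEq_iff_dvd.2 hdvd
      have h2 : ((u % P : ℕ) : ℤ) = ((x % P : ℕ) : ℤ) := by
        rw [Int.natCast_mod, Int.natCast_mod]; exact h1
      have h3 : u % P = x % P := by exact_mod_cast h2
      rw [← h3, Nat.mod_eq_of_lt hu]
  rw [Finset.sum_congr rfl hinner, Finset.sum_ite_eq' (range P) (x % P) (fun u => F u * P), if_pos (Finset.mem_range.2 (Nat.mod_lt x hP))]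
  rw [← mul_assoc, mul_comm ((P:ℂ)⁻¹), mul_assoc, inv_mul_cancel₀ hP0, mul_one]
  -- `F (x % P) = F x` by periodicity
  have hper : ∀ m : ℕ, F (x % P + P * m) = F (x % P) := by
    intro m
    induction m with
    | zero => simp
    | succ m ih => rw [Nat.mul_succ, ← add_assoc, hF, ih]
  have := hper (x / P)
  rw [Nat.mod_add_div] at this
  exact this


/-! ### Distances to the nearest integer for `h/P` -/

/-- `‖h/P‖ ≥ min(h, P − h)/P` for `0 ≤ h ≤ P`. [folklore] -/
theorem min_div_le_distInt {P h : ℕ} (hP : 0 < P) (hh : h ≤ P) :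
    ((min h (P - h) : ℕ) : ℝ) / P ≤ distInt ((h : ℝ) / P) := by
  have hP0 : (0 : ℝ) < P := by exact_mod_cast hP
  have key : ∀ n : ℤ, ((min h (P - h) : ℕ) : ℝ) / P ≤ |(h : ℝ) / P - n| := by
    intro n
    rcases le_or_gt n 0 with hn | hn
    · have hn' : (n : ℝ) ≤ 0 := by exact_mod_cast hn
      have h1 : ((min h (P - h) : ℕ) : ℝ) ≤ h := by exact_mod_cast min_le_left _ _
      calc ((min h (P - h) : ℕ) : ℝ) / P ≤ (h : ℝ) / P := div_le_div_of_nonneg_right h1 hP0.le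
        _ ≤ (h : ℝ) / P - n := by linarith
        _ ≤ |(h : ℝ) / P - n| := le_abs_self _
    · have hn' : (1 : ℝ) ≤ n := by exact_mod_cast hn
      have h1 : ((min h (P - h) : ℕ) : ℝ) ≤ ((P - h : ℕ) : ℝ) := by exact_mod_cast min_le_right _ _
      have h2 : ((P - h : ℕ) : ℝ) = P - h := by push_cast [hh]; ring
      calc ((min h (P - h) : ℕ) : ℝ) / P ≤ ((P : ℝ) - h) / P := by rw [← h2]; exact div_le_div_of_nonneg_right h1 hP0.le
        _ = 1 - (h : ℝ) / P := by field_simp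
        _ ≤ n - (h : ℝ) / P := by linarith
        _ ≤ |(h : ℝ) / P - n| := by rw [abs_sub_comm]; exact le_abs_self _
  exact key (round ((h : ℝ) / P))

/-- Geometric sums from `0`: `‖∑_{n<W} e(nx)‖ · ‖x‖ ≤ 1/2`. [cite: Nathanson1996, §4.4, Lemma 4.7] -/
theorem norm_sum_range_fourierChar_mul_distInt_le (W : ℕ) (x : ℝ) :
    ‖∑ n ∈ range W, (𝐞 ((n : ℝ) * x) : ℂ)‖ * distInt x ≤ 1 / 2 := by
  have h1 : ∑ n ∈ Ioc 0 W, (𝐞 ((n : ℝ) * x) : ℂ) = (𝐞 x : ℂ) * ∑ n ∈ range W, (𝐞 ((n : ℝ) * x) : ℂ) := by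
    have : Ioc 0 W = Ico 1 (W + 1) := by ext n; simp only [Finset.mem_Ioc, Finset.mem_Ico]; omega
    rw [this, Finset.sum_Ico_eq_sum_range, show W + 1 - 1 = W by omega, Finset.mul_sum]
    refine Finset.sum_congr rfl fun n _ => ?_
    rw [← Circle.coe_mul, ← AddChar.map_add_eq_mul]
    congr 2; push_cast; ring
  have h2 : ‖∑ n ∈ range W, (𝐞 ((n : ℝ) * x) : ℂ)‖ = ‖∑ n ∈ Ioc 0 W, (𝐞 ((n : ℝ) * x) : ℂ)‖ := by
    rw [h1, norm_mul, norm_fourierChar, one_mul]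
  rw [h2]
  exact norm_sum_Ioc_fourierChar_mul_distInt_le 0 W x

/-- Consequence: `‖∑_{n<W} e(n h/P)‖ ≤ P/(2 min(h, P−h))` for `0 < h < P`. [folklore] -/
theorem norm_sum_range_fourierChar_div_le {P h : ℕ} (hP : 0 < P) (hh0 : 0 < h) (hhP : h < P) (W : ℕ) :
    ‖∑ n ∈ range W, (𝐞 ((n : ℝ) * ((h : ℝ) / P)) : ℂ)‖ ≤ (P : ℝ) / (2 * (min h (P - h) : ℕ)) := by
  have hmin0 : 0 < min h (P - h) := lt_min hh0 (by omega)
  have hmin : (0 : ℝ) < ((min h (P - h) : ℕ) : ℝ) := by exact_mod_cast hmin0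
  have hP0 : (0 : ℝ) < P := by exact_mod_cast hP
  have hd : ((min h (P - h) : ℕ) : ℝ) / P ≤ distInt ((h : ℝ) / P) := min_div_le_distInt hP hhP.le
  have hd0 : 0 < distInt ((h : ℝ) / P) := lt_of_lt_of_le (by positivity) hd
  have h1 := norm_sum_range_fourierChar_mul_distInt_le W ((h : ℝ) / P)
  rw [← le_div_iff₀ hd0] at h1
  refine h1.trans ?_
  rw [div_le_div_iff₀ hd0 (by positivity)]
  calc 1 / 2 * (2 * ((min h (P - h) : ℕ) : ℝ)) = P * (((min h (P - h) : ℕ) : ℝ) / P) := by field_simp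
    _ ≤ P * distInt ((h : ℝ) / P) := mul_le_mul_of_nonneg_left hd hP0.le

/-- The tail `∑_{h<P, min(h,P−h) > H₀} 1/min(h,P−h)² ≤ 2/H₀`. [folklore] -/
theorem sum_inv_min_sq_le {P H₀ : ℕ} (hH₀ : 0 < H₀) :
    ∑ h ∈ (range P).filter (fun h => H₀ < min h (P - h)), (1 : ℝ) / ((min h (P - h) : ℕ) : ℝ) ^ 2 ≤ 2 / H₀ := by
  -- `1/min² ≤ 1/h² + 1/(P-h)²` and each of the two sums is a tail `≤ 1/H₀`
  have htail : ∀ S : Finset ℕ, (∀ h ∈ S, H₀ < h) → ∑ h ∈ S, (1 : ℝ) / (h : ℝ) ^ 2 ≤ 1 / H₀ := by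
    intro S hS
    -- compare with the telescoping sum `1/(h-1) - 1/h`
    have h1 : ∀ h ∈ S, (1 : ℝ) / (h : ℝ) ^ 2 ≤ 1 / ((h : ℝ) - 1) - 1 / h := by
      intro h hh
      have hh1 : (H₀ : ℝ) + 1 ≤ h := by exact_mod_cast hS h hh
      have hH : (1 : ℝ) ≤ H₀ := by exact_mod_cast hH₀
      have hpos : (0 : ℝ) < (h : ℝ) - 1 := by linarith
      have hh0 : (0 : ℝ) < h := by linarith
      rw [div_sub_div _ _ hpos.ne' hh0.ne', div_le_div_iff₀ (by positivity) (by positivity)]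
      nlinarith
    refine (Finset.sum_le_sum h1).trans ?_
    -- `∑_{h ∈ S} (1/(h-1) − 1/h) ≤ ∑_{h = H₀+1}^{max} … ≤ 1/H₀`
    have hsub : S ⊆ Finset.Ioc H₀ (H₀ + S.sup id) := by
      intro h hh
      rw [Finset.mem_Ioc]
      exact ⟨hS h hh, le_trans (Finset.le_sup (f := id) hh) (Nat.le_add_left _ _)⟩
    have hnn : ∀ h ∈ Finset.Ioc H₀ (H₀ + S.sup id), (0 : ℝ) ≤ 1 / ((h : ℝ) - 1) - 1 / h := by
      intro h hh
      rw [Finset.mem_Ioc] at hh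
      have hh1 : (H₀ : ℝ) + 1 ≤ h := by exact_mod_cast hh.1
      have hH : (1 : ℝ) ≤ H₀ := by exact_mod_cast hH₀
      have hpos : (0 : ℝ) < (h : ℝ) - 1 := by linarith
      rw [sub_nonneg]
      exact one_div_le_one_div_of_le hpos (by linarith)
    refine (Finset.sum_le_sum_of_subset_of_nonneg hsub fun h hh _ => hnn h hh).trans ?_
    -- telescoping
    have htel : ∀ m : ℕ, ∑ h ∈ Finset.Ioc H₀ (H₀ + m), ((1 : ℝ) / ((h : ℝ) - 1) - 1 / h) = 1 / H₀ - 1 / ((H₀ + m : ℕ) : ℝ) := by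
      intro m
      induction m with
      | zero => simp
      | succ m ih =>
          rw [Nat.add_succ, Finset.sum_Ioc_succ_top (by omega), ih]
          push_cast
          ring
    rw [htel]
    have : (0 : ℝ) ≤ 1 / ((H₀ + S.sup id : ℕ) : ℝ) := by positivity
    linarith
  have hsplit : ∀ h ∈ (range P).filter (fun h => H₀ < min h (P - h)),
      (1 : ℝ) / ((min h (P - h) : ℕ) : ℝ) ^ 2 ≤ 1 / (h : ℝ) ^ 2 + 1 / (((P - h : ℕ) : ℝ)) ^ 2 := by
    intro h hh
    rw [Finset.mem_filter] at hh
    have hmin0 : 0 < min h (P - h) := lt_of_le_of_lt (Nat.zero_le _) hh.2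
    rcases min_choice h (P - h) with hm | hm
    · rw [hm]
      have : (0 : ℝ) ≤ 1 / (((P - h : ℕ) : ℝ)) ^ 2 := by positivity
      linarith
    · rw [hm]
      have : (0 : ℝ) ≤ 1 / (h : ℝ) ^ 2 := by positivity
      linarith
  refine (Finset.sum_le_sum hsplit).trans ?_
  rw [Finset.sum_add_distrib]
  have hA : ∑ h ∈ (range P).filter (fun h => H₀ < min h (P - h)), (1 : ℝ) / (h : ℝ) ^ 2 ≤ 1 / H₀ :=
    htail _ fun h hh => by rw [Finset.mem_filter] at hh; exact lt_of_lt_of_le hh.2 (min_le_left _ _)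
  have hB : ∑ h ∈ (range P).filter (fun h => H₀ < min h (P - h)), (1 : ℝ) / (((P - h : ℕ) : ℝ)) ^ 2 ≤ 1 / H₀ := by
    -- reflect `h ↦ P - h`
    have hinj : Set.InjOn (fun h => P - h) ((range P).filter (fun h => H₀ < min h (P - h)) : Set ℕ) := by
      intro a ha b hb hab
      simp only [Finset.coe_filter, Set.mem_setOf_eq, Finset.mem_range] at ha hb
      simp only at hab
      omega
    rw [← Finset.sum_image (f := fun m : ℕ => (1 : ℝ) / (m : ℝ) ^ 2) hinj]
    refine htail _ fun m hm => ?_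
    rw [Finset.mem_image] at hm
    obtain ⟨h, hh, rfl⟩ := hm
    rw [Finset.mem_filter] at hh
    exact lt_of_lt_of_le hh.2 (min_le_right _ _)
  calc _ ≤ 1 / (H₀ : ℝ) + 1 / H₀ := add_le_add hA hB
    _ = 2 / H₀ := by ring

/-! ### The square wave of one binary digit and its box smoothing -/

/-- Points where the square wave `g(u) = [P/2 ≤ u % P ? −1 : 1]` changes under a shift `w ≤ P/2`
lie in two windows of length `w` before the jumps. [folklore] -/
theorem squareWave_shift_ne_subset {P w x : ℕ} (hPeven : 2 ∣ P) (hw : w ≤ P / 2) (hx : x < P)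
    (hne : (P / 2 ≤ (x + w) % P) ≠ (P / 2 ≤ x % P)) :
    x ∈ Finset.Ico (P / 2 - w) (P / 2) ∪ Finset.Ico (P - w) P := by
  rw [Finset.mem_union, Finset.mem_Ico, Finset.mem_Ico]
  rw [Nat.mod_eq_of_lt hx] at hne
  obtain ⟨Q, hQ⟩ := hPeven
  have hP2 : P / 2 = Q := by omega
  rw [hP2] at hne hw ⊢
  by_cases hxw : x + w < P
  · rw [Nat.mod_eq_of_lt hxw] at hne
    left
    constructor
    · by_contra h1; push Not at h1
      -- `x + w < Q` or `x ≥ Q`: no change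
      by_cases hxQ : Q ≤ x
      · exact hne (propext ⟨fun _ => hxQ, fun _ => by omega⟩)
      · push Not at hxQ
        have : x + w < Q := by omega
        exact hne (propext ⟨fun h => by omega, fun h => by omega⟩)
    · by_contra h1; push Not at h1
      exact hne (propext ⟨fun _ => h1, fun _ => by omega⟩)
  · push Not at hxw
    have hmod : (x + w) % P = x + w - P := by
      rw [Nat.mod_eq_sub_mod hxw, Nat.mod_eq_of_lt (by omega)]
    rw [hmod] at hne
    right
    exact ⟨by omega, hx⟩



/-- The square wave differs from its shift by `w ≤ P/2` at `≤ 2w` points of a period, so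
`∑_{x<P} ‖g(x+w) − g(x)‖ ≤ 4w`. [folklore] -/
theorem sum_norm_shift_sub_le {P w : ℕ} (hPeven : 2 ∣ P) (hw : w ≤ P / 2)
    (g : ℕ → ℝ) (hg : ∀ u, g u = if P / 2 ≤ u % P then -1 else 1) :
    ∑ x ∈ range P, ‖(g (x + w) : ℂ) - g x‖ ≤ 4 * w := by
  have hterm : ∀ x ∈ range P, ‖(g (x + w) : ℂ) - g x‖ ≤
      if x ∈ Finset.Ico (P / 2 - w) (P / 2) ∪ Finset.Ico (P - w) P then 2 else 0 := by
    intro x hx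
    rw [Finset.mem_range] at hx
    by_cases hne : (P / 2 ≤ (x + w) % P) = (P / 2 ≤ x % P)
    · have : g (x + w) = g x := by rw [hg, hg x]; exact if_congr (Iff.of_eq hne) rfl rfl
      rw [this, sub_self, norm_zero]
      split_ifs <;> norm_num
    · rw [if_pos (squareWave_shift_ne_subset hPeven hw hx hne)]
      rw [← Complex.ofReal_sub, Complex.norm_real, Real.norm_eq_abs, hg, hg x]
      split_ifs <;> norm_num
  refine (Finset.sum_le_sum hterm).trans ?_
  rw [Finset.sum_ite, Finset.sum_const_zero, add_zero, Finset.sum_const, nsmul_eq_mul]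
  have hcard : (((range P).filter (fun x => x ∈ Finset.Ico (P / 2 - w) (P / 2) ∪ Finset.Ico (P - w) P)).card : ℝ) ≤ 2 * w := by
    have h1 : (range P).filter (fun x => x ∈ Finset.Ico (P / 2 - w) (P / 2) ∪ Finset.Ico (P - w) P) ⊆
        Finset.Ico (P / 2 - w) (P / 2) ∪ Finset.Ico (P - w) P := fun x hx => (Finset.mem_filter.1 hx).2
    have h2 := (Finset.card_le_card h1).trans (Finset.card_union_le _ _)
    rw [Nat.card_Ico, Nat.card_Ico] at h2
    have h3 : P / 2 - (P / 2 - w) + (P - (P - w)) ≤ 2 * w := by omega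
    exact_mod_cast h2.trans h3
  nlinarith

/-- **`L¹` error of the box smoothing** `g̃(x) = W⁻¹∑_{w<W} g(x+w)` (`1 ≤ W ≤ P/2`) of the square
wave over one period: `∑_{x<P} ‖g̃(x) − g(x)‖ ≤ 4W`. Green: "`E |ψ(x/2^i) − ψ̃(x/2^i)| ≤ ε`".
[cite: Green2012, Proposition 2 (proof)] -/
theorem sum_norm_boxSmooth_sub_le {P W : ℕ} (hPeven : 2 ∣ P) (hW1 : 1 ≤ W) (hW : W ≤ P / 2)
    (g : ℕ → ℝ) (hg : ∀ u, g u = if P / 2 ≤ u % P then -1 else 1)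
    (gt : ℕ → ℂ) (hgt : ∀ x, gt x = ((W : ℂ))⁻¹ * ∑ w ∈ range W, (g (x + w) : ℂ)) :
    ∑ x ∈ range P, ‖gt x - g x‖ ≤ 4 * W := by
  have hW0 : (0 : ℝ) < W := by exact_mod_cast hW1
  have hWc : (W : ℂ) ≠ 0 := by exact_mod_cast (by omega : W ≠ 0)
  -- `g̃(x) − g(x) = W⁻¹ ∑_w (g(x+w) − g(x))`
  have hdiff : ∀ x, gt x - g x = ((W : ℂ))⁻¹ * ∑ w ∈ range W, ((g (x + w) : ℂ) - g x) := by
    intro x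
    rw [hgt, Finset.sum_sub_distrib, Finset.sum_const, Finset.card_range, nsmul_eq_mul, mul_sub,
      ← mul_assoc, inv_mul_cancel₀ hWc, one_mul]
  have h1 : ∀ x, ‖gt x - g x‖ ≤ (W : ℝ)⁻¹ * ∑ w ∈ range W, ‖(g (x + w) : ℂ) - g x‖ := by
    intro x
    rw [hdiff, norm_mul, norm_inv, Complex.norm_natCast]
    exact mul_le_mul_of_nonneg_left (norm_sum_le _ _) (by positivity)
  calc ∑ x ∈ range P, ‖gt x - g x‖ ≤ ∑ x ∈ range P, (W : ℝ)⁻¹ * ∑ w ∈ range W, ‖(g (x + w) : ℂ) - g x‖ :=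
        Finset.sum_le_sum fun x _ => h1 x
    _ = (W : ℝ)⁻¹ * ∑ w ∈ range W, ∑ x ∈ range P, ‖(g (x + w) : ℂ) - g x‖ := by
        rw [← Finset.mul_sum, Finset.sum_comm]
    _ ≤ (W : ℝ)⁻¹ * ∑ w ∈ range W, (4 * (w : ℝ)) := by
        refine mul_le_mul_of_nonneg_left (Finset.sum_le_sum fun w hw => ?_) (by positivity)
        rw [Finset.mem_range] at hw
        exact sum_norm_shift_sub_le hPeven (by omega) g hg
    _ ≤ (W : ℝ)⁻¹ * ∑ _w ∈ range W, (4 * (W : ℝ)) := by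
        refine mul_le_mul_of_nonneg_left (Finset.sum_le_sum fun w hw => ?_) (by positivity)
        rw [Finset.mem_range] at hw
        have : (w : ℝ) ≤ W := by exact_mod_cast hw.le
        linarith
    _ = 4 * W := by
        rw [Finset.sum_const, Finset.card_range, nsmul_eq_mul]
        field_simp

/-- The box smoothing is bounded by `1`. [folklore] -/
theorem norm_boxSmooth_le_one {P W : ℕ} (hW1 : 1 ≤ W)
    (g : ℕ → ℝ) (hg : ∀ u, g u = if P / 2 ≤ u % P then -1 else 1)
    (gt : ℕ → ℂ) (hgt : ∀ x, gt x = ((W : ℂ))⁻¹ * ∑ w ∈ range W, (g (x + w) : ℂ)) (x : ℕ) :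
    ‖gt x‖ ≤ 1 := by
  have hW0 : (0 : ℝ) < W := by exact_mod_cast hW1
  rw [hgt, norm_mul, norm_inv, Complex.norm_natCast]
  calc (W : ℝ)⁻¹ * ‖∑ w ∈ range W, (g (x + w) : ℂ)‖ ≤ (W : ℝ)⁻¹ * ∑ w ∈ range W, ‖(g (x + w) : ℂ)‖ :=
        mul_le_mul_of_nonneg_left (norm_sum_le _ _) (by positivity)
    _ = (W : ℝ)⁻¹ * W := by
        congr 1
        rw [Finset.sum_congr rfl (g := fun _ => (1 : ℝ)) fun w _ => by
          rw [Complex.norm_real, hg]; split_ifs <;> simp]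
        simp
    _ = 1 := inv_mul_cancel₀ hW0.ne'

/-! ### Fourier coefficients of the smoothed square wave -/

/-- **The coefficients factor**: `P⁻¹∑_{u<P} g̃(u)e(−hu/P) = ĝ(h) · W⁻¹∑_{w<W} e(hw/P)` (translation
invariance over a period). [folklore] -/
theorem boxSmooth_coeff_eq {P W : ℕ} (hP : 0 < P)
    (g : ℕ → ℝ) (hg : ∀ u, g (u + P) = g u)
    (gt : ℕ → ℂ) (hgt : ∀ x, gt x = ((W : ℂ))⁻¹ * ∑ w ∈ range W, (g (x + w) : ℂ)) (h : ℕ) :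
    (P : ℂ)⁻¹ * ∑ u ∈ range P, gt u * (𝐞 ((u : ℝ) * (-(h : ℝ) / P)) : ℂ) =
      ((P : ℂ)⁻¹ * ∑ u ∈ range P, (g u : ℂ) * (𝐞 ((u : ℝ) * (-(h : ℝ) / P)) : ℂ)) *
        (((W : ℂ))⁻¹ * ∑ w ∈ range W, (𝐞 ((w : ℝ) * ((h : ℝ) / P)) : ℂ)) := by
  set G : ℕ → ℂ := fun v => (g v : ℂ) * (𝐞 ((v : ℝ) * (-(h : ℝ) / P)) : ℂ) with hG
  have hGper : ∀ v, G (v + P) = G v := by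
    intro v
    rw [hG]; dsimp only
    rw [hg]
    congr 1
    have hP0 : (P : ℝ) ≠ 0 := by exact_mod_cast hP.ne'
    have : ((v + P : ℕ) : ℝ) * (-(h : ℝ) / P) = (v : ℝ) * (-(h : ℝ) / P) + ((-(h : ℤ) : ℤ) : ℝ) := by
      push_cast; field_simp; ring
    rw [this, AddChar.map_add_eq_mul, Circle.coe_mul]
    have hint : (𝐞 (((-(h : ℤ) : ℤ)) : ℝ) : ℂ) = 1 := by
      rw [Real.fourierChar_apply]
      have : (↑(2 * Real.pi * (((-(h : ℤ) : ℤ)) : ℝ)) : ℂ) * Complex.I = ((-(h : ℤ) : ℤ) : ℂ) * (2 * Real.pi * Complex.I) := by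
        push_cast; ring
      rw [this, Complex.exp_int_mul_two_pi_mul_I]
    rw [hint, mul_one]
  -- the shifted inner sums
  have hshift : ∀ w : ℕ, ∑ u ∈ range P, (g (u + w) : ℂ) * (𝐞 ((u : ℝ) * (-(h : ℝ) / P)) : ℂ) =
      (𝐞 ((w : ℝ) * ((h : ℝ) / P)) : ℂ) * ∑ v ∈ range P, G v := by
    intro w
    rw [← sum_range_shift G hGper w, Finset.mul_sum]
    refine Finset.sum_congr rfl fun u _ => ?_
    rw [hG]; dsimp only
    rw [add_comm w u]
    rw [mul_left_comm, ← Circle.coe_mul, ← AddChar.map_add_eq_mul]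
    congr 3; push_cast; ring
  calc (P : ℂ)⁻¹ * ∑ u ∈ range P, gt u * (𝐞 ((u : ℝ) * (-(h : ℝ) / P)) : ℂ)
      = (P : ℂ)⁻¹ * ∑ u ∈ range P, ((W : ℂ))⁻¹ * ∑ w ∈ range W, (g (u + w) : ℂ) * (𝐞 ((u : ℝ) * (-(h : ℝ) / P)) : ℂ) := by
        congr 1
        refine Finset.sum_congr rfl fun u _ => ?_
        rw [hgt, mul_assoc, Finset.sum_mul]
    _ = (P : ℂ)⁻¹ * (((W : ℂ))⁻¹ * ∑ w ∈ range W, ∑ u ∈ range P, (g (u + w) : ℂ) * (𝐞 ((u : ℝ) * (-(h : ℝ) / P)) : ℂ)) := by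
        rw [← Finset.mul_sum, Finset.sum_comm]
    _ = (P : ℂ)⁻¹ * (((W : ℂ))⁻¹ * ∑ w ∈ range W, (𝐞 ((w : ℝ) * ((h : ℝ) / P)) : ℂ) * ∑ v ∈ range P, G v) := by
        simp_rw [hshift]
    _ = _ := by rw [← Finset.sum_mul, hG]; ring

/-- **`|ĝ(h)| ≤ 2/min(h, P−h)`** for the square wave, `0 < h < P`. [folklore] -/
theorem norm_squareWave_coeff_le {P h : ℕ} (hPeven : 2 ∣ P) (hh0 : 0 < h) (hhP : h < P)
    (g : ℕ → ℝ) (hg : ∀ u, g u = if P / 2 ≤ u % P then -1 else 1) :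
    ‖(P : ℂ)⁻¹ * ∑ u ∈ range P, (g u : ℂ) * (𝐞 ((u : ℝ) * (-(h : ℝ) / P)) : ℂ)‖ ≤
      2 / ((min h (P - h) : ℕ) : ℝ) := by
  have hP : 0 < P := by omega
  have hP0 : (0 : ℝ) < P := by exact_mod_cast hP
  have hmin0 : 0 < min h (P - h) := lt_min hh0 (by omega)
  have hmin : (0 : ℝ) < ((min h (P - h) : ℕ) : ℝ) := by exact_mod_cast hmin0
  -- `e(u·(−h/P)) = e(u·((P−h)/P))`
  have hfreq : ∀ u : ℕ, (𝐞 ((u : ℝ) * (-(h : ℝ) / P)) : ℂ) = 𝐞 ((u : ℝ) * ((((P - h : ℕ)) : ℝ) / P)) := by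
    intro u
    have : (u : ℝ) * ((((P - h : ℕ)) : ℝ) / P) = (u : ℝ) * (-(h : ℝ) / P) + ((u : ℤ) : ℝ) := by
      push_cast [hhP.le]; field_simp; ring
    rw [this, AddChar.map_add_eq_mul, Circle.coe_mul]
    have hint : (𝐞 (((u : ℤ)) : ℝ) : ℂ) = 1 := by
      rw [Real.fourierChar_apply]
      have : (↑(2 * Real.pi * (((u : ℤ)) : ℝ)) : ℂ) * Complex.I = ((u : ℤ) : ℂ) * (2 * Real.pi * Complex.I) := by
        push_cast; ring
      rw [this, Complex.exp_int_mul_two_pi_mul_I]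
    rw [hint, mul_one]
  -- split `g = 1 − 2·𝟙_{[P/2, P)}`
  have hsplit : ∑ u ∈ range P, (g u : ℂ) * (𝐞 ((u : ℝ) * (-(h : ℝ) / P)) : ℂ) =
      ∑ u ∈ range P, (𝐞 ((u : ℝ) * (-(h : ℝ) / P)) : ℂ) -
        2 * ∑ u ∈ (range P).filter (fun u => P / 2 ≤ u), (𝐞 ((u : ℝ) * (-(h : ℝ) / P)) : ℂ) := by
    rw [Finset.mul_sum, Finset.sum_filter, ← Finset.sum_sub_distrib]
    refine Finset.sum_congr rfl fun u hu => ?_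
    rw [Finset.mem_range] at hu
    rw [hg, Nat.mod_eq_of_lt hu]
    split_ifs <;> push_cast <;> ring
  have hzero : ∑ u ∈ range P, (𝐞 ((u : ℝ) * (-(h : ℝ) / P)) : ℂ) = 0 := by
    have := sum_range_fourierChar_div P hP (-(h : ℤ))
    rw [if_neg] at this
    · convert this using 2; push_cast; ring
    · rw [Int.dvd_neg]; exact fun hd => by have := Int.le_of_dvd (by exact_mod_cast hh0) hd; omega
  have hIco : (range P).filter (fun u => P / 2 ≤ u) = Finset.Ico (P / 2) P := by
    ext u; simp only [Finset.mem_filter, Finset.mem_range, Finset.mem_Ico]; tauto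
  -- the interval sum as a difference of two initial sums, each `≤ P/(2 min)`
  have hint : ‖∑ u ∈ Finset.Ico (P / 2) P, (𝐞 ((u : ℝ) * (-(h : ℝ) / P)) : ℂ)‖ ≤ (P : ℝ) / ((min h (P - h) : ℕ) : ℝ) := by
    have e1 : ∑ u ∈ Finset.Ico (P / 2) P, (𝐞 ((u : ℝ) * (-(h : ℝ) / P)) : ℂ) =
        ∑ u ∈ range P, (𝐞 ((u : ℝ) * ((((P - h : ℕ)) : ℝ) / P)) : ℂ) -
          ∑ u ∈ range (P / 2), (𝐞 ((u : ℝ) * ((((P - h : ℕ)) : ℝ) / P)) : ℂ) := by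
      rw [Finset.range_eq_Ico, Finset.range_eq_Ico, ← Finset.sum_Ico_consecutive _ (Nat.zero_le (P / 2)) (Nat.div_le_self P 2)]
      simp_rw [hfreq]; ring
    rw [e1]
    have hb1 := norm_sum_range_fourierChar_div_le hP (by omega : 0 < P - h) (by omega : P - h < P) P
    have hb2 := norm_sum_range_fourierChar_div_le hP (by omega : 0 < P - h) (by omega : P - h < P) (P / 2)
    have hmin' : min (P - h) (P - (P - h)) = min h (P - h) := by rw [Nat.sub_sub_self hhP.le, min_comm]
    rw [hmin'] at hb1 hb2
    calc _ ≤ ‖∑ u ∈ range P, (𝐞 ((u : ℝ) * ((((P - h : ℕ)) : ℝ) / P)) : ℂ)‖ +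
          ‖∑ u ∈ range (P / 2), (𝐞 ((u : ℝ) * ((((P - h : ℕ)) : ℝ) / P)) : ℂ)‖ := norm_sub_le _ _
      _ ≤ (P : ℝ) / (2 * ((min h (P - h) : ℕ) : ℝ)) + (P : ℝ) / (2 * ((min h (P - h) : ℕ) : ℝ)) := add_le_add hb1 hb2
      _ = (P : ℝ) / ((min h (P - h) : ℕ) : ℝ) := by field_simp; ring
  rw [hsplit, hzero, zero_sub, hIco, norm_mul, norm_neg, norm_mul, norm_inv, Complex.norm_natCast, Complex.norm_two]
  calc (P : ℝ)⁻¹ * (2 * ‖∑ u ∈ Finset.Ico (P / 2) P, (𝐞 ((u : ℝ) * (-(h : ℝ) / P)) : ℂ)‖)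
      ≤ (P : ℝ)⁻¹ * (2 * ((P : ℝ) / ((min h (P - h) : ℕ) : ℝ))) := by gcongr
    _ = 2 / ((min h (P - h) : ℕ) : ℝ) := by field_simp



/-- `e` is `1` at integers. [folklore] -/
theorem fourierChar_intCast (m : ℤ) : (𝐞 ((m : ℝ)) : ℂ) = 1 := by
  rw [Real.fourierChar_apply]
  have : (↑(2 * Real.pi * ((m : ℝ))) : ℂ) * Complex.I = ((m : ℤ) : ℂ) * (2 * Real.pi * Complex.I) := by
    push_cast; ring
  rw [this, Complex.exp_int_mul_two_pi_mul_I]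

/-- The signed representative `σ(h) = h` (`h ≤ P/2`) or `h − P` gives the same character:
`e(x σ(h)/P) = e(x h/P)`. [folklore] -/
theorem fourierChar_signedRep {P : ℕ} (hP : 0 < P) (h x : ℕ) :
    (𝐞 ((x : ℝ) * (((if h ≤ P / 2 then (h : ℤ) else (h : ℤ) - P : ℤ) : ℝ) / P)) : ℂ) =
      𝐞 ((x : ℝ) * ((h : ℝ) / P)) := by
  split_ifs with hh
  · push_cast; rfl
  · have hP0 : (P : ℝ) ≠ 0 := by exact_mod_cast hP.ne'
    have : (x : ℝ) * ((((h : ℤ) - P : ℤ) : ℝ) / P) = (x : ℝ) * ((h : ℝ) / P) + ((-(x : ℤ) : ℤ) : ℝ) := by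
      push_cast; field_simp; ring
    rw [this, AddChar.map_add_eq_mul, Circle.coe_mul, fourierChar_intCast, mul_one]

/-- The box smoothing of a `P`-periodic function is `P`-periodic. [folklore] -/
theorem boxSmooth_periodic {P W : ℕ} (g : ℕ → ℝ) (hg : ∀ u, g (u + P) = g u)
    (gt : ℕ → ℂ) (hgt : ∀ x, gt x = ((W : ℂ))⁻¹ * ∑ w ∈ range W, (g (x + w) : ℂ)) (x : ℕ) :
    gt (x + P) = gt x := by
  rw [hgt, hgt x]
  congr 1
  refine Finset.sum_congr rfl fun w _ => ?_
  rw [add_right_comm, hg]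

/-- The square wave `[P/2 ≤ u % P ? −1 : 1]` is `P`-periodic. [folklore] -/
theorem squareWave_periodic {P : ℕ} (g : ℕ → ℝ) (hg : ∀ u, g u = if P / 2 ≤ u % P then -1 else 1) (u : ℕ) :
    g (u + P) = g u := by
  rw [hg, hg u, Nat.add_mod_right]

/-- **Coefficient bound** for the smoothed square wave: for `min(h, P−h) ≥ 1`,
`‖ĉ(h)‖ ≤ P/(W min(h,P−h)²)` (`|ĝ| ≤ 2/min`, box factor `≤ P/(2W min)`).
[cite: Green2012, Proposition 2 (proof: "`|ψ̂₀(r)| ≤ … min(1, 24/επ|r|)²`")] -/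
theorem norm_boxSmooth_coeff_le {P W h : ℕ} (hPeven : 2 ∣ P) (hW1 : 1 ≤ W) (hh0 : 0 < h) (hhP : h < P)
    (g : ℕ → ℝ) (hg : ∀ u, g u = if P / 2 ≤ u % P then -1 else 1)
    (gt : ℕ → ℂ) (hgt : ∀ x, gt x = ((W : ℂ))⁻¹ * ∑ w ∈ range W, (g (x + w) : ℂ)) :
    ‖(P : ℂ)⁻¹ * ∑ u ∈ range P, gt u * (𝐞 ((u : ℝ) * (-(h : ℝ) / P)) : ℂ)‖ ≤
      (P : ℝ) / (W * ((min h (P - h) : ℕ) : ℝ) ^ 2) := by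
  have hP : 0 < P := by omega
  have hW0 : (0 : ℝ) < W := by exact_mod_cast hW1
  have hmin : (0 : ℝ) < ((min h (P - h) : ℕ) : ℝ) := by exact_mod_cast lt_min hh0 (by omega)
  rw [boxSmooth_coeff_eq hP g (squareWave_periodic g hg) gt hgt h, norm_mul]
  have h1 := norm_squareWave_coeff_le hPeven hh0 hhP g hg
  have h2 : ‖((W : ℂ))⁻¹ * ∑ w ∈ range W, (𝐞 ((w : ℝ) * ((h : ℝ) / P)) : ℂ)‖ ≤
      (W : ℝ)⁻¹ * ((P : ℝ) / (2 * ((min h (P - h) : ℕ) : ℝ))) := by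
    rw [norm_mul, norm_inv, Complex.norm_natCast]
    exact mul_le_mul_of_nonneg_left (norm_sum_range_fourierChar_div_le hP hh0 hhP W) (by positivity)
  calc _ ≤ (2 / ((min h (P - h) : ℕ) : ℝ)) * ((W : ℝ)⁻¹ * ((P : ℝ) / (2 * ((min h (P - h) : ℕ) : ℝ)))) :=
        mul_le_mul h1 h2 (norm_nonneg _) (by positivity)
    _ = (P : ℝ) / (W * ((min h (P - h) : ℕ) : ℝ) ^ 2) := by field_simp

/-- Trivial coefficient bound `‖ĉ(h)‖ ≤ 1` (from `|g̃| ≤ 1`). [folklore] -/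
theorem norm_boxSmooth_coeff_le_one {P W : ℕ} (hP : 0 < P) (hW1 : 1 ≤ W)
    (g : ℕ → ℝ) (hg : ∀ u, g u = if P / 2 ≤ u % P then -1 else 1)
    (gt : ℕ → ℂ) (hgt : ∀ x, gt x = ((W : ℂ))⁻¹ * ∑ w ∈ range W, (g (x + w) : ℂ)) (h : ℕ) :
    ‖(P : ℂ)⁻¹ * ∑ u ∈ range P, gt u * (𝐞 ((u : ℝ) * (-(h : ℝ) / P)) : ℂ)‖ ≤ 1 := by
  have hP0 : (0 : ℝ) < P := by exact_mod_cast hP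
  rw [norm_mul, norm_inv, Complex.norm_natCast]
  calc (P : ℝ)⁻¹ * ‖∑ u ∈ range P, gt u * (𝐞 ((u : ℝ) * (-(h : ℝ) / P)) : ℂ)‖
      ≤ (P : ℝ)⁻¹ * ∑ u ∈ range P, ‖gt u * (𝐞 ((u : ℝ) * (-(h : ℝ) / P)) : ℂ)‖ :=
        mul_le_mul_of_nonneg_left (norm_sum_le _ _) (by positivity)
    _ ≤ (P : ℝ)⁻¹ * ∑ _u ∈ range P, (1 : ℝ) := by
        refine mul_le_mul_of_nonneg_left (Finset.sum_le_sum fun u _ => ?_) (by positivity)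
        rw [norm_mul, norm_fourierChar, mul_one]
        exact norm_boxSmooth_le_one hW1 g hg gt hgt u
    _ = 1 := by rw [Finset.sum_const, Finset.card_range, nsmul_eq_mul, mul_one, inv_mul_cancel₀ hP0.ne']

/-- **Truncation of the Fourier series of the smoothed square wave**: keeping the frequencies with
`min(h, P−h) ≤ H₀` (`H₀ ≥ 1`), written with signed numerators `σ(h) ∈ (−P/2, P/2]`, costs at most
`∑_{min > H₀} ‖ĉ(h)‖ ≤ (P/W)(2/H₀)` uniformly in `x`. Green: "`‖ψ₁ − ψ₀‖_∞ ≤ ∑_{|r|>100/ε³}|ψ̂₀(r)| < ε/3`".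
[cite: Green2012, Proposition 2 (proof)] -/
theorem norm_boxSmooth_sub_trunc_le {P W H₀ : ℕ} (hPeven : 2 ∣ P) (hP2 : 2 ≤ P) (hW1 : 1 ≤ W) (hH₀ : 0 < H₀)
    (g : ℕ → ℝ) (hg : ∀ u, g u = if P / 2 ≤ u % P then -1 else 1)
    (gt : ℕ → ℂ) (hgt : ∀ x, gt x = ((W : ℂ))⁻¹ * ∑ w ∈ range W, (g (x + w) : ℂ)) (x : ℕ) :
    ‖gt x - ∑ h ∈ (range P).filter (fun h => min h (P - h) ≤ H₀),
        ((P : ℂ)⁻¹ * ∑ u ∈ range P, gt u * (𝐞 ((u : ℝ) * (-(h : ℝ) / P)) : ℂ)) *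
          (𝐞 ((x : ℝ) * (((if h ≤ P / 2 then (h : ℤ) else (h : ℤ) - P : ℤ) : ℝ) / P)) : ℂ)‖ ≤
      (P : ℝ) / W * (2 / H₀) := by
  have hP : 0 < P := by omega
  set c : ℕ → ℂ := fun h => (P : ℂ)⁻¹ * ∑ u ∈ range P, gt u * (𝐞 ((u : ℝ) * (-(h : ℝ) / P)) : ℂ) with hc
  have hinv := fourier_inversion hP gt (boxSmooth_periodic g (squareWave_periodic g hg) gt hgt) x
  -- replace signed representatives
  have hrep : ∑ h ∈ (range P).filter (fun h => min h (P - h) ≤ H₀),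
      c h * (𝐞 ((x : ℝ) * (((if h ≤ P / 2 then (h : ℤ) else (h : ℤ) - P : ℤ) : ℝ) / P)) : ℂ) =
      ∑ h ∈ (range P).filter (fun h => min h (P - h) ≤ H₀), c h * (𝐞 ((x : ℝ) * ((h : ℝ) / P)) : ℂ) :=
    Finset.sum_congr rfl fun h _ => by rw [fourierChar_signedRep hP]
  change ‖gt x - ∑ h ∈ (range P).filter (fun h => min h (P - h) ≤ H₀),
      c h * (𝐞 ((x : ℝ) * (((if h ≤ P / 2 then (h : ℤ) else (h : ℤ) - P : ℤ) : ℝ) / P)) : ℂ)‖ ≤ _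
  rw [hrep]
  have hsplit := Finset.sum_filter_add_sum_filter_not (range P) (fun h => min h (P - h) ≤ H₀)
    (fun h => c h * (𝐞 ((x : ℝ) * ((h : ℝ) / P)) : ℂ))
  have hgt_eq : gt x = ∑ h ∈ range P, c h * (𝐞 ((x : ℝ) * ((h : ℝ) / P)) : ℂ) := hinv
  rw [hgt_eq, ← hsplit, add_sub_cancel_left]
  calc ‖∑ h ∈ (range P).filter (fun h => ¬ min h (P - h) ≤ H₀), c h * (𝐞 ((x : ℝ) * ((h : ℝ) / P)) : ℂ)‖
      ≤ ∑ h ∈ (range P).filter (fun h => ¬ min h (P - h) ≤ H₀), ‖c h * (𝐞 ((x : ℝ) * ((h : ℝ) / P)) : ℂ)‖ :=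
        norm_sum_le _ _
    _ ≤ ∑ h ∈ (range P).filter (fun h => ¬ min h (P - h) ≤ H₀), (P : ℝ) / W * (1 / ((min h (P - h) : ℕ) : ℝ) ^ 2) := by
        refine Finset.sum_le_sum fun h hh => ?_
        rw [Finset.mem_filter, Finset.mem_range, not_le] at hh
        have hh0 : 0 < h := by
          by_contra h0; push Not at h0
          have : h = 0 := by omega
          rw [this] at hh; simp at hh
        rw [norm_mul, norm_fourierChar, mul_one]
        refine (norm_boxSmooth_coeff_le hPeven hW1 hh0 hh.1 g hg gt hgt).trans (le_of_eq ?_)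
        field_simp
    _ = (P : ℝ) / W * ∑ h ∈ (range P).filter (fun h => H₀ < min h (P - h)), (1 / ((min h (P - h) : ℕ) : ℝ) ^ 2) := by
        rw [← Finset.mul_sum]
        congr 1
        refine Finset.sum_congr ?_ fun _ _ => rfl
        ext h; simp only [Finset.mem_filter, not_le]
    _ ≤ (P : ℝ) / W * (2 / H₀) := mul_le_mul_of_nonneg_left (sum_inv_min_sq_le hH₀) (by positivity)



/-! ### Products, characters of sums, digits -/

/-- **Replacing factors one at a time**: if `‖a i‖, ‖b i‖ ≤ B` (`B ≥ 1`) then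
`‖∏_{i∈S} a i − ∏_{i∈S} b i‖ ≤ B^{|S|} ∑_{i∈S} ‖a i − b i‖`. Green: "Replacing each copy of `ψ`
by `ψ̃` in turn". [cite: Green2012, Proposition 2 (proof)] -/
theorem norm_prod_sub_prod_le {ι : Type*} [DecidableEq ι] (S : Finset ι) (a b : ι → ℂ) {B : ℝ} (hB : 1 ≤ B)
    (ha : ∀ i ∈ S, ‖a i‖ ≤ B) (hb : ∀ i ∈ S, ‖b i‖ ≤ B) :
    ‖∏ i ∈ S, a i - ∏ i ∈ S, b i‖ ≤ B ^ S.card * ∑ i ∈ S, ‖a i - b i‖ := by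
  induction S using Finset.induction_on with
  | empty => simp
  | insert j S hj ih =>
      have ha' : ∀ i ∈ S, ‖a i‖ ≤ B := fun i hi => ha i (Finset.mem_insert_of_mem hi)
      have hb' : ∀ i ∈ S, ‖b i‖ ≤ B := fun i hi => hb i (Finset.mem_insert_of_mem hi)
      have ih' := ih ha' hb'
      rw [Finset.prod_insert hj, Finset.prod_insert hj, Finset.sum_insert hj, Finset.card_insert_of_notMem hj]
      have hprodb : ‖∏ i ∈ S, b i‖ ≤ B ^ S.card := by
        rw [norm_prod]
        calc ∏ i ∈ S, ‖b i‖ ≤ ∏ _i ∈ S, B := Finset.prod_le_prod (fun _ _ => norm_nonneg _) hb'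
          _ = B ^ S.card := by rw [Finset.prod_const]
      have e : a j * ∏ i ∈ S, a i - b j * ∏ i ∈ S, b i =
          a j * (∏ i ∈ S, a i - ∏ i ∈ S, b i) + (a j - b j) * ∏ i ∈ S, b i := by ring
      rw [e]
      have hBS : 0 ≤ B ^ S.card := by positivity
      have hsum0 : 0 ≤ ∑ i ∈ S, ‖a i - b i‖ := Finset.sum_nonneg fun _ _ => norm_nonneg _
      calc ‖a j * (∏ i ∈ S, a i - ∏ i ∈ S, b i) + (a j - b j) * ∏ i ∈ S, b i‖
          ≤ ‖a j‖ * ‖∏ i ∈ S, a i - ∏ i ∈ S, b i‖ + ‖a j - b j‖ * ‖∏ i ∈ S, b i‖ := by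
            refine (norm_add_le _ _).trans ?_; rw [norm_mul, norm_mul]
        _ ≤ B * (B ^ S.card * ∑ i ∈ S, ‖a i - b i‖) + ‖a j - b j‖ * B ^ S.card := by
            refine add_le_add (mul_le_mul (ha j (Finset.mem_insert_self _ _)) ih' (norm_nonneg _) (by linarith)) ?_
            exact mul_le_mul_of_nonneg_left hprodb (norm_nonneg _)
        _ = B ^ (S.card + 1) * ∑ i ∈ S, ‖a i - b i‖ + B ^ S.card * ‖a j - b j‖ := by ring
        _ ≤ B ^ (S.card + 1) * ∑ i ∈ S, ‖a i - b i‖ + B ^ (S.card + 1) * ‖a j - b j‖ := by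
            refine add_le_add le_rfl (mul_le_mul_of_nonneg_right ?_ (norm_nonneg _))
            exact pow_le_pow_right₀ hB (Nat.le_succ _)
        _ = B ^ (S.card + 1) * (‖a j - b j‖ + ∑ i ∈ S, ‖a i - b i‖) := by ring

/-- Bernoulli-type upper bound: `(1 + η)^m ≤ 1 + 2mη` for `0 ≤ η`, `2mη ≤ 1`. [folklore] -/
theorem one_add_pow_le {η : ℝ} (hη : 0 ≤ η) : ∀ m : ℕ, 2 * m * η ≤ 1 → (1 + η) ^ m ≤ 1 + 2 * m * η := by
  intro m
  induction m with
  | zero => intro _; simp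
  | succ m ih =>
      intro hm
      have hm' : 2 * (m : ℝ) * η ≤ 1 := by push_cast at hm; nlinarith
      have h1 := ih hm'
      rw [pow_succ]
      calc (1 + η) ^ m * (1 + η) ≤ (1 + 2 * m * η) * (1 + η) := mul_le_mul_of_nonneg_right h1 (by linarith)
        _ = 1 + 2 * m * η + η + 2 * m * η * η := by ring
        _ ≤ 1 + 2 * (m + 1 : ℕ) * η := by push_cast; nlinarith

/-- `e` of a finite sum is the product. [folklore] -/
theorem fourierChar_sum {ι : Type*} (s : Finset ι) (a : ι → ℝ) :
    (𝐞 (∑ i ∈ s, a i) : ℂ) = ∏ i ∈ s, (𝐞 (a i) : ℂ) := by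
  classical
  induction s using Finset.induction_on with
  | empty => simp
  | insert j s hj ih => rw [Finset.sum_insert hj, Finset.prod_insert hj, AddChar.map_add_eq_mul, Circle.coe_mul, ih]

/-- The digit sign `sgn(bit_j(x)) = ±1` is the square wave `[2^j ≤ x % 2^{j+1} ? −1 : 1]`. [folklore] -/
theorem sgn_testBit_eq (x j : ℕ) :
    Literature.Probability.RandomGraphs.LowDegree.sgn (x.testBit j) =
      if 2 ^ (j + 1) / 2 ≤ x % 2 ^ (j + 1) then -1 else 1 := by
  have hdiv : 2 ^ (j + 1) / 2 = 2 ^ j := by rw [pow_succ]; simp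
  rw [hdiv]
  unfold Literature.Probability.RandomGraphs.LowDegree.sgn
  -- `testBit x j ↔ 2^j ≤ x % 2^{j+1}`
  have hbit : x.testBit j = true ↔ 2 ^ j ≤ x % 2 ^ (j + 1) := by
    rw [Nat.testBit_eq_decide_div_mod_eq, decide_eq_true_iff, Nat.mod_pow_succ]
    have h1 : x % 2 ^ j < 2 ^ j := Nat.mod_lt _ (Nat.two_pow_pos j)
    have h2 : x / 2 ^ j % 2 < 2 := Nat.mod_lt _ two_pos
    constructor
    · intro h; rw [h]; omega
    · intro h
      by_contra hne
      have : x / 2 ^ j % 2 = 0 := by omega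
      rw [this] at h; omega
  by_cases h : x.testBit j = true
  · rw [if_pos h, if_pos (hbit.1 h)]
  · rw [if_neg h, if_neg (fun h2 => h (hbit.2 h2))]

/-- The kept frequencies `{h < P : min(h, P−h) ≤ H₀}` number at most `2H₀ + 1`. [folklore] -/
theorem card_filter_min_le (P H₀ : ℕ) :
    ((range P).filter (fun h => min h (P - h) ≤ H₀)).card ≤ 2 * H₀ + 1 := by
  have hsub : (range P).filter (fun h => min h (P - h) ≤ H₀) ⊆ range (H₀ + 1) ∪ Finset.Ico (P - H₀) P := by
    intro h hh
    rw [Finset.mem_filter, Finset.mem_range] at hh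
    rw [Finset.mem_union, Finset.mem_range, Finset.mem_Ico]
    rcases min_choice h (P - h) with hm | hm <;> rw [hm] at hh <;> omega
  refine (Finset.card_le_card hsub).trans ((Finset.card_union_le _ _).trans ?_)
  rw [Finset.card_range, Nat.card_Ico]
  omega



/-! ### One digit: the trigonometric polynomial `T` replacing the square wave -/

/-- **The one-digit package** (Green's `ψ̃` for the digit of period `P = 2^{e+1}`, in the discrete
box-smoothing form): with `W = P/D` (or `1` if `P < D`), `g̃` the box smoothing of the square wave
`g`, `ĉ` its Fourier coefficients and `T` the truncation to `min(h, P−h) ≤ H₀` with signed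
numerators: `‖ĉ‖ ≤ 1`, `‖T‖_∞ ≤ 1 + 2D/H₀`, `T` is `P`-periodic and `∑_{x<P}‖T − g‖ ≤ P(4/D + 2D/H₀)`.
[cite: Green2012, Proposition 2 (proof)] -/
theorem digit_package {P D H₀ e d : ℕ} (hP : P = 2 ^ (e + 1)) (hD : D = 2 ^ d) (hd : 1 ≤ d) (hH₀ : 0 < H₀)
    (g : ℕ → ℝ) (hg : ∀ u, g u = if P / 2 ≤ u % P then -1 else 1)
    (W : ℕ) (hW : W = if D ≤ P then P / D else 1)
    (gt : ℕ → ℂ) (hgt : ∀ x, gt x = ((W : ℂ))⁻¹ * ∑ w ∈ range W, (g (x + w) : ℂ))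
    (c : ℕ → ℂ) (hc : ∀ h, c h = (P : ℂ)⁻¹ * ∑ u ∈ range P, gt u * (𝐞 ((u : ℝ) * (-(h : ℝ) / P)) : ℂ))
    (T : ℕ → ℂ) (hT : ∀ x, T x = ∑ h ∈ (range P).filter (fun h => min h (P - h) ≤ H₀),
        c h * (𝐞 ((x : ℝ) * (((if h ≤ P / 2 then (h : ℤ) else (h : ℤ) - P : ℤ) : ℝ) / P)) : ℂ)) :
    (∀ h, ‖c h‖ ≤ 1) ∧ (∀ x, ‖T x‖ ≤ 1 + 2 * D / H₀) ∧ (∀ x, T (x + P) = T x) ∧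
      (∑ x ∈ range P, ‖T x - (g x : ℂ)‖ ≤ P * (4 / D + 2 * D / H₀)) := by
  have hP2 : 2 ≤ P := by rw [hP, pow_succ]; have := Nat.one_le_two_pow (n := e); omega
  have hPpos : 0 < P := by omega
  have hPeven : 2 ∣ P := ⟨2 ^ e, by rw [hP, pow_succ, mul_comm]⟩
  have hD2 : 2 ≤ D := by rw [hD]; calc 2 = 2 ^ 1 := by norm_num
    _ ≤ 2 ^ d := Nat.pow_le_pow_right (by norm_num) hd
  have hDpos : 0 < D := by omega
  have hP0 : (0 : ℝ) < P := by exact_mod_cast hPpos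
  have hD0 : (0 : ℝ) < D := by exact_mod_cast hDpos
  have hH₀0 : (0 : ℝ) < H₀ := by exact_mod_cast hH₀
  -- the width `W`
  have hW1 : 1 ≤ W := by
    rw [hW]; split_ifs with hDP
    · exact Nat.div_pos hDP hDpos
    · exact le_rfl
  have hWle : W ≤ P / 2 := by
    rw [hW]; split_ifs with hDP
    · exact Nat.div_le_div_left hD2 two_pos
    · omega
  have hPW : (P : ℝ) / W ≤ D := by
    rw [hW]; split_ifs with hDP
    · have hdvd : D ∣ P := by
        rw [hD, hP]; apply Nat.pow_dvd_pow
        by_contra hlt; push Not at hlt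
        have : 2 ^ (e + 1) < 2 ^ d := Nat.pow_lt_pow_right (by norm_num) hlt
        rw [hD, hP] at hDP; omega
      have hWD : ((P / D : ℕ) : ℝ) = (P : ℝ) / D := Nat.cast_div hdvd hD0.ne'
      rw [hWD, div_div_eq_mul_div]
      rw [mul_div_assoc, mul_div_cancel₀ _ hP0.ne']
    · push Not at hDP
      simp only [Nat.cast_one, div_one]
      exact_mod_cast hDP.le
  have hW0 : (0 : ℝ) < W := by exact_mod_cast hW1
  -- (a) coefficients
  have ha : ∀ h, ‖c h‖ ≤ 1 := fun h => by rw [hc]; exact norm_boxSmooth_coeff_le_one hPpos hW1 g hg gt hgt h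
  -- truncation error
  have htr : ∀ x, ‖gt x - T x‖ ≤ (P : ℝ) / W * (2 / H₀) := by
    intro x
    have := norm_boxSmooth_sub_trunc_le hPeven hP2 hW1 hH₀ g hg gt hgt x
    rw [hT]
    simp_rw [hc]
    exact this
  have hη : (P : ℝ) / W * (2 / H₀) ≤ 2 * D / H₀ := by
    rw [mul_div_assoc']
    rw [div_le_div_iff_of_pos_right hH₀0]
    nlinarith
  refine ⟨ha, ?_, ?_, ?_⟩
  · intro x
    calc ‖T x‖ = ‖gt x - (gt x - T x)‖ := by rw [sub_sub_cancel]
      _ ≤ ‖gt x‖ + ‖gt x - T x‖ := norm_sub_le _ _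
      _ ≤ 1 + 2 * D / H₀ := add_le_add (norm_boxSmooth_le_one hW1 g hg gt hgt x) ((htr x).trans hη)
  · intro x
    rw [hT, hT x]
    refine Finset.sum_congr rfl fun h _ => ?_
    congr 1
    have hPr : (P : ℝ) ≠ 0 := hP0.ne'
    have : ((x + P : ℕ) : ℝ) * (((if h ≤ P / 2 then (h : ℤ) else (h : ℤ) - P : ℤ) : ℝ) / P) =
        (x : ℝ) * (((if h ≤ P / 2 then (h : ℤ) else (h : ℤ) - P : ℤ) : ℝ) / P) +
          (((if h ≤ P / 2 then (h : ℤ) else (h : ℤ) - P : ℤ)) : ℝ) := by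
      push_cast; field_simp
    rw [this, AddChar.map_add_eq_mul, Circle.coe_mul, fourierChar_intCast, mul_one]
  · -- `L¹` over a period
    have hbox : ∑ x ∈ range P, ‖gt x - g x‖ ≤ 4 * P / D := by
      rw [hW] at hgt
      split_ifs at hgt with hDP
      · have h1 := sum_norm_boxSmooth_sub_le hPeven (by rw [hW, if_pos hDP] at hW1; exact hW1)
          (by rw [hW, if_pos hDP] at hWle; exact hWle) g hg gt hgt
        refine h1.trans ?_
        have : ((P / D : ℕ) : ℝ) ≤ (P : ℝ) / D := Nat.cast_div_le
        rw [mul_div_assoc]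
        linarith
      · have h0 : ∀ x, gt x = g x := fun x => by rw [hgt]; simp
        simp only [h0, sub_self, norm_zero, Finset.sum_const_zero]
        positivity
    calc ∑ x ∈ range P, ‖T x - (g x : ℂ)‖ ≤ ∑ x ∈ range P, (‖gt x - T x‖ + ‖gt x - g x‖) := by
          refine Finset.sum_le_sum fun x _ => ?_
          calc ‖T x - (g x : ℂ)‖ = ‖(gt x - g x) - (gt x - T x)‖ := by ring_nf
            _ ≤ ‖gt x - g x‖ + ‖gt x - T x‖ := norm_sub_le _ _
            _ = _ := add_comm _ _
      _ = ∑ x ∈ range P, ‖gt x - T x‖ + ∑ x ∈ range P, ‖gt x - g x‖ := Finset.sum_add_distrib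
      _ ≤ ∑ _x ∈ range P, (2 * (D : ℝ) / H₀) + 4 * P / D :=
          add_le_add (Finset.sum_le_sum fun x _ => (htr x).trans hη) hbox
      _ = P * (4 / D + 2 * D / H₀) := by
          rw [Finset.sum_const, Finset.card_range, nsmul_eq_mul]; ring



/-! ### Green 2012, Proposition 2 (Kátai): from a Walsh coefficient to a sparse dyadic frequency -/

/-- Pigeonhole for a normed sum: some term is at least the average. [folklore] -/
theorem exists_norm_ge_div_card {ι : Type*} (s : Finset ι) (hs : s.Nonempty) (F : ι → ℂ) (C : ι → ℂ)
    (hC : ∀ i ∈ s, ‖C i‖ ≤ 1) :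
    ∃ i ∈ s, ‖∑ i ∈ s, C i * F i‖ / s.card ≤ ‖F i‖ := by
  by_contra hcon
  push Not at hcon
  have hcard : (0 : ℝ) < s.card := by exact_mod_cast hs.card_pos
  have h1 : ‖∑ i ∈ s, C i * F i‖ ≤ ∑ i ∈ s, ‖F i‖ := by
    refine (norm_sum_le _ _).trans (Finset.sum_le_sum fun i hi => ?_)
    rw [norm_mul]
    calc ‖C i‖ * ‖F i‖ ≤ 1 * ‖F i‖ := mul_le_mul_of_nonneg_right (hC i hi) (norm_nonneg _)
      _ = ‖F i‖ := one_mul _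
  have h2 : ∑ i ∈ s, ‖F i‖ < ∑ _i ∈ s, ‖∑ i ∈ s, C i * F i‖ / s.card := Finset.sum_lt_sum_of_nonempty hs hcon
  rw [Finset.sum_const, nsmul_eq_mul, mul_div_cancel₀ _ hcard.ne'] at h2
  linarith

set_option maxHeartbeats 1600000 in
/-- **Green 2012, Proposition 2 (Kátai's argument), discrete form.** Let `N = 2ⁿ`, `∅ ≠ S ⊆ {0,…,n−1}`,
`k = |S|`, `|f| ≤ 1`, `0 < δ ≤ 1` and suppose the Fourier–Walsh sum is large:
`‖∑_{x<N} f(x) w_S(x)‖ ≥ δN`, `w_S(x) = ∏_{j∈S}(−1)^{x_j}`. Then there is a sparse dyadic rational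
`θ = ∑_{j∈S} h_j/2^{j+1}` with `|h_j| ≤ 2200k²/δ²` and
`‖∑_{x<N} f(x)e(xθ)‖ ≥ (δ/2)(δ²/(6600k²))^k N`. (Green: `|r_i| ≤ (10k/δ)³`, `≥ (δ/10k)^{4k}`; the
shape of the constants is immaterial.) Proof as printed, with the discrete box smoothing
`digit_package` in place of Green's `ψ̃ = (φ ∗ χ ∗ χ)`-construction: replace each digit square wave by
its trigonometric polynomial (`norm_prod_sub_prod_le`; total error `≤ δN/4`), expand the product
(`Finset.prod_sum`) and take the largest of the `≤ (3H₀)^k` resulting exponential sums.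
[cite: Green2012, Proposition 2] -/
theorem katai {n : ℕ} (S : Finset (Fin n)) (hS : S.Nonempty) (f : ℕ → ℂ) (hf : ∀ x, ‖f x‖ ≤ 1)
    {δ : ℝ} (hδ : 0 < δ) (hδ1 : δ ≤ 1)
    (hbig : δ * 2 ^ n ≤ ‖∑ x ∈ range (2 ^ n), f x *
        (Literature.Probability.RandomGraphs.LowDegree.walsh S (fun i => x.testBit i) : ℂ)‖) :
    ∃ h : Fin n → ℤ, (∀ j ∈ S, |(h j : ℝ)| ≤ 2200 * S.card ^ 2 / δ ^ 2) ∧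
      δ / 2 * (δ ^ 2 / (6600 * S.card ^ 2)) ^ S.card * 2 ^ n ≤
        ‖∑ x ∈ range (2 ^ n), f x * (𝐞 ((x : ℝ) * ∑ j ∈ S, (h j : ℝ) / 2 ^ ((j : ℕ) + 1)) : ℂ)‖ := by
  classical
  -- parameters
  set k : ℕ := S.card with hkdef
  have hk1 : 1 ≤ k := Finset.card_pos.2 hS
  have hk1r : (1 : ℝ) ≤ k := by exact_mod_cast hk1
  have hkδ : (1 : ℝ) ≤ k / δ := by rw [le_div_iff₀ hδ]; nlinarith
  set A : ℕ := ⌈32 * (k : ℝ) / δ⌉₊ with hAdef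
  have hAge : 32 * (k : ℝ) / δ ≤ A := Nat.le_ceil _
  have hAle : (A : ℝ) ≤ 32 * k / δ + 1 := (Nat.ceil_lt_add_one (by positivity)).le
  have hA32 : (32 : ℝ) ≤ A := le_trans (by rw [le_div_iff₀ hδ]; nlinarith) hAge
  have hA1 : 1 < A := by exact_mod_cast (show (1 : ℝ) < A by linarith)
  set d : ℕ := Nat.clog 2 A with hddef
  have hd1 : 1 ≤ d := Nat.clog_pos one_lt_two hA1
  set D : ℕ := 2 ^ d with hDdef
  have hAD : A ≤ D := Nat.le_pow_clog one_lt_two A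
  have hD2A : D < 2 * A := by
    have h1 := Nat.pow_pred_clog_lt_self one_lt_two hA1
    rw [← hddef] at h1
    have e : 2 * 2 ^ d.pred = D := by
      rw [hDdef, ← pow_succ', ← Nat.succ_eq_add_one, Nat.succ_pred_eq_of_pos (by omega : 0 < d)]
    omega
  have hDge : 32 * (k : ℝ) / δ ≤ D := hAge.trans (by exact_mod_cast hAD)
  have hDle : (D : ℝ) ≤ 66 * k / δ := by
    have h1 : (D : ℝ) ≤ 2 * A := by exact_mod_cast hD2A.le
    calc (D : ℝ) ≤ 2 * (32 * k / δ + 1) := h1.trans (by linarith)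
      _ = 64 * k / δ + 2 := by ring
      _ ≤ 64 * k / δ + 2 * (k / δ) := by linarith
      _ = 66 * k / δ := by ring
  have hD0 : (0 : ℝ) < D := lt_of_lt_of_le (by positivity) hDge
  set H₀ : ℕ := ⌈32 * (k : ℝ) * D / δ⌉₊ with hH₀def
  have hH₀ge : 32 * (k : ℝ) * D / δ ≤ H₀ := Nat.le_ceil _
  have hH₀le : (H₀ : ℝ) ≤ 32 * k * D / δ + 1 := (Nat.ceil_lt_add_one (by positivity)).le
  have hH₀0r : (0 : ℝ) < H₀ := lt_of_lt_of_le (by positivity) hH₀ge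
  have hH₀0 : 0 < H₀ := by exact_mod_cast hH₀0r
  have hH₀k : (H₀ : ℝ) ≤ 2200 * k ^ 2 / δ ^ 2 := by
    have hstep : 32 * (k : ℝ) * D / δ ≤ 32 * k * (66 * k / δ) / δ :=
      div_le_div_of_nonneg_right (mul_le_mul_of_nonneg_left hDle (by positivity)) hδ.le
    calc (H₀ : ℝ) ≤ 32 * k * D / δ + 1 := hH₀le
      _ ≤ 32 * k * (66 * k / δ) / δ + 1 := by linarith
      _ = 2112 * k ^ 2 / δ ^ 2 + 1 := by field_simp; ring
      _ ≤ 2112 * k ^ 2 / δ ^ 2 + 88 * (k / δ) ^ 2 := by nlinarith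
      _ = 2200 * k ^ 2 / δ ^ 2 := by field_simp; ring
  set η : ℝ := 2 * D / H₀ with hηdef
  have hη0 : 0 ≤ η := by positivity
  have hηle : η ≤ δ / (16 * k) := by
    rw [hηdef, div_le_div_iff₀ hH₀0r (by positivity)]
    calc 2 * (D : ℝ) * (16 * k) = 32 * k * D := by ring
      _ = 32 * k * D / δ * δ := by field_simp
      _ ≤ H₀ * δ := mul_le_mul_of_nonneg_right hH₀ge hδ.le
      _ = δ * H₀ := mul_comm _ _
  have h4D : 4 / (D : ℝ) ≤ δ / (8 * k) := by
    rw [div_le_div_iff₀ hD0 (by positivity)]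
    calc 4 * (8 * (k : ℝ)) = 32 * k := by ring
      _ = 32 * k / δ * δ := by field_simp
      _ ≤ D * δ := mul_le_mul_of_nonneg_right hDge hδ.le
      _ = δ * D := mul_comm _ _
  -- the per-digit objects
  set P : Fin n → ℕ := fun j => 2 ^ ((j : ℕ) + 1) with hPdef
  set Wd : Fin n → ℕ := fun j => if D ≤ P j then P j / D else 1 with hWddef
  set g : Fin n → ℕ → ℝ := fun j u => if P j / 2 ≤ u % P j then -1 else 1 with hgdef
  set gt : Fin n → ℕ → ℂ := fun j x => ((Wd j : ℂ))⁻¹ * ∑ w ∈ range (Wd j), (g j (x + w) : ℂ) with hgtdef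
  set c : Fin n → ℕ → ℂ := fun j h => (P j : ℂ)⁻¹ * ∑ u ∈ range (P j), gt j u * (𝐞 ((u : ℝ) * (-(h : ℝ) / P j)) : ℂ) with hcdef
  set σ : Fin n → ℕ → ℤ := fun j h => if h ≤ P j / 2 then (h : ℤ) else (h : ℤ) - P j with hσdef
  set R : Fin n → Finset ℕ := fun j => (range (P j)).filter (fun h => min h (P j - h) ≤ H₀) with hRdef
  set T : Fin n → ℕ → ℂ := fun j x => ∑ h ∈ R j, c j h * (𝐞 ((x : ℝ) * ((σ j h : ℝ) / P j)) : ℂ) with hTdef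
  have hpack : ∀ j : Fin n, (∀ h, ‖c j h‖ ≤ 1) ∧ (∀ x, ‖T j x‖ ≤ 1 + 2 * D / H₀) ∧ (∀ x, T j (x + P j) = T j x) ∧
      (∑ x ∈ range (P j), ‖T j x - (g j x : ℂ)‖ ≤ P j * (4 / D + 2 * D / H₀)) := fun j =>
    digit_package (P := P j) (D := D) (H₀ := H₀) (e := (j : ℕ)) (d := d) rfl rfl hd1 hH₀0 (g j) (fun _ => rfl)
      (Wd j) rfl (gt j) (fun _ => rfl) (c j) (fun _ => rfl) (T j) (fun _ => rfl)
  -- Walsh function as a product of square waves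
  have hwalsh : ∀ x : ℕ, (Literature.Probability.RandomGraphs.LowDegree.walsh S (fun i => x.testBit i) : ℂ) =
      ∏ j ∈ S, (g j x : ℂ) := by
    intro x
    unfold Literature.Probability.RandomGraphs.LowDegree.walsh
    rw [Complex.ofReal_prod]
    refine Finset.prod_congr rfl fun j _ => ?_
    rw [sgn_testBit_eq]
  set N : ℕ := 2 ^ n with hNdef
  have hN0 : (0 : ℝ) < (2 : ℝ) ^ n := by positivity
  set B : ℝ := 1 + 2 * D / H₀ with hBdef
  have hB1 : 1 ≤ B := by rw [hBdef]; linarith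
  have hBη : B = 1 + η := rfl
  -- Step 1: the total replacement error
  have hg1 : ∀ j x, ‖(g j x : ℂ)‖ ≤ B := fun j x => by
    rw [Complex.norm_real, hgdef]; dsimp only; split_ifs <;> simp [hB1]
  have herrx : ∀ x, ‖f x * ∏ j ∈ S, (g j x : ℂ) - f x * ∏ j ∈ S, T j x‖ ≤ B ^ k * ∑ j ∈ S, ‖(g j x : ℂ) - T j x‖ := by
    intro x
    rw [← mul_sub, norm_mul]
    calc ‖f x‖ * ‖∏ j ∈ S, (g j x : ℂ) - ∏ j ∈ S, T j x‖ ≤ 1 * (B ^ k * ∑ j ∈ S, ‖(g j x : ℂ) - T j x‖) :=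
          mul_le_mul (hf x) (norm_prod_sub_prod_le S _ _ hB1 (fun j _ => hg1 j x) (fun j _ => (hpack j).2.1 x))
            (norm_nonneg _) zero_le_one
      _ = _ := one_mul _
  have hperiod : ∀ j ∈ S, ∑ x ∈ range N, ‖(g j x : ℂ) - T j x‖ ≤ N * (4 / D + η) := by
    intro j hj
    have hPj : P j ∣ N := by
      rw [hNdef, hPdef]; exact Nat.pow_dvd_pow 2 (by have := j.isLt; omega)
    obtain ⟨m, hm⟩ := hPj
    set F : ℕ → ℝ := fun x => ‖(g j x : ℂ) - T j x‖ with hF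
    have hFper : ∀ x, F (x + P j) = F x := by
      intro x
      rw [hF]; dsimp only
      rw [(hpack j).2.2.1 x]
      have : g j (x + P j) = g j x := squareWave_periodic (g j) (fun _ => rfl) x
      rw [this]
    have h1 := sum_range_mul_periodic F hFper m
    rw [← hm] at h1
    rw [h1, nsmul_eq_mul]
    have h2 : ∑ x ∈ range (P j), F x ≤ P j * (4 / D + 2 * D / H₀) := by
      have := (hpack j).2.2.2
      refine le_trans (le_of_eq (Finset.sum_congr rfl fun x _ => ?_)) this
      rw [hF]; dsimp only; rw [norm_sub_rev]
    have hm' : (N : ℝ) = P j * m := by exact_mod_cast hm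
    calc (m : ℝ) * ∑ x ∈ range (P j), F x ≤ m * (P j * (4 / D + 2 * D / H₀)) :=
          mul_le_mul_of_nonneg_left h2 (Nat.cast_nonneg m)
      _ = N * (4 / D + η) := by rw [hm', hηdef]; ring
  have hSdiff : ‖∑ x ∈ range N, f x * ∏ j ∈ S, (g j x : ℂ) - ∑ x ∈ range N, f x * ∏ j ∈ S, T j x‖ ≤ δ / 4 * N := by
    rw [← Finset.sum_sub_distrib]
    calc ‖∑ x ∈ range N, (f x * ∏ j ∈ S, (g j x : ℂ) - f x * ∏ j ∈ S, T j x)‖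
        ≤ ∑ x ∈ range N, ‖f x * ∏ j ∈ S, (g j x : ℂ) - f x * ∏ j ∈ S, T j x‖ := norm_sum_le _ _
      _ ≤ ∑ x ∈ range N, B ^ k * ∑ j ∈ S, ‖(g j x : ℂ) - T j x‖ := Finset.sum_le_sum fun x _ => herrx x
      _ = B ^ k * ∑ j ∈ S, ∑ x ∈ range N, ‖(g j x : ℂ) - T j x‖ := by rw [← Finset.mul_sum, Finset.sum_comm]
      _ ≤ B ^ k * ∑ _j ∈ S, (N : ℝ) * (4 / D + η) := by
          refine mul_le_mul_of_nonneg_left (Finset.sum_le_sum hperiod) (by positivity)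
      _ = B ^ k * (k * (N * (4 / D + η))) := by rw [Finset.sum_const, nsmul_eq_mul]
      _ ≤ (1 + 2 * k * η) * (k * (N * (4 / D + η))) := by
          refine mul_le_mul_of_nonneg_right ?_ (by positivity)
          rw [hBη]
          refine one_add_pow_le hη0 k ?_
          calc 2 * (k : ℝ) * η ≤ 2 * k * (δ / (16 * k)) := mul_le_mul_of_nonneg_left hηle (by positivity)
            _ = δ / 8 := by field_simp; ring
            _ ≤ 1 := by linarith
      _ ≤ δ / 4 * N := by
          -- `(1 + δ/8) · k · (δ/(8k) + δ/(16k)) = (1+δ/8)(3δ/16) ≤ (9/8)(3/16)δ < δ/4`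
          have h1 : 2 * (k : ℝ) * η ≤ δ / 8 := by
            calc 2 * (k : ℝ) * η ≤ 2 * k * (δ / (16 * k)) := mul_le_mul_of_nonneg_left hηle (by positivity)
              _ = δ / 8 := by field_simp; ring
          have h2 : (k : ℝ) * (4 / D + η) ≤ 3 * δ / 16 := by
            calc (k : ℝ) * (4 / D + η) ≤ k * (δ / (8 * k) + δ / (16 * k)) := by gcongr
              _ = 3 * δ / 16 := by field_simp; ring
          have hNn : (0 : ℝ) ≤ N := Nat.cast_nonneg N
          calc (1 + 2 * k * η) * (k * (N * (4 / D + η))) = ((1 + 2 * k * η) * (k * (4 / D + η))) * N := by ring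
            _ ≤ ((1 + δ / 8) * (3 * δ / 16)) * N := by
                refine mul_le_mul_of_nonneg_right ?_ hNn
                exact mul_le_mul (by linarith) h2 (by positivity) (by linarith)
            _ ≤ δ / 4 * N := by
                refine mul_le_mul_of_nonneg_right ?_ hNn
                nlinarith
  -- hence the smoothed sum is large
  have hSW : δ * N ≤ ‖∑ x ∈ range N, f x * ∏ j ∈ S, (g j x : ℂ)‖ := by
    have : ∑ x ∈ range N, f x * ∏ j ∈ S, (g j x : ℂ) = ∑ x ∈ range (2 ^ n), f x *
        (Literature.Probability.RandomGraphs.LowDegree.walsh S (fun i => x.testBit i) : ℂ) :=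
      Finset.sum_congr rfl fun x _ => by rw [hwalsh]
    rw [this]
    have hN : (N : ℝ) = (2 : ℝ) ^ n := by rw [hNdef]; push_cast; ring
    rw [hN]; exact hbig
  have hST : δ / 2 * N ≤ ‖∑ x ∈ range N, f x * ∏ j ∈ S, T j x‖ := by
    have := norm_sub_norm_le (∑ x ∈ range N, f x * ∏ j ∈ S, (g j x : ℂ)) (∑ x ∈ range N, f x * ∏ j ∈ S, T j x)
    have hNn : (0 : ℝ) ≤ N := Nat.cast_nonneg N
    nlinarith
  -- Step 2: expand the product
  have hexpand : ∀ x : ℕ, ∏ j ∈ S, T j x =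
      ∑ τ ∈ S.pi R, (∏ j ∈ S.attach, c j.1 (τ j.1 j.2)) *
        (𝐞 ((x : ℝ) * ∑ j ∈ S.attach, ((σ j.1 (τ j.1 j.2) : ℝ) / P j.1)) : ℂ) := by
    intro x
    rw [Finset.prod_sum]
    refine Finset.sum_congr rfl fun τ _ => ?_
    rw [Finset.prod_mul_distrib, Finset.mul_sum, fourierChar_sum]
  set Sg : (∀ j ∈ S, ℕ) → ℂ := fun τ => ∑ x ∈ range N, f x *
    (𝐞 ((x : ℝ) * ∑ j ∈ S.attach, ((σ j.1 (τ j.1 j.2) : ℝ) / P j.1)) : ℂ) with hSg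
  set Cf : (∀ j ∈ S, ℕ) → ℂ := fun τ => ∏ j ∈ S.attach, c j.1 (τ j.1 j.2) with hCf
  have hSTeq : ∑ x ∈ range N, f x * ∏ j ∈ S, T j x = ∑ τ ∈ S.pi R, Cf τ * Sg τ := by
    calc ∑ x ∈ range N, f x * ∏ j ∈ S, T j x
        = ∑ x ∈ range N, ∑ τ ∈ S.pi R, f x * (Cf τ *
            (𝐞 ((x : ℝ) * ∑ j ∈ S.attach, ((σ j.1 (τ j.1 j.2) : ℝ) / P j.1)) : ℂ)) := by
          refine Finset.sum_congr rfl fun x _ => ?_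
          rw [hexpand, Finset.mul_sum]
      _ = ∑ τ ∈ S.pi R, ∑ x ∈ range N, f x * (Cf τ *
            (𝐞 ((x : ℝ) * ∑ j ∈ S.attach, ((σ j.1 (τ j.1 j.2) : ℝ) / P j.1)) : ℂ)) := Finset.sum_comm
      _ = ∑ τ ∈ S.pi R, Cf τ * Sg τ := by
          refine Finset.sum_congr rfl fun τ _ => ?_
          rw [hSg]; dsimp only; rw [Finset.mul_sum]
          refine Finset.sum_congr rfl fun x _ => ?_
          ring
  have hCf1 : ∀ τ ∈ S.pi R, ‖Cf τ‖ ≤ 1 := by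
    intro τ _
    rw [hCf]; dsimp only
    rw [norm_prod]
    calc ∏ j ∈ S.attach, ‖c j.1 (τ j.1 j.2)‖ ≤ ∏ _j ∈ S.attach, (1 : ℝ) :=
          Finset.prod_le_prod (fun _ _ => norm_nonneg _) fun j _ => (hpack j.1).1 _
      _ = 1 := Finset.prod_const_one
  have hpi_ne : (S.pi R).Nonempty := by
    rw [Finset.pi_nonempty]
    intro j _
    refine ⟨0, ?_⟩
    rw [hRdef]; dsimp only
    rw [Finset.mem_filter, Finset.mem_range]
    exact ⟨Nat.two_pow_pos _, by simp⟩
  obtain ⟨τ, hτ, hτge⟩ := exists_norm_ge_div_card (S.pi R) hpi_ne Sg Cf hCf1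
  rw [← hSTeq] at hτge
  -- the number of `τ`
  have hcardR : ∀ j, ((R j).card : ℝ) ≤ 3 * H₀ := by
    intro j
    have := card_filter_min_le (P j) H₀
    have h' : ((R j).card : ℝ) ≤ 2 * H₀ + 1 := by exact_mod_cast this
    have : (1 : ℝ) ≤ H₀ := by exact_mod_cast hH₀0
    linarith
  have hcardpi : ((S.pi R).card : ℝ) ≤ (3 * H₀) ^ k := by
    rw [Finset.card_pi, Nat.cast_prod, hkdef, ← Finset.prod_const]
    exact Finset.prod_le_prod (fun _ _ => Nat.cast_nonneg _) fun j _ => hcardR j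
  have hcardpos : (0 : ℝ) < (S.pi R).card := by exact_mod_cast hpi_ne.card_pos
  -- the frequency
  refine ⟨fun j => if hj : j ∈ S then σ j (τ j hj) else 0, ?_, ?_⟩
  · intro j hj
    dsimp only
    rw [dif_pos hj]
    have hmem : τ j hj ∈ R j := Finset.mem_pi.1 hτ j hj
    rw [hRdef] at hmem; dsimp only at hmem
    rw [Finset.mem_filter, Finset.mem_range] at hmem
    have habs : |((σ j (τ j hj) : ℤ) : ℝ)| = ((min (τ j hj) (P j - τ j hj) : ℕ) : ℝ) := by
      rw [hσdef]; dsimp only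
      split_ifs with hle
      · rw [min_eq_left (by omega)]; push_cast; exact abs_of_nonneg (Nat.cast_nonneg _)
      · have h1 : ((τ j hj : ℕ) : ℝ) ≤ P j := by exact_mod_cast hmem.1.le
        rw [min_eq_right (by omega)]
        have e1 : (((τ j hj : ℤ) - (P j : ℕ) : ℤ) : ℝ) = (τ j hj : ℝ) - P j := by push_cast; ring
        rw [e1, abs_of_nonpos (by linarith), Nat.cast_sub hmem.1.le]
        ring
    rw [habs]
    calc ((min (τ j hj) (P j - τ j hj) : ℕ) : ℝ) ≤ H₀ := by exact_mod_cast hmem.2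
      _ ≤ 2200 * k ^ 2 / δ ^ 2 := hH₀k
  · -- the exponential sum at `θ_τ`
    have hθ : ∑ j ∈ S, (((if hj : j ∈ S then σ j (τ j hj) else 0 : ℤ)) : ℝ) / 2 ^ ((j : ℕ) + 1) =
        ∑ j ∈ S.attach, ((σ j.1 (τ j.1 j.2) : ℝ) / P j.1) := by
      rw [← Finset.sum_attach S]
      refine Finset.sum_congr rfl fun j _ => ?_
      simp only [dif_pos j.2, hPdef, Nat.cast_pow, Nat.cast_ofNat]
    have hN : ((2 : ℝ)) ^ n = N := by rw [hNdef]; push_cast; ring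
    rw [hθ, hN]
    change δ / 2 * (δ ^ 2 / (6600 * (k : ℝ) ^ 2)) ^ k * N ≤ ‖Sg τ‖
    refine le_trans ?_ hτge
    rw [le_div_iff₀ hcardpos]
    -- `(δ/2)(δ²/(6600k²))^k N · card ≤ (δ/2)(δ²/(6600k²))^k N (3H₀)^k ≤ (δ/2) N ≤ ‖Σ_T‖`
    have h3H : (3 * (H₀ : ℝ)) * (δ ^ 2 / (6600 * (k : ℝ) ^ 2)) ≤ 1 := by
      calc (3 * (H₀ : ℝ)) * (δ ^ 2 / (6600 * (k : ℝ) ^ 2)) ≤ (3 * (2200 * k ^ 2 / δ ^ 2)) * (δ ^ 2 / (6600 * (k : ℝ) ^ 2)) := by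
            gcongr
        _ = 1 := by field_simp; ring
    have hpow : ((3 * (H₀ : ℝ)) * (δ ^ 2 / (6600 * (k : ℝ) ^ 2))) ^ k ≤ 1 := pow_le_one₀ (by positivity) h3H
    have hNn : (0 : ℝ) ≤ N := Nat.cast_nonneg N
    calc δ / 2 * (δ ^ 2 / (6600 * (k : ℝ) ^ 2)) ^ k * N * (S.pi R).card
        ≤ δ / 2 * (δ ^ 2 / (6600 * (k : ℝ) ^ 2)) ^ k * N * (3 * H₀) ^ k := by gcongr
      _ = δ / 2 * N * ((3 * (H₀ : ℝ)) * (δ ^ 2 / (6600 * (k : ℝ) ^ 2))) ^ k := by simp only [mul_pow]; ring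
      _ ≤ δ / 2 * N * 1 := mul_le_mul_of_nonneg_left hpow (by positivity)
      _ = δ / 2 * N := mul_one _
      _ ≤ _ := hST



/-! ### Green 2012, Proposition 1 for `λ` (assembly) -/

open Literature.Probability.RandomGraphs.LowDegree (walsh sgn)
open Literature.NumberTheory.Sieve.MoebiusWalsh (walshSum_eq_sum_range)

/-- The trivial bound `|walshSum g S| ≤ 2ⁿ` for `|g| ≤ 1`. [folklore] -/
theorem abs_walshSum_le {n : ℕ} (g : ℕ → ℤ) (hg : ∀ m, |(g m : ℝ)| ≤ 1) (S : Finset (Fin n)) :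
    |walshSum g S| ≤ 2 ^ n := by
  rw [walshSum_eq_sum_range]
  refine (Finset.abs_sum_le_sum_abs _ _).trans ?_
  have h : ∀ N ∈ range (2 ^ n), |(g N : ℝ) * walsh S (fun j : Fin n => N.testBit j)| ≤ 1 := by
    intro N _
    rw [abs_mul]
    have h2 : |walsh S (fun j : Fin n => N.testBit j)| ≤ 1 := by
      unfold walsh
      rw [Finset.abs_prod]
      refine Finset.prod_le_one (fun _ _ => abs_nonneg _) fun j _ => ?_
      unfold sgn
      split_ifs <;> norm_num
    calc |(g N : ℝ)| * |walsh S (fun j : Fin n => N.testBit j)| ≤ 1 * 1 :=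
          mul_le_mul (hg N) h2 (abs_nonneg _) zero_le_one
      _ = 1 := one_mul _
  refine (Finset.sum_le_sum h).trans ?_
  simp

/-- The Walsh sum of `λ` as the norm of a complex sum over `{0, …, 2ⁿ − 1}`. [folklore] -/
theorem abs_walshSum_liouville_eq {n : ℕ} (S : Finset (Fin n)) :
    |walshSum (fun m => liouville m) S| =
      ‖∑ x ∈ range (2 ^ n), ((liouville x : ℤ) : ℂ) *
        ((walsh S (fun i : Fin n => x.testBit i) : ℝ) : ℂ)‖ := by
  rw [walshSum_eq_sum_range, ← Real.norm_eq_abs, ← Complex.norm_real]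
  congr 1
  push_cast
  rfl


end GreenWalsh

open Literature.Probability.RandomGraphs.LowDegree (walsh sgn) in
/-- **Green 2012, Proposition 1 for the Liouville function** (discharge of the named fact
`green_liouville_fourierWalsh`): there are `c > 0` and `K` such that for every `n ≥ 1` and every
non-empty `S ⊆ {0, …, n−1}` with `|S| = k`,
`|Σ_{x ∈ {0,1}ⁿ} λ(val x) Π_{j∈S}(−1)^{x_j}| / 2ⁿ ≤ K k e^{−c√n/k}`.
Proof as printed (§4, "Proof of Proposition 1"): if the coefficient is `≥ δ2ⁿ`, Proposition 2
(`GreenWalsh.katai`) gives a sparse dyadic `θ = Σ_{j∈S} h_j/2^{j+1}` with `|h_j| ≤ 2200k²/δ²` and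
`|Σ_{x<2ⁿ} λ(x)e(θx)| ≥ (δ/2)(δ²/6600k²)^k 2ⁿ`, and Proposition 3 (`GreenWalsh.prop3_liouville`)
bounds the same sum by `K₁2ⁿe^{−c₁√log 2ⁿ}`; with `δ = Kke^{−c√n/k}`, `c = c₁√(log 2)/10`, `K ≥ 82`
the two are incompatible for `n` large, and small `n`, `k > c₅√n` are absorbed into `K`.
[cite: Green2012, Proposition 1; §1 (remark on `λ`)] -/
theorem green_liouville_fourierWalsh_holds : green_liouville_fourierWalsh := by
  obtain ⟨c₁, hc₁, c₅, hc₅, K₁, hK₁, n₀, hP3⟩ := GreenWalsh.prop3_liouville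
  have hlog2 : 0 < Real.log 2 := Real.log_pos one_lt_two
  have hsl : 0 < Real.sqrt (Real.log 2) := Real.sqrt_pos.2 hlog2
  set c : ℝ := c₁ * Real.sqrt (Real.log 2) / 10 with hcdef
  have hc0 : 0 < c := by positivity
  obtain ⟨L₀, hL₀, hgr⟩ := GreenWalsh.exists_pow_le_exp_sqrt (A := 2 * K₁ + 1) (a := 7 * c) (by positivity) (by positivity) 0
  set n₁ : ℕ := max (max n₀ 1) ⌈L₀⌉₊ with hn₁def
  set K : ℝ := max (max 82 (Real.exp (c / c₅))) (Real.exp (c * Real.sqrt n₁)) with hKdef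
  have hK82 : (82 : ℝ) ≤ K := (le_max_left _ _).trans (le_max_left _ _)
  have hK1 : (1 : ℝ) ≤ K := by linarith
  have hKc₅ : Real.exp (c / c₅) ≤ K := (le_max_right _ _).trans (le_max_left _ _)
  have hKn₁ : Real.exp (c * Real.sqrt n₁) ≤ K := le_max_right _ _
  have hKsq : (6600 : ℝ) ≤ K ^ 2 := by
    have := pow_le_pow_left₀ (by norm_num) hK82 2
    norm_num at this
    linarith
  have hn₁ge : max n₀ 1 ≤ n₁ := le_max_left _ _
  have hn₁ge' : ⌈L₀⌉₊ ≤ n₁ := le_max_right _ _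
  clear_value c K n₁
  refine ⟨c, hc0, K, fun n _hn S hS => ?_⟩
  set k : ℕ := S.card with hkdef
  have hk1 : 1 ≤ k := Finset.card_pos.2 hS
  have hk1r : (1 : ℝ) ≤ k := by exact_mod_cast hk1
  have hk0 : (0 : ℝ) < k := by linarith
  have h2n : (0 : ℝ) < 2 ^ n := by positivity
  have hsn : 0 ≤ Real.sqrt n := Real.sqrt_nonneg _
  have hW : |walshSum (fun m => liouville m) S| ≤ 2 ^ n :=
    GreenWalsh.abs_walshSum_le _ (fun m => LiouvilleSum.abs_liouville_le_one m) S
  set δ : ℝ := K * k * Real.exp (-(c * Real.sqrt n / k)) with hδdef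
  have hδ0 : 0 < δ := by positivity
  clear_value δ
  rw [div_le_iff₀ h2n]
  by_contra hcon
  rw [not_le] at hcon
  -- `δ < 1`
  have hδ1 : δ < 1 := by
    by_contra h1
    rw [not_lt] at h1
    exact lt_irrefl _ (hcon.trans_le (hW.trans (le_mul_of_one_le_left h2n.le h1)))
  -- a lower bound `K e^{-x} ≤ δ` whenever `c√n/k ≤ x`
  have hδge : ∀ x : ℝ, c * Real.sqrt n / k ≤ x → K * Real.exp (-x) ≤ δ := by
    intro x hx
    calc K * Real.exp (-x) ≤ K * Real.exp (-(c * Real.sqrt n / k)) :=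
          mul_le_mul_of_nonneg_left (Real.exp_le_exp.2 (by linarith)) (by linarith)
      _ = K * Real.exp (-(c * Real.sqrt n / k)) * 1 := (mul_one _).symm
      _ ≤ K * Real.exp (-(c * Real.sqrt n / k)) * k :=
          mul_le_mul_of_nonneg_left hk1r (by positivity)
      _ = δ := by rw [hδdef]; ring
  have hKexp : ∀ x : ℝ, Real.exp x ≤ K → 1 ≤ K * Real.exp (-x) := by
    intro x hx
    have := mul_le_mul_of_nonneg_right hx (Real.exp_pos (-x)).le
    rwa [← Real.exp_add, add_neg_cancel, Real.exp_zero] at this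
  -- `k ≤ c₅ √n`
  have hkc₅ : (k : ℝ) ≤ c₅ * Real.sqrt n := by
    by_contra hlt
    rw [not_le] at hlt
    have hlt' : Real.sqrt n < k / c₅ := by rw [lt_div_iff₀ hc₅]; linarith
    have h1 : c * Real.sqrt n / k < c / c₅ := by
      rw [div_lt_iff₀ hk0]
      calc c * Real.sqrt n < c * (k / c₅) := mul_lt_mul_of_pos_left hlt' hc0
        _ = c / c₅ * k := by ring
    have h2 := hδge (c / c₅) h1.le
    have h3 := hKexp (c / c₅) hKc₅
    linarith
  -- `n₁ ≤ n`
  have hn₁n : n₁ ≤ n := by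
    by_contra hlt
    rw [not_le] at hlt
    have hsq : Real.sqrt n ≤ Real.sqrt n₁ := Real.sqrt_le_sqrt (by exact_mod_cast hlt.le)
    have h1 : c * Real.sqrt n / k ≤ c * Real.sqrt n₁ :=
      calc c * Real.sqrt n / k ≤ c * Real.sqrt n := div_le_self (by positivity) hk1r
        _ ≤ c * Real.sqrt n₁ := mul_le_mul_of_nonneg_left hsq hc0.le
    have h2 := hδge _ h1
    have h3 := hKexp _ hKn₁
    linarith
  have hn₀n : n₀ ≤ n := le_trans ((le_max_left _ _).trans hn₁ge) hn₁n
  have hL₀n : L₀ ≤ n := by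
    have h1 : ⌈L₀⌉₊ ≤ n := hn₁ge'.trans hn₁n
    exact (Nat.le_ceil L₀).trans (by exact_mod_cast h1)
  -- Proposition 2 (Kátai)
  have hf : ∀ x, ‖((liouville x : ℤ) : ℂ)‖ ≤ 1 := fun x => by
    rw [Complex.norm_intCast]; exact LiouvilleSum.abs_liouville_le_one x
  have hbig : δ * 2 ^ n ≤ ‖∑ x ∈ range (2 ^ n), ((liouville x : ℤ) : ℂ) *
      ((walsh S (fun i : Fin n => x.testBit i) : ℝ) : ℂ)‖ := by
    rw [← GreenWalsh.abs_walshSum_liouville_eq]; exact hcon.le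
  obtain ⟨h, hh, hΦ⟩ := GreenWalsh.katai S hS (fun x => ((liouville x : ℤ) : ℂ)) hf hδ0 hδ1.le hbig
  -- the numerators are `≤ e^{c₁√log N}`
  have hs : Real.sqrt (Real.log ((2 : ℝ) ^ n)) = Real.sqrt n * Real.sqrt (Real.log 2) := by
    rw [Real.log_pow, Real.sqrt_mul' _ hlog2.le]
  have hδsq : δ ^ 2 = K ^ 2 * (k : ℝ) ^ 2 * Real.exp (-(2 * c * Real.sqrt n / k)) := by
    rw [hδdef, show -(2 * c * Real.sqrt n / k) = -(c * Real.sqrt n / k) + -(c * Real.sqrt n / k) by ring,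
      Real.exp_add]
    ring
  have hee : Real.exp (2 * c * Real.sqrt n / k) * Real.exp (-(2 * c * Real.sqrt n / k)) = 1 := by
    rw [← Real.exp_add, add_neg_cancel, Real.exp_zero]
  have hnum : 2200 * (k : ℝ) ^ 2 / δ ^ 2 ≤ Real.exp (2 * c * Real.sqrt n / k) := by
    rw [div_le_iff₀ (by positivity), hδsq,
      show Real.exp (2 * c * Real.sqrt n / k) * (K ^ 2 * (k : ℝ) ^ 2 * Real.exp (-(2 * c * Real.sqrt n / k)))
        = (Real.exp (2 * c * Real.sqrt n / k) * Real.exp (-(2 * c * Real.sqrt n / k))) * (K ^ 2 * (k : ℝ) ^ 2) by ring,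
      hee, one_mul]
    exact mul_le_mul_of_nonneg_right (by linarith) (sq_nonneg (k : ℝ))
  have hnum2 : Real.exp (2 * c * Real.sqrt n / k) ≤ Real.exp (c₁ * Real.sqrt (Real.log ((2 : ℝ) ^ n))) := by
    apply Real.exp_le_exp.2
    rw [hs]
    have h0 : 0 ≤ c₁ * Real.sqrt n * Real.sqrt (Real.log 2) := by positivity
    calc 2 * c * Real.sqrt n / k ≤ 2 * c * Real.sqrt n := div_le_self (by positivity) hk1r
      _ = (1 / 5) * (c₁ * Real.sqrt n * Real.sqrt (Real.log 2)) := by rw [hcdef]; ring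
      _ ≤ 1 * (c₁ * Real.sqrt n * Real.sqrt (Real.log 2)) := by gcongr; norm_num
      _ = c₁ * (Real.sqrt n * Real.sqrt (Real.log 2)) := by ring
  have hnumer : ∀ j ∈ S, |(h j : ℝ)| ≤ Real.exp (c₁ * Real.sqrt (Real.log ((2 : ℝ) ^ n))) :=
    fun j hj => (hh j hj).trans (hnum.trans hnum2)
  -- Proposition 3
  have hup := hP3 n hn₀n S hk1 hkc₅ h hnumer
  have hmain : δ / 2 * (δ ^ 2 / (6600 * (k : ℝ) ^ 2)) ^ k ≤
      K₁ * Real.exp (-(c₁ * Real.sqrt (Real.log ((2 : ℝ) ^ n)))) := by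
    have h' := hΦ.trans hup
    refine le_of_mul_le_mul_right ?_ h2n
    calc δ / 2 * (δ ^ 2 / (6600 * (k : ℝ) ^ 2)) ^ k * 2 ^ n
        ≤ K₁ * (2 : ℝ) ^ n * Real.exp (-(c₁ * Real.sqrt (Real.log ((2 : ℝ) ^ n)))) := h'
      _ = K₁ * Real.exp (-(c₁ * Real.sqrt (Real.log ((2 : ℝ) ^ n)))) * 2 ^ n := by ring
  -- lower bounds for the left-hand side
  have hδlow : Real.exp (-(c * Real.sqrt n)) ≤ δ := by
    have h1 := hδge (c * Real.sqrt n) (div_le_self (by positivity) hk1r)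
    have h2 : Real.exp (-(c * Real.sqrt n)) ≤ K * Real.exp (-(c * Real.sqrt n)) :=
      le_mul_of_one_le_left (Real.exp_pos _).le hK1
    exact h2.trans h1
  have hXlow : Real.exp (-(2 * c * Real.sqrt n / k)) ≤ δ ^ 2 / (6600 * (k : ℝ) ^ 2) := by
    rw [le_div_iff₀ (by positivity), hδsq]
    have hE := (Real.exp_pos (-(2 * c * Real.sqrt n / k))).le
    calc Real.exp (-(2 * c * Real.sqrt n / k)) * (6600 * (k : ℝ) ^ 2)
        = 6600 * ((k : ℝ) ^ 2 * Real.exp (-(2 * c * Real.sqrt n / k))) := by ring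
      _ ≤ K ^ 2 * ((k : ℝ) ^ 2 * Real.exp (-(2 * c * Real.sqrt n / k))) :=
          mul_le_mul_of_nonneg_right hKsq (mul_nonneg (sq_nonneg _) hE)
      _ = K ^ 2 * (k : ℝ) ^ 2 * Real.exp (-(2 * c * Real.sqrt n / k)) := by ring
  have hpow : Real.exp (-(2 * c * Real.sqrt n)) ≤ (δ ^ 2 / (6600 * (k : ℝ) ^ 2)) ^ k := by
    have hp := pow_le_pow_left₀ (Real.exp_pos _).le hXlow k
    have he : Real.exp (-(2 * c * Real.sqrt n / k)) ^ k = Real.exp (-(2 * c * Real.sqrt n)) := by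
      rw [← Real.exp_nat_mul]
      congr 1
      field_simp
    rwa [he] at hp
  have hlow : Real.exp (-(c * Real.sqrt n)) / 2 * Real.exp (-(2 * c * Real.sqrt n)) ≤
      δ / 2 * (δ ^ 2 / (6600 * (k : ℝ) ^ 2)) ^ k :=
    mul_le_mul (by linarith) hpow (Real.exp_pos _).le (by positivity)
  -- comparison of the two sides
  have hcs : c₁ * Real.sqrt (Real.log ((2 : ℝ) ^ n)) = 10 * c * Real.sqrt n := by
    rw [hs, hcdef]
    ring
  rw [hcs] at hmain
  have hfin := hlow.trans hmain
  have hprod : Real.exp (-(c * Real.sqrt n)) / 2 * Real.exp (-(2 * c * Real.sqrt n)) =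
      Real.exp (7 * c * Real.sqrt n) / 2 * Real.exp (-(10 * c * Real.sqrt n)) := by
    rw [div_mul_eq_mul_div, div_mul_eq_mul_div, ← Real.exp_add, ← Real.exp_add]
    congr 2
    ring
  rw [hprod] at hfin
  have hEpos : 0 < Real.exp (-(10 * c * Real.sqrt n)) := Real.exp_pos _
  have h7 : Real.exp (7 * c * Real.sqrt n) / 2 ≤ K₁ := by
    refine le_of_mul_le_mul_right ?_ hEpos
    linarith [hfin]
  have hgrow : 2 * K₁ + 1 ≤ Real.exp (7 * c * Real.sqrt n) := by
    have := hgr n hL₀n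
    simpa using this
  linarith

end Literature.NumberTheory.LFunctions
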